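import Literature.MathematicalPhysics.QuantumFieldTheory.Balaban1983to89.Beta.AssemblyRemainder
import Literature.MathematicalPhysics.QuantumFieldTheory.Balaban1983to89.Beta.DriftRemainder
import Literature.MathematicalPhysics.QuantumFieldTheory.Balaban1983to89.Beta.RateCertificate
import Literature.MathematicalPhysics.QuantumFieldTheory.Balaban1983to89.Beta.RemainderChainTorus
import Literature.MathematicalPhysics.QuantumFieldTheory.Balaban1983to89.Beta.RemainderConstNumerals

/-!
# `Balaban1983to89.Beta.RemainderConstCertified` — the THREE-LANE ASSEMBLY of the β sub-cell in the CONSTANT-FORM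
remainder socket: (cap) finitely many certified finite-k values of the one-loop coefficients + (asym) a rate for the
one-loop coefficients with ONE certified value ⟹ a k-uniform FLOOR `f ≤ β⁰_{k+1}`; (asym2 / an4) the k-uniform
constant-form remainder bound `RemainderConst S γ₀ r` (printed chain, `r = ε₁·K_rem,L`) with `r < f` ⟹
`β_{k+1} ≥ f − r > 0` on every box ⟹ Theorem 2 as printed / endpoint existence / discrete asymptotic freedom
(β sub-cell of the audit cell `pub-balaban`, asymptotic lane asym2, journal node BETA-asym2-CERTIFIED-ASSEMBLY)

HONEST FRAMING (cell rule, verbatim, page 1 of everything the β sub-cell writes): discharging `BetaPertH` makes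
Bałaban's UV stability UNCONDITIONAL — a real constructive-QFT result; it is NOT the continuum limit and NOT the Clay
problem.  THIS MODULE DISCHARGES NOTHING of the series: it is `[folklore]` algebra of inequalities joining, BY NAME,
hypothesis carriers and theorems already in the tree (`Beta.Assembly`, `Beta.AssemblyRemainder`, `Beta.RateCertificate`,
`Beta.Certified`, `Beta.RemainderChain`, `Beta.RemainderChainLattice`, `Beta.RemainderChainTorus`,
`Beta.RemainderConstNumerals`, `FlowStepRuns`), none of which is modified.  Every analytic, computational and modelling
input is a HYPOTHESIS BINDER labelled below; nothing printed by Bałaban is asserted.  Value = kernel-checked bookkeeping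
(the missing socket between the certified × asymptotic lanes and the constant-form remainder), NOT summit progress.

ABSOLUTE RULE (cell charter, verbatim): "No internally-minted statement may enter as a cited fact.  Every hypothesis is
either kernel-proved in this package or a verbatim quotation of a PUBLISHED theorem with page reference.  The
manuscript(s) under audit are NOT citable for their own disputed steps — they are the thing under adjudication;
programme-internal (2001/route/tribunal) claims are never citable."  The `[cite: …]` tags below are CONTEXT ONLY (they
say which printed display a hypothesis shape or a conclusion types); no tag imports a fact.

CITATION HEADER (lean-in-tree rule 2026-08-18).  T. Bałaban, *Renormalization group approach to lattice gauge field
theories. I. Generation of effective actions in a small field approximation and a coupling constant renormalization in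
four dimensions*, Commun. Math. Phys. **109**, 249–301 (1987) [Balaban1987RG1] (cell paper B12, [I]): p. 259 Theorem 2
with (0.31) (typed `B12.Thm2Printed`); p. 264 (1.20)–(1.22) (the one-loop coefficient, typed `B12Beta.secondMoment`) and
§1 p. 263–264 ("uniformly bounded", smoothness in the couplings: the shapes `FlowStep.BetaUpperH`, `FlowStep.BetaContH`);
p. 268 (2.12)–(2.14) (the one-loop split, typed `B12Beta.OneLoopSplit`); p. 293 (5.10).  T. Bałaban, *Renormalization
group approach to lattice gauge field theories. II. Cluster expansions*, Commun. Math. Phys. **116**, 1–22 (1988)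
[Balaban1988RG2Cluster] (cell paper B13, [II]): p. 20 Lemma 3 (2.38); p. 21: "for κ sufficiently large, and ε₁
sufficiently small" (before (2.40)), (2.41), and the closing relation and the assumption `O(1)C₃ε₁ ≤ ½E₀` after it.
NO `η = L^{−k} → 0` convergence statement (with or without rate) for
the coefficients (1.22), NO lower bound `β ≥ b > 0` and NO finite-k value is printed in the series (cell records
HOME/BETA-SPEC.md §0.3, HOME/BETA/WALL.md §4): these are the located OPEN inputs of the three lanes and enter below only
as binders.

## Why this module exists (the socket mismatch it closes)

The asymptotic lane's `Beta.RateCertificate` (§3 `limitFormOfCertified`, `thm2Printed_of_certified`,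
`thm2Printed_of_smallKCert`, `betaAFH_of_certified`, …) and the certified lane's export `Beta.Certified`
(`thm2Printed_of_cert`, …) go through `Beta.Assembly.LimitForm`, whose remainder field is the LINEAR form (AF-1)
`|β¹_{k+1}(p)| ≤ Cr·p_k` — located for (1.22) at the UNPRINTED cubic insertion (cell record BETA/AN4.md (P1)) and supplied
by no delivered grade.  What the printed chain [II] (2.38)/(2.41) → [I] (4.3)–(4.5), (4.37), (5.10) → (1.22) delivers
(rows an4 / asym2: `RemainderChainLattice.ChainL.abs_beta1_le`, `RemainderChainTorus.ChainT.abs_beta1_le`, modulo the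
printed leaves carried as fields of the chain) is the CONSTANT form `RemainderConst S γ₀ (ε₁·K_rem,L)`, whose
coefficient `K_rem,L = remCoeffL d M c α₂ B₃` is k-FREE by closed formula (`RemainderChainLattice.remCoeffL`, numerals
`RemainderConstNumerals`; lane verdict BETA/ASYM2.md §0: for this constant the template "certified for k ≤ k₀, proved
for k ≥ k₀" is void — one closed form serves every k).  `Beta.AssemblyRemainder` feeds the constant form into the
minimal carrier `EventualForm`, but from the exact limit value (`0 < β⁰_∞` a hypothesis, `k₀` existential).  The one
theorem the coordinator's sentence asks for — *{certified finite-k values} + {rate ⟹ tail} + {RemainderConst uniform}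
⟹ the END statement* — was therefore not a kernel theorem before this file.  It is now, with every threshold explicit.

## Content ([folklore] throughout; section numbers = the section headers below)

1. FLOORS of a real sequence `b` (standing for `S.β0`) from `RateCertificate.GeomRate b binf c₀ θ` (`0 ≤ θ ≤ 1`,
   `binf` ANY real, never assumed positive) and certificates: `tail_floor_of_cert` — ONE certified lower value
   `m ≤ b k₁` and an index `k₂` passing the decidable test `c₀θ^{k₂} ≤ (m − c₀θ^{k₁})/4` give
   `3(m − c₀θ^{k₁})/4 ≤ b k` for every `k ≥ k₂` (the coordinator's "`betaBar_pos_of_ge k₀`", quantitative);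
   `floor_of_cert` — with the certified list `m₀ ≤ b k` (`k < k₂`; the coordinator's "`oneLoopCoeff_k_pos, k ≤ k₀`",
   quantitative) the UNIFORM floor `min m₀ (3(m − c₀θ^{k₁})/4) ≤ b k` for all k.
2. β-LEVEL: a floor `f ≤ β⁰_{k+1}` and `RemainderConst S γ₀ r` give `FlowStep.BetaLowerH (f − r) γ₀ β`
   (`betaLowerH_of_floor_const`; tail version `betaLowerTail_of_floor_const`) — no γ-shrinking of the box, no Lipschitz
   constant, no sign of any limit; the smallness spent is `r < f`, i.e. on ε₁ ("ε₁ sufficiently small", [II] p. 21).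
3. END SOCKETS, floor form: `eventualFormOfFloorConst` (the minimal carrier `Assembly.EventualForm β`, `b = f − r`),
   `thm2Printed_of_floor_const` (`B12.Thm2Printed C L`, Theorem 2 as printed), `betaAFH_of_floor_const` (`BetaAFH β`).
4. THE CERTIFIED INSTANTIATION (the three lanes joined): `eventualFormOfCertifiedConst`,
   `endpointExistence_of_certifiedConst`, `thm2_fineLattices_of_certifiedConst`, `betaLowerH_of_certifiedConst`,
   `thm2Printed_of_certifiedConst`, `betaAFH_of_certifiedConst`; the drop-in twin of asym1's binder list
   `thm2Printed_of_certified_const` ((hCr, haf1) ↦ (hrem, hr); its `hgap` is implied); the Cauchy-rate twin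
   `thm2Printed_of_cauchyCertifiedConst` (no limit value among the hypotheses); the cap3-carrier twin
   `thm2Printed_of_smallKCertConst` (`c : Certified.SmallKCert S.β0 binf`).
5. CHAIN LEVEL: the remainder slot filled by a window chain `R : ChainL d M μ ν S γ₀ c ℓ α₂ B₃` or a torus chain
   `ChainT` (the printed leaves BY NAME as fields) under the four numeric conditions `CondsL`, the closing relation
   `R22gen`, the printed signs `SignsL` and the printed-type restriction `ε₁·K_rem,L < floor`:
   `thm2Printed_of_certifiedChainL` / `…ChainT`, `endpointExistence_of_certifiedChainL` / `…ChainT`, the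
   elementary-coefficient form `thm2Printed_of_certifiedChainL_elem` (`RemainderConstNumerals.elemCoeffL`, no infinite
   sum left); `floor_pos_of_gap`, `exists_eps1_lt` (the restriction is a satisfiable NUMERIC condition once the floor is
   positive — it is of the printed type "ε₁ sufficiently small" ([II] p. 21, before (2.40); «given the preceding
   constants» is OUR gloss of the order of choices, not print); whether Bałaban's inductive construction runs at that
   ε₁ is the content of the leaves, not of this remark).
6. NON-VACUITY: the joint hypotheses of §4 are satisfiable (`Witness.eventualFormOne` on `Assembly.Witness.splitOne`; the bare
   `Nonempty (EventualForm constOne)` is already `Assembly.Witness.ofConvConst_nonvacuous` and is not restated).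
7. (v1.1) MARGIN × CONSTANT REMAINDER — the constant-form twins of `RateCertificate` §7 (margin form) and §8 (strip
   socket), i.e. the agreed cap × asym interlock (LOWER certified values `m ≤ β⁰_{k+1}` for `k ≤ k₁` only) on the
   constant road: the floor `m − c₀θ^{k₁}(1 + θ) ≤ β⁰_{k+1}` for ALL k (`GeomRate.lower_of_list`) into §2/§3 with
   `k₀ = 0`; the SINGLE numeric condition is `r < m − c₀θ^{k₁}(1 + θ)` (≡ `c₀θ^{k₁}(1 + θ) + ε₁·K_rem,L < m`); the box
   `]0,γ₀]` is NOT shrunk (no `marginBox`: the constant road spends ε₁, not γ); asym1's gap is implied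
   (`marginGap_of_marginConst`).  `betaLowerH_of_marginConst`, `beta_pos_all_of_marginConst`,
   `eventualFormOfMarginConst` (+ `_consts`), `endpointExistence_of_marginConst`, `thm2Printed_of_marginConst` /
   `_of_cauchyMarginConst` / `_of_symbolMarginConst` / `_of_stripMarginConst`, `betaAFH_of_marginConst`,
   `exists_eps1_lt_margin`; chain level `thm2Printed_of_marginChainL` / `…ChainT` / `…ChainL_elem`,
   `endpointExistence_of_marginChainL` / `…ChainT` (the an4 carriers `RemainderLimitTorus.ChainTLoc` /
   `RemainderLocality.ChainTFac` conclude the same `RemainderConst` by their own `abs_beta1_le` and plug into the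
   β-level sockets verbatim — not imported here); non-vacuity on the scale-dependent family `Witness.geomFamily`
   (`β_{k+1} ≡ 1 + 2^{−k}`; certified depth `k₁ = 1` needed, `Witness.marginConst_depth`).
8. (v1.2) REAL-ZONE × CONSTANT and BLOCK-TRANSFER × CONSTANT — the constant-form twins of `RateCertificate` §9 (real-zone
   socket: a REAL-momentum step rate + the uniform strip bound, Hadamard three lines) and §10 (block transfer: `n` steps
   of block size `L` versus one step of block size `L' = Lⁿ`, under asym1's located COMPOSITION HYPOTHESIS
   `S.β0 k = blockSum n b k`, Q-asym1-5 — a binder, not printed, not asserted), binder lists = asym1's with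
   `(hgap, hCr, haf1)` ↦ `(hrem, hr)`: `thm2Printed_of_realMarginConst` (+ `_decay`: strip bound and moments discharged
   from (5.10) constants), `betaLowerH_of_realMarginConst`; `cauchyRate_of_block`, `list_of_block`,
   `betaLowerH_of_blockMarginConst`, `thm2Printed_of_blockMarginConst`, `endpointExistence_of_blockMarginConst`, chain
   level `thm2Printed_of_blockMarginChainL` (the chain AT the large block size); the fine-lattice half of (0.31) on the
   margin × constant road WITH NO THRESHOLD (`thm2_fineLattices_of_marginConst`: `k₀ = 0`, every `K`, every
   `0 < g ≤ γ ≤ γ₀`); non-vacuity with a scale-dependent block-sum split (`Witness.blockMarginConst_nonvacuous`).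
9. (v1.3) NEAR-SEQUENCE TRANSFER × CONSTANT — the constant-form twins of `RateCertificate` v1.7 §11 (the INEQUALITY form
   of the composition hypothesis: a rate `GeomRate a binf c₀ θ` and a one-sided certified list `m ≤ a k (k ≤ k₁)` for a
   COMPARISON sequence `a` transfer to `S.β0` along the located nearness `NearRate a S.β0 e θ` — the one-loop
   scheme-transfer rate, asym1's Q-asym1-5 in inequality form, a binder, NOT printed, NOT asserted; `e = 0` is §8's
   `hblock`), binder lists = asym1's with `(hgap, hCr, haf1)` ↦ `(hrem, hr)`, the ONE condition
   `r < m − e − (c₀ + e)θ^{k₁}(1 + θ)` (≡ `(c₀ + e)θ^{k₁}(1 + θ) + e + ε₁·K_rem < m`: the nearness constant is paid twice):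
   `nearMarginGap_of_nearMarginConst` (asym1's near gap is implied), `betaLowerH_of_nearMarginConst`,
   `beta_pos_all_of_nearMarginConst`, `beta0_pos_all_of_nearMarginConst`, `endpointExistence_of_nearMarginConst`,
   `thm2Printed_of_nearMarginConst`, `betaAFH_of_nearMarginConst`, `thm2_fineLattices_of_nearMarginConst` (no threshold);
   the DECOUPLED form `thm2Printed_of_depthMarginConst` (asym1's rate for `S.β0` itself + a one-sided discrepancy
   `a k − e ≤ S.β0 k` at the certified depths `k ≤ k₁` only + certificates for `a`; `e` paid once; HONEST NOTE of §9: for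
   `θ < 1` a `NearRate` to a converging comparison sequence CONTAINS a rate for `S.β0` — the near road relocates asym1's
   rate question, it does not remove it), `list_of_depthDiscrepancy`, `depthDiscrepancy_of_nearRate`;
   the GENUINE block-size-`Lⁿ` step from small-block data (`CauchyRate b a θ`, nearness to the block sums with ratio `θⁿ`):
   `betaLowerH_of_blockNearMarginConst`, `thm2Printed_of_blockNearMarginConst`, `endpointExistence_of_blockNearMarginConst`,
   the `e = 0` consistency form `thm2Printed_of_blockMarginConst'`; chain level `thm2Printed_of_nearMarginChainL`,
   `thm2Printed_of_blockNearMarginChainL` (the chain AT the construction's block size); non-vacuity with a genuine nearness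
   (`Witness.nearMarginConst_nonvacuous`, `S.β0 ≠ a`).
10. (v1.4) CUMULATIVE (PARTIAL-SUM) SCHEME / L-TRANSFER DEFECT × CONSTANT — asym2's β-level side of the cell lead's
    RULING (R19) («the L-transfer at EXISTENCE grade is the wall's (D1) binder twice, not a new item»): the hypothesis
    shape `CumNear a b Γ := ∀ k, |Σ_{j<k} b j − Σ_{j<k} a j| ≤ Γ` (cumulative nearness — the grade of (D1) and of the
    conclusion of the lead's `ScalewiseVectorSeam.lTransfer_flowSum_le_of_hU`; `Γ = 0` is §8's `hblock`, `Γ = e/(1 − ϑ)`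
    §9's `NearRate`; row an2's telescoped scheme term, `CumNear.telescoped`; NOT printed, a binder, never asserted), its
    algebra (`CumNear.const_nonneg/symm/mono/of_eq/telescoped/of_telescoped/abs_sub_le/lower/drift`,
    `cumNear_of_nearRate`, `sum_range_mul_eq_sum_blockSum`, `cumNear_blockSum_of_flowSums`), and the constant remainder
    behind it at the two grades the cell distinguishes: END grade with NO condition on `Γ` (drift transport into row
    an4's `Beta.DriftRemainder` sockets, imported BY NAME: `oneLoopDrift_of_cumNear`,
    `betaPartialSumsLowerH_of_cumNearConst`, `endpointExistence_of_cumNearConst`, `p355Unconditional_of_cumNearConst`,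
    the block road `endpointExistence_of_blockCumNearConst`, the (R19) conclusion shape itself as the binder
    `endpointExistence_of_lTransferConst`, chain level `endpointExistence_of_cumNearChainL`) and Theorem-2-printed grade
    with the ONE condition `c₀θ^{k₁}(1 + θ) + 2Γ + r < m` (`betaLowerH_of_cumNearMarginConst`,
    `thm2Printed_of_cumNearMarginConst`, `betaAFH_of_cumNearMarginConst`); non-vacuity with an OSCILLATING defect
    (`Witness.cumNearConst_nonvacuous`: `|S.β0 k − a k| = 1/4` for every k).
11. (v1.4) EVENTUAL RATE × CONSTANT — the constant-form twins of `RateCertificate` v1.8 §12 (the rate owed from a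
    threshold scale `k₁` on only, `EvGeomRate S.β0 binf c₀ θ k₁`; below it the one-sided certified list for every
    `k ≤ k₁`; the SAME floor `m − c₀θ^{k₁}(1 + θ)`, `EvGeomRate.lower_of_list`): `endpointExistence_of_floor_const` (the
    END socket of §3's floor road), `betaLowerH_of_evMarginConst`, `beta_pos_all_of_evMarginConst`,
    `endpointExistence_of_evMarginConst`, `thm2Printed_of_evMarginConst`, `thm2Printed_of_evCauchyMarginConst`,
    `betaAFH_of_evMarginConst`, chain level `thm2Printed_of_evMarginChainL`, `endpointExistence_of_evMarginChainL`;
    non-vacuity with a rate that FAILS below the threshold (`Witness.evMarginConst_nonvacuous`).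
12. (v1.5) POINTER, no declaration: (U) DERIVED — on every road above whose rate binder is TWO-SIDED (§§4–11; not
    the bare floor road of §3 ∕ §11) the printed-type upper bound `hup : BetaUpperH β' γ₀ β` (and `hβ'`, `hlo`) is NOT
    an independent input: it follows from the rate and the remainder bound (`β_{k+1} ≤ β⁰_∞ + c₀ + r`).  The `hup`-free
    twins of the END ∕ Theorem-2-printed sockets (suffix `_cont`; asym2's side of row an4's `Beta.DriftRemainder` v1.1
    §6) live in the COMPANION LEAF `Beta.RemainderConstUpperDerived` (same writer; split off because this file is at
    the gate's file-size cap), e.g. `RemainderConstUpperDerived.thm2Printed_of_certifiedChainL_cont`.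

## The coordinator's sentence, binder by binder (VERDICT of lane asym2, RULING (R15) census form)

"assemble `betaPertH_holds` from {`oneLoopCoeff_k_pos`, k ≤ k₀} + `betaBar_pos_of_ge k₀` + `RemainderConst` uniform —
or state precisely which piece is still open."  The kernel theorem is `thm2Printed_of_certifiedChainL` (conclusion
`B12.Thm2Printed C L`, Theorem 2 AS PRINTED, (0.31) p. 259) resp. `endpointExistence_of_certifiedChainL` (the END
statement `DagBinding.EndpointExistence C`).  The NAME `betaPertH_holds` is NOT delivered and must not be (R15-2(d)):
`FlowStep.BetaPertH` is the rigid `O(γ²)` typing, which forces a k-independent one-loop coefficient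
(`BetaPertRigid.beta0_eq_of_pert`) and is presumably false for (1.22); the sub-cell's END statements are the ones
above.  Binders of `thm2Printed_of_certifiedChainL`, each with its STATUS:
* `hgen : ForwardGenerated C β` — MODELLING of (0.17)–(0.20) pp. 255–256 (the runs are generated forward by the β-functions);
  `hL : 1 < L` — printed standing assumption (p. 251: L odd > 11).
* `hconv : GeomRate S.β0 binf c₀ θ`, `hθ0`, `hθ1` — asym lane (asym1), LOCATED-UNPRINTED (no convergence statement for
  (1.22) in [I]–[III]; cell item O-asym1-1); `binf` is any real: its sign is never assumed here.
* `hcert : m ≤ S.β0 k₁`, `hsmall : ∀ k < k₂, m₀ ≤ S.β0 k` — cap lanes (cap1/cap2 engines, cap3 carrier),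
  COMPUTATIONAL LEAVES (certified enclosures produced outside the kernel; none is in the tree for Bałaban's split at
  the time of writing — cell referee item R-cap-8); `hk₂` — a decidable comparison of the lanes' rationals.
* `R : ChainL …`, `hC : CondsL d c ℓ`, `h22 : c.R22gen ℓ`, `hs : SignsL c α₂ B₃`, `hd`, `hM` — an4/asym2 lane: the
  chain's FIELDS are the printed leaves ([II] Lemma 3 (2.38) p. 20 for the localized kernels, the representation
  (1.20)–(1.22), the (5.10)-type decay), carried BY NAME and NOT proved in the tree (wall item (D4)); the numeric
  conditions are k-free thresholds in closed form (`RemainderConstNumerals.condsL_four_iff_numerals`).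
* `hε₁ : c.ε₁ * remCoeffL d M c α₂ B₃ < min m₀ (3(m − c₀θ^{k₁})/4)` — the printed-TYPE restriction "ε₁ sufficiently
  small" ([II] p. 21), here against the certified floor; numerically satisfiable (`exists_eps1_lt`), k-free.
* `hcont : BetaContH γ₀ β` — (C) joint continuity, LOCATED-UNPRINTED beyond the p. 263–264 assertion (wall item (D5)).
* `hup : BetaUpperH β' γ₀ β` — (U) the printed uniform upper bound (p. 264 with (5.10), (5.42)), as a binder;
  since v1.5 known NOT to be an independent input on this road: DERIVED from `hconv` (two-sided) and the remainder
  bound (`RemainderConstUpperDerived.thm2Printed_of_certifiedChainL_cont`, the same theorem without this line).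
STILL OPEN for an unconditional Theorem 2 (precisely): the rate `hconv` (asym1), the certificates `hcert`/`hsmall`
(cap), the chain leaves inside `R` (D4), and (C) `hcont` (D5).  Closed here: the ASSEMBLY — no further hypothesis
(no `0 < β⁰_∞`, no identification `β⁰_∞ = stepBal N L`, no (AF-1), no γ-shrinking) stands between those four inputs
and `B12.Thm2Printed C L`.

VERSIONS.  v1 (p184438, 73e855feedc7): §§1–6.  v1.1 (APPEND-ONLY — no v1 declaration, statement or docstring line
touched): §7, the margin × constant twins answering asym1's margin form (`RateCertificate` v1.3/v1.4), whose glue "must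
live on asym2's side of the import arrow" (cell journal); `thm2Printed_of_marginChainL` joins the binder census above
with `(hcert, hk₂, hsmall, hε₁ < min …)` replaced by `(hlist, hε₁ < m − c₀θ^{k₁}(1 + θ))`.  v1.2 (APPEND-ONLY for
declarations: no v1/v1.1 statement or proof touched; DOCFIX of two cite LOCATORS and of the citation header's p. 21
clause — the words "ε₁ sufficiently small" stand BEFORE (2.40), the closing assumptions after (2.41); cell cross-read
records REFEREE5 #138/#141 R2): §8, the constant-form twins of `RateCertificate` v1.5 §9 (real-zone socket) and v1.6 §10
(block transfer) and the threshold-free fine-lattice form; `thm2Printed_of_blockMarginChainL` joins the binder census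
above at the LARGE block size `L'` with `(hconv, hθ0, hθ1)` replaced by the small-block `(hn, hrate : CauchyRate b a θ,
hθ0, hθ1)` plus the composition hypothesis `hblock` (LOCATED, NOT printed — one more open input on that road, asym1's
Q-asym1-5) and `hlist` by small-block block-sum certificates.  v1.3 (APPEND-ONLY for declarations: no v1–v1.2
statement or proof touched; DOCFIX of one gloss — the printed words at [II] p. 21 are "ε₁ sufficiently small", the
clause «given the preceding constants» formerly inside the quotation marks (Content item 5, `exists_eps1_lt`) is ours;
cell cross-read record C-adv4-81 R1): §9, the constant-form twins of `RateCertificate` v1.7 §11 (near-sequence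
transfer); `thm2Printed_of_nearMarginChainL` joins the binder census above with `(hconv, hlist)` stated for a COMPARISON
sequence `a` plus ONE MORE open input `hnear : NearRate a S.β0 e θ` (LOCATED, NOT printed — the one-loop scheme-transfer
rate, asym1's Q-asym1-5 in inequality form) and `hε₁ < m − e − (c₀ + e)θ^{k₁}(1 + θ)`;
`thm2Printed_of_blockNearMarginChainL` is `thm2Printed_of_blockMarginChainL` with `hblock` ↦ `hnear` likewise.
v1.4 (APPEND-ONLY: no v1–v1.3 declaration, statement, proof or docstring line touched; ONE new import,
`Beta.DriftRemainder` — row an4's drift × constant-remainder sockets, used BY NAME): §10, the cumulative (partial-sum)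
scheme / L-transfer defect `CumNear` × constant remainder — asym2's β-level side of RULING (R19): at END grade the defect
enters NO numeric condition beyond the partial-sums constant (`endpointExistence_of_lTransferConst` takes the (R19)
conclusion shape itself as the binder), at Theorem-2 grade it is paid as `2Γ` against the certified margin (a
certificate question, (R19-3), not supplied); §11, the constant-form twins of `RateCertificate` v1.8 §12 (eventual rate
from a threshold scale).  The binder census above is unchanged but for these located replacements of `hconv`.
v1.5 (DOC-ONLY: no declaration, statement or proof touched; no new import): DOCFIX of ONE gloss in §10's section
docstring — row an2's located reading of the telescoped scheme defect is now quoted in an2's own words, «if γ_k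
converges (expected from locality, NOT proved here) the per-step defect → 0 and the cumulative defect stays bounded»,
where v1.4 had compressed it to «with the cumulative defect γ_k bounded» (cell cross-read record C-pv14-84, A1); the
census bullet (U) annotated; Content item 12 = POINTER to the companion leaf `Beta.RemainderConstUpperDerived` ((U)
DERIVED: `hup`-free `_cont` twins of §§4–11's sockets), split off because this file reached the gate's size cap.
STILL OPEN, unchanged: the rate (asym1), the certificates (cap), the chain leaves (D4), (C) (D5).
-/

namespace Literature.MathematicalPhysics.QuantumFieldTheory.Balaban1983to89.Beta.RemainderConstCertified

open Literature.MathematicalPhysics.QuantumFieldTheory.Balaban1983to89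
open FlowStep DagBinding FlowStepRuns
open Literature.MathematicalPhysics.QuantumFieldTheory.Balaban1983to89.Beta.Assembly
open Literature.MathematicalPhysics.QuantumFieldTheory.Balaban1983to89.Beta.RemainderChain
open Literature.MathematicalPhysics.QuantumFieldTheory.Balaban1983to89.Beta.RemainderChainLattice
open Literature.MathematicalPhysics.QuantumFieldTheory.Balaban1983to89.Beta.RemainderChainTorus
open Literature.MathematicalPhysics.QuantumFieldTheory.Balaban1983to89.Beta.RemainderConstNumerals (elemCoeffL)
open Literature.MathematicalPhysics.QuantumFieldTheory.Balaban1983to89.Beta.RateCertificate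
open Literature.MathematicalPhysics.QuantumFieldTheory.Balaban1983to89.Beta.Certified (SmallKCert)

noncomputable section

/-! ## 1. Floors of a real sequence from the rate and the certificates -/

/-- **The TAIL FLOOR from the rate + ONE certified value** ("`betaBar_pos_of_ge k₀`", quantitative): a
`GeomRate b binf c₀ θ` (`0 ≤ θ ≤ 1`; `binf` any real), a certified lower value `m ≤ b_{k₁}` and an index `k₂` with
`c₀θ^{k₂} ≤ (m − c₀θ^{k₁})/4` give `3(m − c₀θ^{k₁})/4 ≤ b_k` for every `k ≥ k₂` — via the enclosure
`m − c₀θ^{k₁} ≤ b_∞` (`GeomRate.binf_ge`) and `b_k ≥ b_∞ − c₀θ^k ≥ b_∞ − c₀θ^{k₂}`. [folklore] -/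
theorem tail_floor_of_cert {b : ℕ → ℝ} {binf c₀ θ m : ℝ} {k₁ k₂ : ℕ} (hconv : GeomRate b binf c₀ θ) (hθ0 : 0 ≤ θ)
    (hθ1 : θ ≤ 1) (hcert : m ≤ b k₁) (hk₂ : c₀ * θ ^ k₂ ≤ (m - c₀ * θ ^ k₁) / 4) :
    ∀ k, k₂ ≤ k → 3 * (m - c₀ * θ ^ k₁) / 4 ≤ b k := fun k hk => by
  have h1 := hconv.binf_ge hcert
  have h2 := (abs_le.mp (hconv k)).1
  have h3 : c₀ * θ ^ k ≤ c₀ * θ ^ k₂ :=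
    mul_le_mul_of_nonneg_left (pow_le_pow_of_le_one hθ0 hθ1 hk) hconv.const_nonneg
  linarith

/-- **The UNIFORM FLOOR from the rate + ONE certified value + the certified list** ("`oneLoopCoeff_k_pos, k ≤ k₀`",
quantitative, joined to the tail): `m₀ ≤ b_k` for `k < k₂` and the data of `tail_floor_of_cert` give
`min m₀ (3(m − c₀θ^{k₁})/4) ≤ b_k` for ALL k. [folklore] -/
theorem floor_of_cert {b : ℕ → ℝ} {binf c₀ θ m m₀ : ℝ} {k₁ k₂ : ℕ} (hconv : GeomRate b binf c₀ θ) (hθ0 : 0 ≤ θ)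
    (hθ1 : θ ≤ 1) (hcert : m ≤ b k₁) (hk₂ : c₀ * θ ^ k₂ ≤ (m - c₀ * θ ^ k₁) / 4)
    (hsmall : ∀ k, k < k₂ → m₀ ≤ b k) : ∀ k, min m₀ (3 * (m - c₀ * θ ^ k₁) / 4) ≤ b k := fun k =>
  (lt_or_ge k k₂).elim (fun hk => (min_le_left _ _).trans (hsmall k hk))
    (fun hk => (min_le_right _ _).trans (tail_floor_of_cert hconv hθ0 hθ1 hcert hk₂ k hk))

/-- The floor is POSITIVE as soon as the certified value beats the rate's slack at `k₁` (`c₀θ^{k₁} < m`, the test of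
`GeomRate.binf_pos`) and the listed floor is positive. [folklore] -/
theorem floor_pos_of_gap {c₀ θ m m₀ : ℝ} {k₁ : ℕ} (hgap : c₀ * θ ^ k₁ < m) (hm₀ : 0 < m₀) :
    0 < min m₀ (3 * (m - c₀ * θ ^ k₁) / 4) :=
  lt_min hm₀ (by linarith)

/-! ## 2. β-level: a floor of the one-loop coefficients and the constant-form remainder bound -/

variable {β : HBeta}

/-- The constant of a `RemainderConst S γ₀ r` on non-empty boxes (`0 < γ₀`) is `≥ 0` (evaluate at the corner). [folklore] -/
theorem remainderConst_nonneg (S : B12Beta.OneLoopSplit β) {γ₀ r : ℝ} (hγ₀ : 0 < γ₀) (hrem : RemainderConst S γ₀ r) :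
    0 ≤ r :=
  (abs_nonneg _).trans (hrem 0 (fun _ => γ₀) fun _ => ⟨hγ₀, le_rfl⟩)

/-- **`β_{k+1} ≥ f − r` on ALL boxes from a floor and the constant form**: `f ≤ β⁰_{k+1}` for all k and
`|β¹_{k+1}(p)| ≤ r` on `]0,γ₀]^{k+1}` give `FlowStep.BetaLowerH (f − r) γ₀ β` through the printed split
`β = β⁰ + β¹` ((2.12)–(2.14)).  Compare `RemainderChain.betaLowerH_of_split_const` (`2b ≤ β⁰`, `r ≤ b` ⟹ floor `b`):
this is the sharp bookkeeping `b = f − r`. [cite: Balaban1987RG1, (2.12)–(2.14) p.268] -/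
theorem betaLowerH_of_floor_const (S : B12Beta.OneLoopSplit β) {γ₀ f r : ℝ} (hF : ∀ k, f ≤ S.β0 k)
    (hrem : RemainderConst S γ₀ r) : BetaLowerH (f - r) γ₀ β := fun k v hv => by
  have h1 := (abs_le.mp (hrem k v (histBox_of_mem_box hv))).1
  rw [S.split k v]
  linarith [hF k]

/-- The TAIL version: a floor for `k ≥ k₀` and the constant form give `f − r ≤ β_{k+1}` on the boxes for `k ≥ k₀`
(the field `tail` of `Assembly.EventualForm`). [cite: Balaban1987RG1, (2.12)–(2.14) p.268] -/
theorem betaLowerTail_of_floor_const (S : B12Beta.OneLoopSplit β) {γ₀ f r : ℝ} {k₀ : ℕ}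
    (hF : ∀ k, k₀ ≤ k → f ≤ S.β0 k) (hrem : RemainderConst S γ₀ r) :
    ∀ k, k₀ ≤ k → ∀ v ∈ Box γ₀ k, f - r ≤ β k v := fun k hk v hv => by
  have h1 := (abs_le.mp (hrem k v (histBox_of_mem_box hv))).1
  rw [S.split k v]
  linarith [hF k hk]

/-! ## 3. END sockets, floor form -/

/-- **The minimal carrier `Assembly.EventualForm β` from a TAIL floor and the constant form**: `f ≤ β⁰_{k+1}` for
`k ≥ k₀`, `RemainderConst S γ₀ r` with `r < f`, the printed two-sided bound (`β_{k+1} ≤ β′`, `−β′ ≤ β_{k+1}`) and (C):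
`b = f − r`, threshold scale `k₀`. [cite: Balaban1987RG1, §1 p.264] -/
def eventualFormOfFloorConst (S : B12Beta.OneLoopSplit β) {γ₀ f r β' : ℝ} {k₀ : ℕ} (hγ₀ : 0 < γ₀)
    (hF : ∀ k, k₀ ≤ k → f ≤ S.β0 k) (hrem : RemainderConst S γ₀ r) (hr : r < f) (hup : BetaUpperH β' γ₀ β)
    (hlo : ∀ k, ∀ v ∈ Box γ₀ k, -β' ≤ β k v) (hcont : BetaContH γ₀ β) : EventualForm β where
  γ₀ := γ₀
  γ₀_pos := hγ₀
  b := f - r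
  b_pos := sub_pos.mpr hr
  k₀ := k₀
  tail := betaLowerTail_of_floor_const S hF hrem
  β' := β'
  upper := hup
  lower := hlo
  cont := hcont

/-- The carrier's constants are the given ones: `b = f − r`, `k₀`, `γ₀`, `β′`. [folklore] -/
theorem eventualFormOfFloorConst_consts (S : B12Beta.OneLoopSplit β) {γ₀ f r β' : ℝ} {k₀ : ℕ} (hγ₀ : 0 < γ₀)
    (hF : ∀ k, k₀ ≤ k → f ≤ S.β0 k) (hrem : RemainderConst S γ₀ r) (hr : r < f) (hup : BetaUpperH β' γ₀ β)
    (hlo : ∀ k, ∀ v ∈ Box γ₀ k, -β' ≤ β k v) (hcont : BetaContH γ₀ β) :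
    (eventualFormOfFloorConst S hγ₀ hF hrem hr hup hlo hcont).b = f - r ∧
      (eventualFormOfFloorConst S hγ₀ hF hrem hr hup hlo hcont).k₀ = k₀ ∧
      (eventualFormOfFloorConst S hγ₀ hF hrem hr hup hlo hcont).γ₀ = γ₀ ∧
      (eventualFormOfFloorConst S hγ₀ hF hrem hr hup hlo hcont).β' = β' :=
  ⟨rfl, rfl, rfl, rfl⟩

/-- **THEOREM 2 AS PRINTED from a UNIFORM floor and the constant form**: for a construction generated forward by its
β-functions, `1 < L`, a floor `f ≤ β⁰_{k+1}` (all k), `RemainderConst S γ₀ r` with `r < f`, (C) and the printed upper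
bound (U): `B12.Thm2Printed C L` (`FlowStepRuns.thm2Printed_of_boxBoundsH` with `b = f − r`; `b ≤ β′` read off at a
box corner).  Inputs BY NAME that no printed source supplies: the floor, the remainder bound's leaves, (C).
[cite: Balaban1987RG1, Thm 2 p.259 with (0.31)] -/
theorem thm2Printed_of_floor_const {C : B12.Construction} (hgen : ForwardGenerated C β) {L : ℝ} (hL : 1 < L)
    (S : B12Beta.OneLoopSplit β) {γ₀ f r β' : ℝ} (hγ₀ : 0 < γ₀) (hF : ∀ k, f ≤ S.β0 k)
    (hrem : RemainderConst S γ₀ r) (hr : r < f) (hcont : BetaContH γ₀ β) (hup : BetaUpperH β' γ₀ β) :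
    B12.Thm2Printed C L := by
  have hlo : BetaLowerH (f - r) γ₀ β := betaLowerH_of_floor_const S hF hrem
  have hmem : (fun _ : Fin (0 + 1) => γ₀) ∈ Box γ₀ 0 := mem_box.mpr fun _ => ⟨hγ₀, le_rfl⟩
  exact thm2Printed_of_boxBoundsH hgen hL hγ₀ (sub_pos.mpr hr) ((hlo 0 _ hmem).trans (hup 0 _ hmem)) hcont hlo hup

/-- **Discrete asymptotic freedom `BetaAFH β`** (a uniform `β_{k+1} ≥ f − r > 0` on `]0,γ₀]`-boxes) from a uniform floor
and the constant form. [folklore] -/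
theorem betaAFH_of_floor_const (S : B12Beta.OneLoopSplit β) {γ₀ f r : ℝ} (hγ₀ : 0 < γ₀) (hF : ∀ k, f ≤ S.β0 k)
    (hrem : RemainderConst S γ₀ r) (hr : r < f) : BetaAFH β :=
  ⟨γ₀, hγ₀, f - r, sub_pos.mpr hr, betaLowerH_of_floor_const S hF hrem⟩

/-! ## 4. The certified instantiation: (cap) certificates × (asym) rate × (asym2/an4) constant-form remainder -/

/-- **`EventualForm β` FROM THE THREE LANES** — (asym) `GeomRate S.β0 binf c₀ θ`, `0 ≤ θ ≤ 1`, `binf` any real;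
(cap) ONE certified lower value `m ≤ β⁰_{k₁+1}` and an index `k₂` with `c₀θ^{k₂} ≤ (m − c₀θ^{k₁})/4`; (asym2/an4)
`RemainderConst S γ₀ r` with `r < 3(m − c₀θ^{k₁})/4`; the printed two-sided bound; (C).  Constants: `b =
3(m − c₀θ^{k₁})/4 − r`, `k₀ = k₂`.  NO `0 < β⁰_∞`, NO identification of `β⁰_∞`, NO (AF-1), NO γ-shrinking.
[cite: Balaban1987RG1, §1 p.264 and (2.12)–(2.14) p.268] -/
def eventualFormOfCertifiedConst (S : B12Beta.OneLoopSplit β) {γ₀ binf c₀ θ r β' m : ℝ} {k₁ k₂ : ℕ}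
    (hγ₀ : 0 < γ₀) (hθ0 : 0 ≤ θ) (hθ1 : θ ≤ 1) (hconv : GeomRate S.β0 binf c₀ θ) (hcert : m ≤ S.β0 k₁)
    (hk₂ : c₀ * θ ^ k₂ ≤ (m - c₀ * θ ^ k₁) / 4) (hrem : RemainderConst S γ₀ r)
    (hr : r < 3 * (m - c₀ * θ ^ k₁) / 4) (hup : BetaUpperH β' γ₀ β) (hlo : ∀ k, ∀ v ∈ Box γ₀ k, -β' ≤ β k v)
    (hcont : BetaContH γ₀ β) : EventualForm β :=
  eventualFormOfFloorConst S hγ₀ (tail_floor_of_cert hconv hθ0 hθ1 hcert hk₂) hrem hr hup hlo hcont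

/-- Its constants: `b = 3(m − c₀θ^{k₁})/4 − r`, `k₀ = k₂`, `γ₀`, `β′`. [folklore] -/
theorem eventualFormOfCertifiedConst_consts (S : B12Beta.OneLoopSplit β) {γ₀ binf c₀ θ r β' m : ℝ} {k₁ k₂ : ℕ}
    (hγ₀ : 0 < γ₀) (hθ0 : 0 ≤ θ) (hθ1 : θ ≤ 1) (hconv : GeomRate S.β0 binf c₀ θ) (hcert : m ≤ S.β0 k₁)
    (hk₂ : c₀ * θ ^ k₂ ≤ (m - c₀ * θ ^ k₁) / 4) (hrem : RemainderConst S γ₀ r)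
    (hr : r < 3 * (m - c₀ * θ ^ k₁) / 4) (hup : BetaUpperH β' γ₀ β) (hlo : ∀ k, ∀ v ∈ Box γ₀ k, -β' ≤ β k v)
    (hcont : BetaContH γ₀ β) :
    (eventualFormOfCertifiedConst S hγ₀ hθ0 hθ1 hconv hcert hk₂ hrem hr hup hlo hcont).b =
        3 * (m - c₀ * θ ^ k₁) / 4 - r ∧
      (eventualFormOfCertifiedConst S hγ₀ hθ0 hθ1 hconv hcert hk₂ hrem hr hup hlo hcont).k₀ = k₂ ∧
      (eventualFormOfCertifiedConst S hγ₀ hθ0 hθ1 hconv hcert hk₂ hrem hr hup hlo hcont).γ₀ = γ₀ ∧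
      (eventualFormOfCertifiedConst S hγ₀ hθ0 hθ1 hconv hcert hk₂ hrem hr hup hlo hcont).β' = β' :=
  ⟨rfl, rfl, rfl, rfl⟩

/-- **THE END STATEMENT `DagBinding.EndpointExistence C` FROM THE THREE LANES** (forward-generated constructions): the
inputs of `eventualFormOfCertifiedConst`; no small-k list, no sign of `β⁰_∞`, no (AF-1)
(`Assembly.EventualForm.endpointExistence`). [cite: Balaban1987RG1, Thm 2 p.259 (first sentence)] -/
theorem endpointExistence_of_certifiedConst {C : B12.Construction} (hgen : ForwardGenerated C β)
    (S : B12Beta.OneLoopSplit β) {γ₀ binf c₀ θ r β' m : ℝ} {k₁ k₂ : ℕ} (hγ₀ : 0 < γ₀) (hθ0 : 0 ≤ θ) (hθ1 : θ ≤ 1)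
    (hconv : GeomRate S.β0 binf c₀ θ) (hcert : m ≤ S.β0 k₁) (hk₂ : c₀ * θ ^ k₂ ≤ (m - c₀ * θ ^ k₁) / 4)
    (hrem : RemainderConst S γ₀ r) (hr : r < 3 * (m - c₀ * θ ^ k₁) / 4) (hup : BetaUpperH β' γ₀ β)
    (hlo : ∀ k, ∀ v ∈ Box γ₀ k, -β' ≤ β k v) (hcont : BetaContH γ₀ β) : EndpointExistence C :=
  (eventualFormOfCertifiedConst S hγ₀ hθ0 hθ1 hconv hcert hk₂ hrem hr hup hlo hcont).endpointExistence hgen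

/-- **The lower half of (0.31) on FINE lattices from the three lanes** — no small-k sign
(`Assembly.EventualForm.thm2_fineLattices`), with `b = 3(m − c₀θ^{k₁})/4 − r` and threshold scale `k₂`.
[cite: Balaban1987RG1, Thm 2 (0.31) p.259] -/
theorem thm2_fineLattices_of_certifiedConst {C : B12.Construction} (hgen : ForwardGenerated C β)
    (S : B12Beta.OneLoopSplit β) {γ₀ binf c₀ θ r β' m : ℝ} {k₁ k₂ : ℕ} (hγ₀ : 0 < γ₀) (hθ0 : 0 ≤ θ) (hθ1 : θ ≤ 1)
    (hconv : GeomRate S.β0 binf c₀ θ) (hcert : m ≤ S.β0 k₁) (hk₂ : c₀ * θ ^ k₂ ≤ (m - c₀ * θ ^ k₁) / 4)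
    (hrem : RemainderConst S γ₀ r) (hr : r < 3 * (m - c₀ * θ ^ k₁) / 4) (hup : BetaUpperH β' γ₀ β)
    (hlo : ∀ k, ∀ v ∈ Box γ₀ k, -β' ≤ β k v) (hcont : BetaContH γ₀ β) :
    ∀ (n : ℕ) (γ : ℝ), 0 < γ → γ ≤ γ₀ → ∀ g : ℝ, 0 < g → 1 / γ ^ 2 + β' * k₂ ≤ 1 / g ^ 2 →
      ∀ K : ℕ, (3 * (3 * (m - c₀ * θ ^ k₁) / 4 - r) + 2 * β') * k₂ ≤ (3 * (m - c₀ * θ ^ k₁) / 4 - r) * K →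
        ∃ g0 : ℝ, (C ⟨K, n, g0⟩).flow.InInterval γ K ∧ (C ⟨K, n, g0⟩).flow.g K = g ∧
          Step.Discrete031 ((3 * (m - c₀ * θ ^ k₁) / 4 - r) / 2) β' K g (C ⟨K, n, g0⟩).flow.g :=
  (eventualFormOfCertifiedConst S hγ₀ hθ0 hθ1 hconv hcert hk₂ hrem hr hup hlo hcont).thm2_fineLattices hgen

/-- **(AF-0) on ALL boxes from the three lanes with the certified list**: `β_{k+1} ≥ min m₀ (3(m − c₀θ^{k₁})/4) − r`
on `]0,γ₀]^{k+1}` for every k. [cite: Balaban1987RG1, (2.12)–(2.14) p.268] -/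
theorem betaLowerH_of_certifiedConst (S : B12Beta.OneLoopSplit β) {γ₀ binf c₀ θ r m m₀ : ℝ} {k₁ k₂ : ℕ}
    (hθ0 : 0 ≤ θ) (hθ1 : θ ≤ 1) (hconv : GeomRate S.β0 binf c₀ θ) (hcert : m ≤ S.β0 k₁)
    (hk₂ : c₀ * θ ^ k₂ ≤ (m - c₀ * θ ^ k₁) / 4) (hsmall : ∀ k, k < k₂ → m₀ ≤ S.β0 k)
    (hrem : RemainderConst S γ₀ r) : BetaLowerH (min m₀ (3 * (m - c₀ * θ ^ k₁) / 4) - r) γ₀ β :=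
  betaLowerH_of_floor_const S (floor_of_cert hconv hθ0 hθ1 hcert hk₂ hsmall) hrem

/-- **THEOREM 2 AS PRINTED FROM THE THREE LANES** — `B12.Thm2Printed C L` from: the DAG (`ForwardGenerated`), `1 < L`;
(asym) `GeomRate S.β0 binf c₀ θ`, `0 ≤ θ ≤ 1`, `binf` ANY real; (cap) ONE certified lower value `m ≤ β⁰_{k₁+1}`, an index
`k₂` with `c₀θ^{k₂} ≤ (m − c₀θ^{k₁})/4` and the certified list `m₀ ≤ β⁰_{k+1}`, `k < k₂`; (asym2/an4)
`RemainderConst S γ₀ r` with `r < min m₀ (3(m − c₀θ^{k₁})/4)`; (C); (U).  The lower constant of (0.31) is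
`(min m₀ (3(m − c₀θ^{k₁})/4) − r)/log L`.  [cite: Balaban1987RG1, Thm 2 p.259 with (0.31)] -/
theorem thm2Printed_of_certifiedConst {C : B12.Construction} (hgen : ForwardGenerated C β) {L : ℝ} (hL : 1 < L)
    (S : B12Beta.OneLoopSplit β) {γ₀ binf c₀ θ r β' m m₀ : ℝ} {k₁ k₂ : ℕ} (hγ₀ : 0 < γ₀) (hθ0 : 0 ≤ θ)
    (hθ1 : θ ≤ 1) (hconv : GeomRate S.β0 binf c₀ θ) (hcert : m ≤ S.β0 k₁)
    (hk₂ : c₀ * θ ^ k₂ ≤ (m - c₀ * θ ^ k₁) / 4) (hsmall : ∀ k, k < k₂ → m₀ ≤ S.β0 k)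
    (hrem : RemainderConst S γ₀ r) (hr : r < min m₀ (3 * (m - c₀ * θ ^ k₁) / 4)) (hcont : BetaContH γ₀ β)
    (hup : BetaUpperH β' γ₀ β) : B12.Thm2Printed C L :=
  thm2Printed_of_floor_const hgen hL S hγ₀ (floor_of_cert hconv hθ0 hθ1 hcert hk₂ hsmall) hrem hr hcont hup

/-- **`BetaAFH β` from the three lanes** (same inputs as `thm2Printed_of_certifiedConst` minus the DAG, `L`, (C), (U)).
[folklore] -/
theorem betaAFH_of_certifiedConst (S : B12Beta.OneLoopSplit β) {γ₀ binf c₀ θ r m m₀ : ℝ} {k₁ k₂ : ℕ}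
    (hγ₀ : 0 < γ₀) (hθ0 : 0 ≤ θ) (hθ1 : θ ≤ 1) (hconv : GeomRate S.β0 binf c₀ θ) (hcert : m ≤ S.β0 k₁)
    (hk₂ : c₀ * θ ^ k₂ ≤ (m - c₀ * θ ^ k₁) / 4) (hsmall : ∀ k, k < k₂ → m₀ ≤ S.β0 k)
    (hrem : RemainderConst S γ₀ r) (hr : r < min m₀ (3 * (m - c₀ * θ ^ k₁) / 4)) : BetaAFH β :=
  betaAFH_of_floor_const S hγ₀ (floor_of_cert hconv hθ0 hθ1 hcert hk₂ hsmall) hrem hr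

/-- **DROP-IN TWIN of asym1's `RateCertificate.thm2Printed_of_certified`**: the same binder list — ONE certified
ENCLOSURE `m ≤ β⁰_{k₁+1} ≤ M`, the index `k₂`, the list `3(M + c₀θ^{k₁})/4 ≤ β⁰_{k+1}` (`k < k₂`) — with the linear
remainder pair `(hCr, haf1)` REPLACED by the constant form `(hrem, hr)`, `r < 3(m − c₀θ^{k₁})/4`; asym1's
`hgap : c₀θ^{k₁} < m` is implied (`r ≥ 0` on non-empty boxes) and dropped.  Since `M + c₀θ^{k₁} ≥ m − c₀θ^{k₁}`, the list
serves the floor `3(m − c₀θ^{k₁})/4`. [cite: Balaban1987RG1, Thm 2 p.259 with (0.31)] -/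
theorem thm2Printed_of_certified_const {C : B12.Construction} (hgen : ForwardGenerated C β) {L : ℝ} (hL : 1 < L)
    (S : B12Beta.OneLoopSplit β) {γ₀ binf c₀ θ r β' m M : ℝ} {k₁ k₂ : ℕ} (hγ₀ : 0 < γ₀) (hθ0 : 0 ≤ θ)
    (hθ1 : θ < 1) (hconv : GeomRate S.β0 binf c₀ θ) (hlo : m ≤ S.β0 k₁) (hhi : S.β0 k₁ ≤ M)
    (hk₂ : c₀ * θ ^ k₂ ≤ (m - c₀ * θ ^ k₁) / 4) (hsmall : ∀ k, k < k₂ → 3 * (M + c₀ * θ ^ k₁) / 4 ≤ S.β0 k)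
    (hrem : RemainderConst S γ₀ r) (hr : r < 3 * (m - c₀ * θ ^ k₁) / 4) (hcont : BetaContH γ₀ β)
    (hup : BetaUpperH β' γ₀ β) : B12.Thm2Printed C L := by
  have hq : 0 ≤ c₀ * θ ^ k₁ := mul_nonneg hconv.const_nonneg (pow_nonneg hθ0 k₁)
  refine thm2Printed_of_certifiedConst hgen hL S hγ₀ hθ0 hθ1.le hconv hlo hk₂ (m₀ := 3 * (m - c₀ * θ ^ k₁) / 4)
    (fun k hk => le_trans (by linarith) (hsmall k hk)) hrem (by rwa [min_self]) hcont hup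

/-- **The same END statement from the CAUCHY form of the rate** — no limit value among the hypotheses at all (`β⁰_∞` is
the constructed `CauchyRate.lim S.β0`, `c₀ = c/(1 − θ)`; `RateCertificate.CauchyRate.geomRate`).
[cite: Balaban1987RG1, Thm 2 p.259 with (0.31)] -/
theorem thm2Printed_of_cauchyCertifiedConst {C : B12.Construction} (hgen : ForwardGenerated C β) {L : ℝ}
    (hL : 1 < L) (S : B12Beta.OneLoopSplit β) {γ₀ c θ r β' m m₀ : ℝ} {k₁ k₂ : ℕ} (hγ₀ : 0 < γ₀) (hθ0 : 0 ≤ θ)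
    (hθ1 : θ < 1) (hrate : CauchyRate S.β0 c θ) (hcert : m ≤ S.β0 k₁)
    (hk₂ : c / (1 - θ) * θ ^ k₂ ≤ (m - c / (1 - θ) * θ ^ k₁) / 4) (hsmall : ∀ k, k < k₂ → m₀ ≤ S.β0 k)
    (hrem : RemainderConst S γ₀ r) (hr : r < min m₀ (3 * (m - c / (1 - θ) * θ ^ k₁) / 4))
    (hcont : BetaContH γ₀ β) (hup : BetaUpperH β' γ₀ β) : B12.Thm2Printed C L :=
  thm2Printed_of_certifiedConst hgen hL S hγ₀ hθ0 hθ1.le (hrate.geomRate hθ1) hcert hk₂ hsmall hrem hr hcont hup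

/-- **The same END statement through the certified lane's CARRIER `Certified.SmallKCert S.β0 binf`** (cap3): its list
`3β⁰_∞/4 ≤ β⁰_{k+1}` (`k < c.k₁`, `SmallKCert.hsmall`) serves the floor `3(m − c₀θ^{k₁})/4` through the enclosure
`m − c₀θ^{k₁} ≤ β⁰_∞` (`GeomRate.binf_ge`); the carrier must reach an index with `c₀θ^{c.k₁} ≤ (m − c₀θ^{k₁})/4` (the
test of `RateCertificate.thm2Printed_of_smallKCert`).  (hCr, haf1) of that theorem ↦ (hrem, hr).
[cite: Balaban1987RG1, Thm 2 p.259 with (0.31)] -/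
theorem thm2Printed_of_smallKCertConst {C : B12.Construction} (hgen : ForwardGenerated C β) {L : ℝ} (hL : 1 < L)
    (S : B12Beta.OneLoopSplit β) {γ₀ binf c₀ θ r β' m : ℝ} {k₁ : ℕ} (hγ₀ : 0 < γ₀) (hθ0 : 0 ≤ θ) (hθ1 : θ < 1)
    (hconv : GeomRate S.β0 binf c₀ θ) (hcert : m ≤ S.β0 k₁) (hrem : RemainderConst S γ₀ r)
    (hr : r < 3 * (m - c₀ * θ ^ k₁) / 4) (hcont : BetaContH γ₀ β) (hup : BetaUpperH β' γ₀ β)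
    (c : SmallKCert S.β0 binf) (hk : c₀ * θ ^ c.k₁ ≤ (m - c₀ * θ ^ k₁) / 4) : B12.Thm2Printed C L := by
  have hB := hconv.binf_ge hcert
  exact thm2Printed_of_certifiedConst hgen hL S hγ₀ hθ0 hθ1.le hconv hcert hk (m₀ := 3 * (m - c₀ * θ ^ k₁) / 4)
    (fun k hk' => le_trans (by linarith) (c.hsmall k hk')) hrem (by rwa [min_self]) hcont hup

/-! ## 5. Chain level: the remainder slot filled by the printed chain (window carrier `ChainL`, torus carrier `ChainT`) -/

variable {d : ℕ}

/-- **THEOREM 2 AS PRINTED FROM THE THREE LANES, THE REMAINDER SLOT FILLED BY A WINDOW CHAIN** `R : ChainL d M μ ν S γ₀ c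
ℓ α₂ B₃` (the printed leaves [II] (2.38), [I] (1.20)–(1.22), (5.10)-type decay BY NAME as fields) under the four numeric
conditions `CondsL d c ℓ`, the closing relation `(1 − 10δ)ℓ = 1`, the printed signs and the printed-type restriction
`ε₁·K_rem,L < min m₀ (3(m − c₀θ^{k₁})/4)` ("ε₁ sufficiently small", [II] p. 21) — `ChainL.abs_beta1_le` ∘
`thm2Printed_of_certifiedConst`.  The coordinator's sentence as ONE kernel theorem; see the header for the status of
each binder.  NOT Theorem 2 unconditionally. [cite: Balaban1987RG1, Thm 2 p.259 with (0.31); Balaban1988RG2Cluster, (2.38) p.20 and p.21] -/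
theorem thm2Printed_of_certifiedChainL {C : B12.Construction} (hgen : ForwardGenerated C β) {L : ℝ} (hL : 1 < L)
    (S : B12Beta.OneLoopSplit β) {M : ℕ} {μ ν : Fin d} {γ₀ : ℝ} {c : B13.Consts} {ℓ α₂ B₃ : ℝ}
    (R : ChainL d M μ ν S γ₀ c ℓ α₂ B₃) (hC : CondsL d c ℓ) (h22 : c.R22gen ℓ) (hs : SignsL c α₂ B₃) (hd : 0 < d)
    (hM : 0 < M) {binf c₀ θ β' m m₀ : ℝ} {k₁ k₂ : ℕ} (hγ₀ : 0 < γ₀) (hθ0 : 0 ≤ θ) (hθ1 : θ ≤ 1)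
    (hconv : GeomRate S.β0 binf c₀ θ) (hcert : m ≤ S.β0 k₁) (hk₂ : c₀ * θ ^ k₂ ≤ (m - c₀ * θ ^ k₁) / 4)
    (hsmall : ∀ k, k < k₂ → m₀ ≤ S.β0 k)
    (hε₁ : c.ε₁ * remCoeffL d M c α₂ B₃ < min m₀ (3 * (m - c₀ * θ ^ k₁) / 4)) (hcont : BetaContH γ₀ β)
    (hup : BetaUpperH β' γ₀ β) : B12.Thm2Printed C L :=
  thm2Printed_of_certifiedConst hgen hL S hγ₀ hθ0 hθ1 hconv hcert hk₂ hsmall (R.abs_beta1_le hC h22 hs hd hM) hε₁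
    hcont hup

/-- **… THE REMAINDER SLOT FILLED BY A TORUS CHAIN** `R : ChainT d M μ ν S γ₀ c ℓ α₂ B₃` (the periodic carrier of print;
same coefficient `K_rem,L`, `ChainT.abs_beta1_le`). [cite: Balaban1987RG1, Thm 2 p.259 with (0.31); Balaban1988RG2Cluster, (2.38) p.20 and p.21] -/
theorem thm2Printed_of_certifiedChainT {C : B12.Construction} (hgen : ForwardGenerated C β) {L : ℝ} (hL : 1 < L)
    (S : B12Beta.OneLoopSplit β) {M : ℕ} [NeZero M] {μ ν : Fin d} {γ₀ : ℝ} {c : B13.Consts} {ℓ α₂ B₃ : ℝ}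
    (R : ChainT d M μ ν S γ₀ c ℓ α₂ B₃) (hC : CondsL d c ℓ) (h22 : c.R22gen ℓ) (hs : SignsL c α₂ B₃) (hd : 0 < d)
    {binf c₀ θ β' m m₀ : ℝ} {k₁ k₂ : ℕ} (hγ₀ : 0 < γ₀) (hθ0 : 0 ≤ θ) (hθ1 : θ ≤ 1)
    (hconv : GeomRate S.β0 binf c₀ θ) (hcert : m ≤ S.β0 k₁) (hk₂ : c₀ * θ ^ k₂ ≤ (m - c₀ * θ ^ k₁) / 4)
    (hsmall : ∀ k, k < k₂ → m₀ ≤ S.β0 k)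
    (hε₁ : c.ε₁ * remCoeffL d M c α₂ B₃ < min m₀ (3 * (m - c₀ * θ ^ k₁) / 4)) (hcont : BetaContH γ₀ β)
    (hup : BetaUpperH β' γ₀ β) : B12.Thm2Printed C L :=
  thm2Printed_of_certifiedConst hgen hL S hγ₀ hθ0 hθ1 hconv hcert hk₂ hsmall (R.abs_beta1_le hC h22 hs hd) hε₁
    hcont hup

/-- **The END statement `EndpointExistence C` from the three lanes, window chain** — tail only (no certified list), the
restriction against the tail floor `ε₁·K_rem,L < 3(m − c₀θ^{k₁})/4`, the printed two-sided bound and (C).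
[cite: Balaban1987RG1, Thm 2 p.259 (first sentence); Balaban1988RG2Cluster, (2.38) p.20 and p.21] -/
theorem endpointExistence_of_certifiedChainL {C : B12.Construction} (hgen : ForwardGenerated C β)
    (S : B12Beta.OneLoopSplit β) {M : ℕ} {μ ν : Fin d} {γ₀ : ℝ} {c : B13.Consts} {ℓ α₂ B₃ : ℝ}
    (R : ChainL d M μ ν S γ₀ c ℓ α₂ B₃) (hC : CondsL d c ℓ) (h22 : c.R22gen ℓ) (hs : SignsL c α₂ B₃) (hd : 0 < d)
    (hM : 0 < M) {binf c₀ θ β' m : ℝ} {k₁ k₂ : ℕ} (hγ₀ : 0 < γ₀) (hθ0 : 0 ≤ θ) (hθ1 : θ ≤ 1)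
    (hconv : GeomRate S.β0 binf c₀ θ) (hcert : m ≤ S.β0 k₁) (hk₂ : c₀ * θ ^ k₂ ≤ (m - c₀ * θ ^ k₁) / 4)
    (hε₁ : c.ε₁ * remCoeffL d M c α₂ B₃ < 3 * (m - c₀ * θ ^ k₁) / 4) (hup : BetaUpperH β' γ₀ β)
    (hlo : ∀ k, ∀ v ∈ Box γ₀ k, -β' ≤ β k v) (hcont : BetaContH γ₀ β) : EndpointExistence C :=
  endpointExistence_of_certifiedConst hgen S hγ₀ hθ0 hθ1 hconv hcert hk₂ (R.abs_beta1_le hC h22 hs hd hM) hε₁ hup hlo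
    hcont

/-- **… `EndpointExistence C` from the three lanes, torus chain.**
[cite: Balaban1987RG1, Thm 2 p.259 (first sentence); Balaban1988RG2Cluster, (2.38) p.20 and p.21] -/
theorem endpointExistence_of_certifiedChainT {C : B12.Construction} (hgen : ForwardGenerated C β)
    (S : B12Beta.OneLoopSplit β) {M : ℕ} [NeZero M] {μ ν : Fin d} {γ₀ : ℝ} {c : B13.Consts} {ℓ α₂ B₃ : ℝ}
    (R : ChainT d M μ ν S γ₀ c ℓ α₂ B₃) (hC : CondsL d c ℓ) (h22 : c.R22gen ℓ) (hs : SignsL c α₂ B₃) (hd : 0 < d)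
    {binf c₀ θ β' m : ℝ} {k₁ k₂ : ℕ} (hγ₀ : 0 < γ₀) (hθ0 : 0 ≤ θ) (hθ1 : θ ≤ 1)
    (hconv : GeomRate S.β0 binf c₀ θ) (hcert : m ≤ S.β0 k₁) (hk₂ : c₀ * θ ^ k₂ ≤ (m - c₀ * θ ^ k₁) / 4)
    (hε₁ : c.ε₁ * remCoeffL d M c α₂ B₃ < 3 * (m - c₀ * θ ^ k₁) / 4) (hup : BetaUpperH β' γ₀ β)
    (hlo : ∀ k, ∀ v ∈ Box γ₀ k, -β' ≤ β k v) (hcont : BetaContH γ₀ β) : EndpointExistence C :=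
  endpointExistence_of_certifiedConst hgen S hγ₀ hθ0 hθ1 hconv hcert hk₂ (R.abs_beta1_le hC h22 hs hd) hε₁ hup hlo
    hcont

/-- **Theorem 2 as printed from the three lanes with the ELEMENTARY closed-form coefficient** `E = elemCoeffL d M c α₂ B₃`
of `RemainderConstNumerals` (a rational function of exponentials of the printed letters, no infinite sum:
`RemainderConstNumerals.ChainL.abs_beta1_le_elem`), restriction `ε₁·E < floor`.
[cite: Balaban1987RG1, Thm 2 p.259 with (0.31); Balaban1988RG2Cluster, (2.38) p.20 and p.21] -/
theorem thm2Printed_of_certifiedChainL_elem {C : B12.Construction} (hgen : ForwardGenerated C β) {L : ℝ} (hL : 1 < L)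
    (S : B12Beta.OneLoopSplit β) {M : ℕ} {μ ν : Fin d} {γ₀ : ℝ} {c : B13.Consts} {ℓ α₂ B₃ : ℝ}
    (R : ChainL d M μ ν S γ₀ c ℓ α₂ B₃) (hC : CondsL d c ℓ) (h22 : c.R22gen ℓ) (hs : SignsL c α₂ B₃) (hd : 0 < d)
    (hM : 0 < M) {binf c₀ θ β' m m₀ : ℝ} {k₁ k₂ : ℕ} (hγ₀ : 0 < γ₀) (hθ0 : 0 ≤ θ) (hθ1 : θ ≤ 1)
    (hconv : GeomRate S.β0 binf c₀ θ) (hcert : m ≤ S.β0 k₁) (hk₂ : c₀ * θ ^ k₂ ≤ (m - c₀ * θ ^ k₁) / 4)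
    (hsmall : ∀ k, k < k₂ → m₀ ≤ S.β0 k)
    (hε₁ : c.ε₁ * elemCoeffL d M c α₂ B₃ < min m₀ (3 * (m - c₀ * θ ^ k₁) / 4)) (hcont : BetaContH γ₀ β)
    (hup : BetaUpperH β' γ₀ β) : B12.Thm2Printed C L :=
  thm2Printed_of_certifiedConst hgen hL S hγ₀ hθ0 hθ1 hconv hcert hk₂ hsmall
    (RemainderConstNumerals.ChainL.abs_beta1_le_elem R hC h22 hs hd hM) hε₁ hcont hup

/-- The restriction `ε₁·K < f` against a POSITIVE floor is a satisfiable numeric condition: for `f > 0` and any `K`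
there is `ε₁ > 0` with `ε₁·K < f` (`RemainderChain.exists_eps1_le` at `f/2`).  It is of the printed type "ε₁
sufficiently small" ([II] p. 21: the words "for κ sufficiently large, and ε₁ sufficiently small" before (2.40), the
assumption `O(1)C₃ε₁ ≤ ½E₀` after (2.41)); that ε₁ is chosen given the preceding constants is OUR gloss of the order of
choices, not print; γ is chosen after ε₁ ([I] Thm 3 p. 264). [cite: Balaban1988RG2Cluster, p.21 (before (2.40) and after (2.41))] -/
theorem exists_eps1_lt (f K : ℝ) (hf : 0 < f) : ∃ ε₁ : ℝ, 0 < ε₁ ∧ ε₁ * K < f := by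
  obtain ⟨ε₁, hε, hle⟩ := exists_eps1_le (f / 2) K (by linarith)
  exact ⟨ε₁, hε, by linarith⟩

/-! ## 6. Non-vacuity: the joint hypotheses of §4 are satisfiable -/

namespace Witness

open Assembly.Witness (constOne splitOne)

/-- The constant split `β⁰ ≡ 1` has the (trivial) rate `GeomRate _ 1 0 0`. [folklore] -/
theorem geomRate_splitOne : GeomRate splitOne.β0 1 0 0 := fun k => by
  simp [splitOne]

/-- … and the constant-form remainder bound with `r = 0` on `]0,1]`-boxes. [folklore] -/
theorem remainderConst_splitOne : RemainderConst splitOne 1 0 := fun k p _ => by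
  simp [splitOne]

/-- `eventualFormOfCertifiedConst` instantiated on `β ≡ 1`: `γ₀ = 1`, `binf = 1`, `c₀ = θ = r = 0`, `β′ = 1`,
certificate `m = 1` at `k₁ = 0`, index `k₂ = 0`. [folklore] -/
def eventualFormOne : EventualForm constOne :=
  eventualFormOfCertifiedConst splitOne (γ₀ := 1) (binf := 1) (c₀ := 0) (θ := 0) (r := 0) (β' := 1) (m := 1)
    (k₁ := 0) (k₂ := 0) one_pos le_rfl zero_le_one geomRate_splitOne (by simp [splitOne]) (by norm_num)
    remainderConst_splitOne (by norm_num) (fun _ _ _ => le_rfl) (fun _ _ _ => by show (-1 : ℝ) ≤ 1; norm_num)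
    (fun _ => continuousOn_const)

/-- Its lower constant is `3/4` (`= 3(1 − 0)/4 − 0`) and its threshold scale is `0`. [folklore] -/
theorem eventualFormOne_consts : eventualFormOne.b = 3 / 4 ∧ eventualFormOne.k₀ = 0 := by
  refine ⟨?_, rfl⟩
  show 3 * (1 - 0 * (0 : ℝ) ^ 0) / 4 - 0 = 3 / 4
  norm_num

/-- The β-level conclusion on the witness: `BetaLowerH (min 1 (3/4) − 0) 1 constOne` from `betaLowerH_of_certifiedConst`
with the one-entry list `1 ≤ β⁰_{k+1}` (`k < 0`, empty) — i.e. the §4 hypotheses minus the DAG are jointly satisfiable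
with a positive floor. [folklore] -/
theorem betaLowerH_one : BetaLowerH (min (1 : ℝ) (3 * (1 - 0 * (0 : ℝ) ^ 0) / 4) - 0) 1 constOne :=
  betaLowerH_of_certifiedConst splitOne (binf := 1) (k₂ := 0) le_rfl zero_le_one geomRate_splitOne
    (by simp [splitOne]) (by norm_num) (fun k hk => absurd hk (Nat.not_lt_zero k)) remainderConst_splitOne

end Witness

/-! ## 7. (v1.1) MARGIN × CONSTANT REMAINDER — the constant-form twins of `RateCertificate` §7 (margin form) and §8
(strip socket)

The asymptotic lane's margin form (`RateCertificate` v1.3/v1.4 §7: `GeomRate.lower_of_list`, `eventualFormOfMargin`,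
`thm2Printed_of_margin` / `_of_cauchyMargin` / `_of_symbolMargin` / `_of_stripMargin`) is the agreed cap × asym interlock:
the certified lane supplies LOWER values `m ≤ β⁰_{k+1}` at the depths `k ≤ k₁` it reaches and nothing else, the
asymptotic lane a `GeomRate S.β0 binf c₀ θ` (`0 ≤ θ ≤ 1`, `binf` ANY real), and every one-loop coefficient is then
`≥ m − c₀θ^{k₁}(1 + θ)`.  Its remainder slot is the LINEAR form (AF-1) `|β¹_{k+1}(p)| ≤ C_r·p_k`, paid for by shrinking
the box to `marginBox γ₀ C_r b₀`.  On the CONSTANT road of this file the remainder is `RemainderConst S γ₀ r`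
(`r = ε₁·K_rem,L` from the printed chain, k-free), and the margin floor feeds §2/§3 with threshold scale `k₀ = 0`:
the SINGLE numeric condition is `r < m − c₀θ^{k₁}(1 + θ)`, i.e. `c₀θ^{k₁}(1 + θ) + ε₁·K_rem,L < m` — the rate's slack at
the last certified depth plus the remainder constant must fit under the certified value.  The box `]0,γ₀]` is NOT
shrunk (the smallness is spent on ε₁, "ε₁ sufficiently small" [II] p. 21; γ is chosen after ε₁, [I] Thm 3 p. 264),
there is no enclosure, no index test, no threshold list, no sign or identification of `β⁰_∞`, no (AF-1); asym1's gap
`c₀θ^{k₁}(1 + θ) < m` is IMPLIED (`marginGap_of_marginConst`, since `r ≥ 0` on non-empty boxes).  The an4 carriers with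
the (5.1)-leaf derived (`RemainderLimitTorus.ChainTLoc`, `RemainderLocality.ChainTFac`) conclude the SAME
`RemainderConst S γ (ε₁·K_rem,L)` by their own `abs_beta1_le` and plug into the β-level sockets below verbatim; they are
not imported here (import closure).  Real analysis about an arbitrary split; nothing of the series is discharged. -/

/-- asym1's gap is implied on the constant road: `RemainderConst S γ₀ r` on non-empty boxes forces `0 ≤ r`, so
`r < m − c₀θ^{k₁}(1 + θ)` gives `c₀θ^{k₁}(1 + θ) < m` (hence `RateCertificate.beta0_pos_all_of_margin`,
`GeomRate.binf_pos_of_gap` apply). [folklore] -/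
theorem marginGap_of_marginConst (S : B12Beta.OneLoopSplit β) {γ₀ c₀ θ r m : ℝ} {k₁ : ℕ} (hγ₀ : 0 < γ₀)
    (hrem : RemainderConst S γ₀ r) (hr : r < m - c₀ * θ ^ k₁ * (1 + θ)) : c₀ * θ ^ k₁ * (1 + θ) < m := by
  have := remainderConst_nonneg S hγ₀ hrem
  linarith

/-- **(AF-0) on ALL boxes, margin × constant**: the rate, the one-sided certified list `m ≤ β⁰_{k+1}` (`k ≤ k₁`) and
`RemainderConst S γ₀ r` give `β_{k+1} ≥ m − c₀θ^{k₁}(1 + θ) − r` on `]0,γ₀]^{k+1}` for EVERY k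
(`GeomRate.lower_of_list` ∘ `betaLowerH_of_floor_const`). [cite: Balaban1987RG1, (2.12)–(2.14) p.268] -/
theorem betaLowerH_of_marginConst (S : B12Beta.OneLoopSplit β) {γ₀ binf c₀ θ r m : ℝ} {k₁ : ℕ} (hθ0 : 0 ≤ θ)
    (hθ1 : θ ≤ 1) (hconv : GeomRate S.β0 binf c₀ θ) (hlist : ∀ k, k ≤ k₁ → m ≤ S.β0 k)
    (hrem : RemainderConst S γ₀ r) : BetaLowerH (m - c₀ * θ ^ k₁ * (1 + θ) - r) γ₀ β :=
  betaLowerH_of_floor_const S (hconv.lower_of_list hθ0 hθ1 hlist) hrem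

/-- … hence `β_{k+1} > 0` on every `]0,γ₀]`-box under the single condition `r < m − c₀θ^{k₁}(1 + θ)`. [folklore] -/
theorem beta_pos_all_of_marginConst (S : B12Beta.OneLoopSplit β) {γ₀ binf c₀ θ r m : ℝ} {k₁ : ℕ} (hθ0 : 0 ≤ θ)
    (hθ1 : θ ≤ 1) (hconv : GeomRate S.β0 binf c₀ θ) (hlist : ∀ k, k ≤ k₁ → m ≤ S.β0 k)
    (hrem : RemainderConst S γ₀ r) (hr : r < m - c₀ * θ ^ k₁ * (1 + θ)) :
    ∀ k, ∀ v ∈ Box γ₀ k, 0 < β k v := fun k v hv => by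
  have := betaLowerH_of_marginConst S hθ0 hθ1 hconv hlist hrem k v hv
  linarith

/-- **The minimal carrier `Assembly.EventualForm β`, margin × constant**: `b = m − c₀θ^{k₁}(1 + θ) − r`, threshold
scale `k₀ = 0`, box `]0,γ₀]` UNCHANGED, `β′` the printed upper constant; the lower companion `−β′ ≤ β_{k+1}` of the
two-sided bound is DERIVED (`β_{k+1} ≥ b > 0` and `β_{k+1} ≤ β′` on the box). [cite: Balaban1987RG1, §1 p.264 and (2.12)–(2.14) p.268] -/
def eventualFormOfMarginConst (S : B12Beta.OneLoopSplit β) {γ₀ binf c₀ θ r β' m : ℝ} {k₁ : ℕ} (hγ₀ : 0 < γ₀)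
    (hθ0 : 0 ≤ θ) (hθ1 : θ ≤ 1) (hconv : GeomRate S.β0 binf c₀ θ) (hlist : ∀ k, k ≤ k₁ → m ≤ S.β0 k)
    (hrem : RemainderConst S γ₀ r) (hr : r < m - c₀ * θ ^ k₁ * (1 + θ)) (hup : BetaUpperH β' γ₀ β)
    (hcont : BetaContH γ₀ β) : EventualForm β :=
  eventualFormOfFloorConst S (k₀ := 0) hγ₀ (fun k _ => hconv.lower_of_list hθ0 hθ1 hlist k) hrem hr hup
    (fun k v hv => by
      have h1 := betaLowerH_of_marginConst S hθ0 hθ1 hconv hlist hrem k v hv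
      have h2 := hup k v hv
      linarith)
    hcont

/-- Its constants: `b = m − c₀θ^{k₁}(1 + θ) − r`, `k₀ = 0`, box `γ₀` (not shrunk), `β′`. [folklore] -/
theorem eventualFormOfMarginConst_consts (S : B12Beta.OneLoopSplit β) {γ₀ binf c₀ θ r β' m : ℝ} {k₁ : ℕ}
    (hγ₀ : 0 < γ₀) (hθ0 : 0 ≤ θ) (hθ1 : θ ≤ 1) (hconv : GeomRate S.β0 binf c₀ θ)
    (hlist : ∀ k, k ≤ k₁ → m ≤ S.β0 k) (hrem : RemainderConst S γ₀ r) (hr : r < m - c₀ * θ ^ k₁ * (1 + θ))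
    (hup : BetaUpperH β' γ₀ β) (hcont : BetaContH γ₀ β) :
    (eventualFormOfMarginConst S hγ₀ hθ0 hθ1 hconv hlist hrem hr hup hcont).b = m - c₀ * θ ^ k₁ * (1 + θ) - r ∧
      (eventualFormOfMarginConst S hγ₀ hθ0 hθ1 hconv hlist hrem hr hup hcont).k₀ = 0 ∧
      (eventualFormOfMarginConst S hγ₀ hθ0 hθ1 hconv hlist hrem hr hup hcont).γ₀ = γ₀ ∧
      (eventualFormOfMarginConst S hγ₀ hθ0 hθ1 hconv hlist hrem hr hup hcont).β' = β' :=
  ⟨rfl, rfl, rfl, rfl⟩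

/-- **THE END STATEMENT `DagBinding.EndpointExistence C`, margin × constant** (forward-generated constructions):
rate + one-sided list + constant remainder + the one condition + (U) + (C). [cite: Balaban1987RG1, Thm 2 p.259 (first sentence)] -/
theorem endpointExistence_of_marginConst {C : B12.Construction} (hgen : ForwardGenerated C β)
    (S : B12Beta.OneLoopSplit β) {γ₀ binf c₀ θ r β' m : ℝ} {k₁ : ℕ} (hγ₀ : 0 < γ₀) (hθ0 : 0 ≤ θ) (hθ1 : θ ≤ 1)
    (hconv : GeomRate S.β0 binf c₀ θ) (hlist : ∀ k, k ≤ k₁ → m ≤ S.β0 k) (hrem : RemainderConst S γ₀ r)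
    (hr : r < m - c₀ * θ ^ k₁ * (1 + θ)) (hup : BetaUpperH β' γ₀ β) (hcont : BetaContH γ₀ β) :
    EndpointExistence C :=
  (eventualFormOfMarginConst S hγ₀ hθ0 hθ1 hconv hlist hrem hr hup hcont).endpointExistence hgen

/-- **THEOREM 2 AS PRINTED, MARGIN × CONSTANT — the constant-form twin of `RateCertificate.thm2Printed_of_margin`.**
Inputs: the DAG (`ForwardGenerated`), `1 < L`; the printed split `S`; (asym) `GeomRate S.β0 binf c₀ θ`, `0 ≤ θ ≤ 1`,
`binf` ANY real; (cap) ONE-SIDED certified lower values `m ≤ β⁰_{k+1}` for `k ≤ k₁`; (asym2/an4) `RemainderConst S γ₀ r`;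
the ONE numeric condition `r < m − c₀θ^{k₁}(1 + θ)`; (C); (U).  Binder list = asym1's with `(hgap, hCr, haf1)` ↦
`(hrem, hr)`.  Lower constant of (0.31): `(m − c₀θ^{k₁}(1 + θ) − r)/log L`, on the FULL box `]0,γ₀]`.
[cite: Balaban1987RG1, Thm 2 p.259 with (0.31)] -/
theorem thm2Printed_of_marginConst {C : B12.Construction} (hgen : ForwardGenerated C β) {L : ℝ} (hL : 1 < L)
    (S : B12Beta.OneLoopSplit β) {γ₀ binf c₀ θ r β' m : ℝ} {k₁ : ℕ} (hγ₀ : 0 < γ₀) (hθ0 : 0 ≤ θ) (hθ1 : θ ≤ 1)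
    (hconv : GeomRate S.β0 binf c₀ θ) (hlist : ∀ k, k ≤ k₁ → m ≤ S.β0 k) (hrem : RemainderConst S γ₀ r)
    (hr : r < m - c₀ * θ ^ k₁ * (1 + θ)) (hcont : BetaContH γ₀ β) (hup : BetaUpperH β' γ₀ β) :
    B12.Thm2Printed C L :=
  thm2Printed_of_floor_const hgen hL S hγ₀ (hconv.lower_of_list hθ0 hθ1 hlist) hrem hr hcont hup

/-- **Discrete asymptotic freedom `BetaAFH β`, margin × constant** (witness box `γ₀` itself, constant
`m − c₀θ^{k₁}(1 + θ) − r`). [folklore] -/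
theorem betaAFH_of_marginConst (S : B12Beta.OneLoopSplit β) {γ₀ binf c₀ θ r m : ℝ} {k₁ : ℕ} (hγ₀ : 0 < γ₀)
    (hθ0 : 0 ≤ θ) (hθ1 : θ ≤ 1) (hconv : GeomRate S.β0 binf c₀ θ) (hlist : ∀ k, k ≤ k₁ → m ≤ S.β0 k)
    (hrem : RemainderConst S γ₀ r) (hr : r < m - c₀ * θ ^ k₁ * (1 + θ)) : BetaAFH β :=
  betaAFH_of_floor_const S hγ₀ (hconv.lower_of_list hθ0 hθ1 hlist) hrem hr

/-- **… from the CAUCHY shape of the rate** (`c₀ = c/(1 − θ)`, `θ < 1`; the constructed limit never appears) — twin of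
`RateCertificate.thm2Printed_of_cauchyMargin`. [cite: Balaban1987RG1, Thm 2 p.259 with (0.31)] -/
theorem thm2Printed_of_cauchyMarginConst {C : B12.Construction} (hgen : ForwardGenerated C β) {L : ℝ} (hL : 1 < L)
    (S : B12Beta.OneLoopSplit β) {γ₀ c θ r β' m : ℝ} {k₁ : ℕ} (hγ₀ : 0 < γ₀) (hθ0 : 0 ≤ θ) (hθ1 : θ < 1)
    (hrate : CauchyRate S.β0 c θ) (hlist : ∀ k, k ≤ k₁ → m ≤ S.β0 k) (hrem : RemainderConst S γ₀ r)
    (hr : r < m - c / (1 - θ) * θ ^ k₁ * (1 + θ)) (hcont : BetaContH γ₀ β) (hup : BetaUpperH β' γ₀ β) :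
    B12.Thm2Printed C L :=
  thm2Printed_of_marginConst hgen hL S hγ₀ hθ0 hθ1.le (hrate.geomRate hθ1) hlist hrem hr hcont hup

/-- **… through the SYMBOL SOCKET** (`RateCertificate` §6; `c₀ = (3/2)c/(1 − θ)`): a symbol step rate for the one-loop
kernels, the identification `S.β0 k = secondMoment (P k) μ ν` ((1.22) at zero couplings), the one-sided list, the
constant remainder and the one condition — twin of `RateCertificate.thm2Printed_of_symbolMargin`.
[cite: Balaban1987RG1, (1.22) p.264 and Thm 2 p.259 with (0.31)] -/
theorem thm2Printed_of_symbolMarginConst {C : B12.Construction} (hgen : ForwardGenerated C β) {L : ℝ} (hL : 1 < L)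
    (S : B12Beta.OneLoopSplit β) {P : ℕ → B12Beta.Kernel d} {μ ν : Fin d}
    (hP : ∀ k, PolarizationSign.MomentSummable (P k) 2) (hβ0 : ∀ k, S.β0 k = B12Beta.secondMoment (P k) μ ν)
    {γ₀ c θ r β' m : ℝ} {k₁ : ℕ} (hγ₀ : 0 < γ₀) (hθ0 : 0 ≤ θ) (hθ1 : θ < 1) (hrate : SymbolStepRate P μ ν c θ)
    (hlist : ∀ k, k ≤ k₁ → m ≤ S.β0 k) (hrem : RemainderConst S γ₀ r)
    (hr : r < m - 3 / 2 * c / (1 - θ) * θ ^ k₁ * (1 + θ)) (hcont : BetaContH γ₀ β) (hup : BetaUpperH β' γ₀ β) :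
    B12.Thm2Printed C L :=
  thm2Printed_of_cauchyMarginConst hgen hL S hγ₀ hθ0 hθ1 (hrate.cauchyRate hP hβ0) hlist hrem hr hcont hup

/-- **… from a STRIP STEP RATE** (`RateCertificate` §8, momentum route (S2); `c₀ = 3c/(R²(1 − θ))` by Cauchy's estimate
on the circle of radius `R` where the exponential moments hold) — twin of `RateCertificate.thm2Printed_of_stripMargin`.
[cite: Balaban1987RG1, (1.22) p.264 and Thm 2 p.259 with (0.31)] -/
theorem thm2Printed_of_stripMarginConst {C : B12.Construction} (hgen : ForwardGenerated C β) {L : ℝ} (hL : 1 < L)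
    (S : B12Beta.OneLoopSplit β) {P : ℕ → B12Beta.Kernel d} {μ ν : Fin d}
    (hP : ∀ k, PolarizationSign.MomentSummable (P k) 2) (hβ0 : ∀ k, S.β0 k = B12Beta.secondMoment (P k) μ ν)
    {γ₀ R c θ r β' m : ℝ} {k₁ : ℕ} (hγ₀ : 0 < γ₀) (hR : 0 < R) (hθ0 : 0 ≤ θ) (hθ1 : θ < 1)
    (hrate : StripStepRate P μ ν R c θ)
    (hE : ∀ k, ∀ v ∈ ({Pi.single μ 1, Pi.single ν 1, Pi.single μ 1 + Pi.single ν 1} : Set (Fin d → ℤ)),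
      MomentSymbol.ExpMoment (P k μ ν) v R)
    (hlist : ∀ k, k ≤ k₁ → m ≤ S.β0 k) (hrem : RemainderConst S γ₀ r)
    (hr : r < m - 3 * c / R ^ 2 / (1 - θ) * θ ^ k₁ * (1 + θ)) (hcont : BetaContH γ₀ β) (hup : BetaUpperH β' γ₀ β) :
    B12.Thm2Printed C L :=
  thm2Printed_of_cauchyMarginConst hgen hL S hγ₀ hθ0 hθ1 (hrate.cauchyRate hR hP hE hβ0) hlist hrem hr hcont hup

/-- The one condition is a satisfiable NUMERIC restriction on ε₁ once asym1's gap holds: for `c₀θ^{k₁}(1 + θ) < m` and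
any coefficient `K` there is `ε₁ > 0` with `ε₁·K < m − c₀θ^{k₁}(1 + θ)` (printed type "ε₁ sufficiently small", [II]
p. 21; whether the inductive construction runs at that ε₁ is the content of the leaves).
[cite: Balaban1988RG2Cluster, p.21 (before (2.40) and after (2.41))] -/
theorem exists_eps1_lt_margin {c₀ θ m : ℝ} {k₁ : ℕ} (K : ℝ) (hgap : c₀ * θ ^ k₁ * (1 + θ) < m) :
    ∃ ε₁ : ℝ, 0 < ε₁ ∧ ε₁ * K < m - c₀ * θ ^ k₁ * (1 + θ) :=
  exists_eps1_lt _ K (margin_pos hgap)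

/-- **THEOREM 2 AS PRINTED, MARGIN × CONSTANT, THE REMAINDER SLOT FILLED BY A WINDOW CHAIN** `R : ChainL d M μ ν S γ₀ c ℓ
α₂ B₃` (printed leaves BY NAME as fields; wall item (D4)) under `CondsL`, the closing relation `R22gen`, the printed signs
and the ONE condition `ε₁·K_rem,L < m − c₀θ^{k₁}(1 + θ)` — `ChainL.abs_beta1_le` ∘ `thm2Printed_of_marginConst`.
Binders and their status: `hgen` MODELLING; `hL` printed; `hconv/hθ0/hθ1` asym1 (LOCATED-UNPRINTED, O-asym1-1);
`hlist` cap (COMPUTATIONAL LEAVES, lower values only); `R, hC, h22, hs, hd, hM` an4/asym2 (printed leaves as fields,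
k-free closed-form thresholds); `hε₁` printed-TYPE restriction, k-free; `hcont` (C) (D5); `hup` (U).  NOT Theorem 2
unconditionally. [cite: Balaban1987RG1, Thm 2 p.259 with (0.31); Balaban1988RG2Cluster, (2.38) p.20 and p.21] -/
theorem thm2Printed_of_marginChainL {C : B12.Construction} (hgen : ForwardGenerated C β) {L : ℝ} (hL : 1 < L)
    (S : B12Beta.OneLoopSplit β) {M : ℕ} {μ ν : Fin d} {γ₀ : ℝ} {c : B13.Consts} {ℓ α₂ B₃ : ℝ}
    (R : ChainL d M μ ν S γ₀ c ℓ α₂ B₃) (hC : CondsL d c ℓ) (h22 : c.R22gen ℓ) (hs : SignsL c α₂ B₃) (hd : 0 < d)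
    (hM : 0 < M) {binf c₀ θ β' m : ℝ} {k₁ : ℕ} (hγ₀ : 0 < γ₀) (hθ0 : 0 ≤ θ) (hθ1 : θ ≤ 1)
    (hconv : GeomRate S.β0 binf c₀ θ) (hlist : ∀ k, k ≤ k₁ → m ≤ S.β0 k)
    (hε₁ : c.ε₁ * remCoeffL d M c α₂ B₃ < m - c₀ * θ ^ k₁ * (1 + θ)) (hcont : BetaContH γ₀ β)
    (hup : BetaUpperH β' γ₀ β) : B12.Thm2Printed C L :=
  thm2Printed_of_marginConst hgen hL S hγ₀ hθ0 hθ1 hconv hlist (R.abs_beta1_le hC h22 hs hd hM) hε₁ hcont hup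

/-- **… THE REMAINDER SLOT FILLED BY A TORUS CHAIN** `R : ChainT d M μ ν S γ₀ c ℓ α₂ B₃` (periodic carrier of print; same
`K_rem,L`; `ChainT.abs_beta1_le`). [cite: Balaban1987RG1, Thm 2 p.259 with (0.31); Balaban1988RG2Cluster, (2.38) p.20 and p.21] -/
theorem thm2Printed_of_marginChainT {C : B12.Construction} (hgen : ForwardGenerated C β) {L : ℝ} (hL : 1 < L)
    (S : B12Beta.OneLoopSplit β) {M : ℕ} [NeZero M] {μ ν : Fin d} {γ₀ : ℝ} {c : B13.Consts} {ℓ α₂ B₃ : ℝ}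
    (R : ChainT d M μ ν S γ₀ c ℓ α₂ B₃) (hC : CondsL d c ℓ) (h22 : c.R22gen ℓ) (hs : SignsL c α₂ B₃) (hd : 0 < d)
    {binf c₀ θ β' m : ℝ} {k₁ : ℕ} (hγ₀ : 0 < γ₀) (hθ0 : 0 ≤ θ) (hθ1 : θ ≤ 1) (hconv : GeomRate S.β0 binf c₀ θ)
    (hlist : ∀ k, k ≤ k₁ → m ≤ S.β0 k) (hε₁ : c.ε₁ * remCoeffL d M c α₂ B₃ < m - c₀ * θ ^ k₁ * (1 + θ))
    (hcont : BetaContH γ₀ β) (hup : BetaUpperH β' γ₀ β) : B12.Thm2Printed C L :=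
  thm2Printed_of_marginConst hgen hL S hγ₀ hθ0 hθ1 hconv hlist (R.abs_beta1_le hC h22 hs hd) hε₁ hcont hup

/-- **… window chain, with the ELEMENTARY closed-form coefficient** `E = RemainderConstNumerals.elemCoeffL d M c α₂ B₃`
(no infinite sum left; `RemainderConstNumerals.ChainL.abs_beta1_le_elem`), condition `ε₁·E < m − c₀θ^{k₁}(1 + θ)`.
[cite: Balaban1987RG1, Thm 2 p.259 with (0.31); Balaban1988RG2Cluster, (2.38) p.20 and p.21] -/
theorem thm2Printed_of_marginChainL_elem {C : B12.Construction} (hgen : ForwardGenerated C β) {L : ℝ} (hL : 1 < L)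
    (S : B12Beta.OneLoopSplit β) {M : ℕ} {μ ν : Fin d} {γ₀ : ℝ} {c : B13.Consts} {ℓ α₂ B₃ : ℝ}
    (R : ChainL d M μ ν S γ₀ c ℓ α₂ B₃) (hC : CondsL d c ℓ) (h22 : c.R22gen ℓ) (hs : SignsL c α₂ B₃) (hd : 0 < d)
    (hM : 0 < M) {binf c₀ θ β' m : ℝ} {k₁ : ℕ} (hγ₀ : 0 < γ₀) (hθ0 : 0 ≤ θ) (hθ1 : θ ≤ 1)
    (hconv : GeomRate S.β0 binf c₀ θ) (hlist : ∀ k, k ≤ k₁ → m ≤ S.β0 k)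
    (hε₁ : c.ε₁ * elemCoeffL d M c α₂ B₃ < m - c₀ * θ ^ k₁ * (1 + θ)) (hcont : BetaContH γ₀ β)
    (hup : BetaUpperH β' γ₀ β) : B12.Thm2Printed C L :=
  thm2Printed_of_marginConst hgen hL S hγ₀ hθ0 hθ1 hconv hlist
    (RemainderConstNumerals.ChainL.abs_beta1_le_elem R hC h22 hs hd hM) hε₁ hcont hup

/-- **The END statement `EndpointExistence C`, margin × constant, window chain.**
[cite: Balaban1987RG1, Thm 2 p.259 (first sentence); Balaban1988RG2Cluster, (2.38) p.20 and p.21] -/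
theorem endpointExistence_of_marginChainL {C : B12.Construction} (hgen : ForwardGenerated C β)
    (S : B12Beta.OneLoopSplit β) {M : ℕ} {μ ν : Fin d} {γ₀ : ℝ} {c : B13.Consts} {ℓ α₂ B₃ : ℝ}
    (R : ChainL d M μ ν S γ₀ c ℓ α₂ B₃) (hC : CondsL d c ℓ) (h22 : c.R22gen ℓ) (hs : SignsL c α₂ B₃) (hd : 0 < d)
    (hM : 0 < M) {binf c₀ θ β' m : ℝ} {k₁ : ℕ} (hγ₀ : 0 < γ₀) (hθ0 : 0 ≤ θ) (hθ1 : θ ≤ 1)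
    (hconv : GeomRate S.β0 binf c₀ θ) (hlist : ∀ k, k ≤ k₁ → m ≤ S.β0 k)
    (hε₁ : c.ε₁ * remCoeffL d M c α₂ B₃ < m - c₀ * θ ^ k₁ * (1 + θ)) (hup : BetaUpperH β' γ₀ β)
    (hcont : BetaContH γ₀ β) : EndpointExistence C :=
  endpointExistence_of_marginConst hgen S hγ₀ hθ0 hθ1 hconv hlist (R.abs_beta1_le hC h22 hs hd hM) hε₁ hup hcont

/-- **… `EndpointExistence C`, margin × constant, torus chain.**
[cite: Balaban1987RG1, Thm 2 p.259 (first sentence); Balaban1988RG2Cluster, (2.38) p.20 and p.21] -/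
theorem endpointExistence_of_marginChainT {C : B12.Construction} (hgen : ForwardGenerated C β)
    (S : B12Beta.OneLoopSplit β) {M : ℕ} [NeZero M] {μ ν : Fin d} {γ₀ : ℝ} {c : B13.Consts} {ℓ α₂ B₃ : ℝ}
    (R : ChainT d M μ ν S γ₀ c ℓ α₂ B₃) (hC : CondsL d c ℓ) (h22 : c.R22gen ℓ) (hs : SignsL c α₂ B₃) (hd : 0 < d)
    {binf c₀ θ β' m : ℝ} {k₁ : ℕ} (hγ₀ : 0 < γ₀) (hθ0 : 0 ≤ θ) (hθ1 : θ ≤ 1) (hconv : GeomRate S.β0 binf c₀ θ)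
    (hlist : ∀ k, k ≤ k₁ → m ≤ S.β0 k) (hε₁ : c.ε₁ * remCoeffL d M c α₂ B₃ < m - c₀ * θ ^ k₁ * (1 + θ))
    (hup : BetaUpperH β' γ₀ β) (hcont : BetaContH γ₀ β) : EndpointExistence C :=
  endpointExistence_of_marginConst hgen S hγ₀ hθ0 hθ1 hconv hlist (R.abs_beta1_le hC h22 hs hd) hε₁ hup hcont

/-! ### Non-vacuity of §7 on a genuinely scale-dependent family -/

namespace Witness

/-- The scale-dependent family `β_{k+1} ≡ 1 + (1/2)^k` (no coupling dependence) — the sequence of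
`RateCertificate.Witness.margin_nonvacuous`. [folklore] -/
def geomFamily : HBeta := fun k _ => 1 + (1 / 2 : ℝ) ^ k

/-- Its split: `β⁰_{k+1} = 1 + (1/2)^k`, `β¹ ≡ 0`. [folklore] -/
def splitGeom : B12Beta.OneLoopSplit geomFamily where
  β0 := fun k => 1 + (1 / 2 : ℝ) ^ k
  β1 := fun _ _ => 0
  split := fun _ _ => by simp [geomFamily]
  vanish := fun _ _ _ => rfl

/-- The rate `GeomRate β⁰ 1 1 (1/2)` (`|β⁰_{k+1} − 1| = (1/2)^k`). [folklore] -/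
theorem geomRate_splitGeom : GeomRate splitGeom.β0 1 1 (1 / 2) := fun k => by
  show |1 + (1 / 2 : ℝ) ^ k - 1| ≤ 1 * (1 / 2) ^ k
  rw [add_sub_cancel_left, one_mul]
  exact le_of_eq (abs_of_nonneg (by positivity))

/-- The one-sided certified list `1 ≤ β⁰_{k+1}` at the depths `k ≤ 1`. [folklore] -/
theorem list_splitGeom : ∀ k, k ≤ 1 → (1 : ℝ) ≤ splitGeom.β0 k := fun k _ => by
  show (1 : ℝ) ≤ 1 + (1 / 2 : ℝ) ^ k
  have : 0 ≤ (1 / 2 : ℝ) ^ k := by positivity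
  linarith

/-- The constant-form remainder bound with `r = 0` on `]0,1]`-boxes. [folklore] -/
theorem remainderConst_splitGeom : RemainderConst splitGeom 1 0 := fun k p _ => by
  show |(0 : ℝ)| ≤ 0
  simp

/-- The printed-type upper bound `β_{k+1} ≤ 2` on `]0,1]`-boxes. [folklore] -/
theorem betaUpperH_geomFamily : BetaUpperH 2 1 geomFamily := fun k v _ => by
  show 1 + (1 / 2 : ℝ) ^ k ≤ 2
  have : (1 / 2 : ℝ) ^ k ≤ 1 := pow_le_one₀ (by norm_num) (by norm_num)
  linarith

/-- `eventualFormOfMarginConst` instantiated: `γ₀ = 1`, certified value `m = 1` at depths `k ≤ k₁ = 1`, rate constants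
`binf = c₀ = 1`, `θ = 1/2`, remainder `r = 0`, `β′ = 2`; the one condition reads `0 < 1 − (1/2)(3/2) = 1/4`. [folklore] -/
def eventualFormMarginGeom : EventualForm geomFamily :=
  eventualFormOfMarginConst splitGeom (γ₀ := 1) (β' := 2) (m := 1) (k₁ := 1) one_pos (by norm_num) (by norm_num)
    geomRate_splitGeom list_splitGeom remainderConst_splitGeom (by norm_num) betaUpperH_geomFamily
    (fun _ => continuousOn_const)

/-- Its lower constant is `1/4` (`= 1 − 1·(1/2)·(3/2) − 0`) and its threshold scale is `0`. [folklore] -/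
theorem eventualFormMarginGeom_consts : eventualFormMarginGeom.b = 1 / 4 ∧ eventualFormMarginGeom.k₀ = 0 := by
  refine ⟨?_, rfl⟩
  show (1 : ℝ) - 1 * (1 / 2) ^ 1 * (1 + 1 / 2) - 0 = 1 / 4
  norm_num

/-- `BetaAFH` of the scale-dependent family from `betaAFH_of_marginConst` (the §7 hypotheses minus the DAG, (C), (U) are
jointly satisfiable with a k-dependent one-loop coefficient). [folklore] -/
theorem betaAFH_geomFamily : BetaAFH geomFamily :=
  betaAFH_of_marginConst splitGeom (γ₀ := 1) (m := 1) (k₁ := 1) one_pos (by norm_num) (by norm_num) geomRate_splitGeom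
    list_splitGeom remainderConst_splitGeom (by norm_num)

/-- … and the certified DEPTH is needed: with the first coefficient only (`k₁ = 0`) the one condition fails
(`1·1·(3/2) + 0 ≥ 1`), with `k₁ = 1` it holds — one more certified depth buys the factor `θ`. [folklore] -/
theorem marginConst_depth : ¬ (0 : ℝ) < 1 - 1 * (1 / 2 : ℝ) ^ 0 * (1 + 1 / 2) ∧
    (0 : ℝ) < 1 - 1 * (1 / 2 : ℝ) ^ 1 * (1 + 1 / 2) := by
  constructor <;> norm_num

end Witness

/-! ## 8. (v1.2) REAL-ZONE × CONSTANT and BLOCK-TRANSFER × CONSTANT — the constant-form twins of `RateCertificate` §9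
(real-zone socket, three lines) and §10 (block transfer); the fine-lattice half of (0.31) with NO threshold

`RateCertificate` v1.5 §9 (`RealStepRate`, `StripBound`, `RealStepRate.stripStepRate`, `thm2Printed_of_realMargin`) and
v1.6 §10 (`blockSum`, `cauchyRate_blockSum`, `thm2Printed_of_blockMargin`) end, like §7/§8 there, in the LINEAR remainder
slot (AF-1) `(hCr, haf1)` on the shrunk box.  The twins below put the CONSTANT form `RemainderConst S γ₀ r` in that slot,
with asym1's binder lists otherwise VERBATIM and `(hgap, hCr, haf1)` ↦ `(hrem, hr)`: the ONE numeric condition is again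
`r < m − c₀θ₁^{k₁}(1 + θ₁)` at the transported rate constants — real zone: `θ₁ = θ^{1−ρ/R}`,
`c₀ = 3c^{1−ρ/R}(2M)^{ρ/R}/(ρ²(1 − θ₁))` (asym1's radii `(R, r)` are written `(R, ρ)` here because `r` is the remainder
constant of this file); block transfer: `θ₁ = θⁿ`, `c₀ = a(Σ_{i<n}θ^i)²/(1 − θⁿ)` for a small-block `CauchyRate b a θ`.
On the block road the construction runs at the LARGE block size `L'` (think `L' = Lⁿ = 27`, inside the printed regime
«L odd > 11», [I] p. 251) and `hblock : S.β0 k = blockSum n b k` is asym1's located COMPOSITION HYPOTHESIS Q-asym1-5 (NOT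
printed, NOT asserted — a binder); the remainder constant is the one of the chain AT `L'` (`r = ε₁·K_rem,L'`, k-free by the
same closed formula; the chain's `ℓ` is tied to `L'` only through the closing relation `R22gen ℓ`).  Last, the fine-lattice
half of (0.31) on the margin × constant road (`thm2_fineLattices_of_marginConst`): threshold scale `k₀ = 0`, so Theorem 2's
"for `K ≥ k₀`" and "`1/γ² + β′k₀ ≤ 1/g²`" provisos DISAPPEAR — every `K` and every `0 < g ≤ γ ≤ γ₀`.  [folklore] algebra
joining landed theorems by name; nothing of the series is discharged; NOT Theorem 2 unconditionally. -/

/-- **THEOREM 2 AS PRINTED from a REAL step rate, CONSTANT remainder — twin of `RateCertificate.thm2Printed_of_realMargin`**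
(three lines ∘ Cauchy ∘ margin ∘ §7): inputs the DAG, `1 < L`, the split `S`, the one-loop kernels `P` with
`S.β0 k = secondMoment (P k) μ ν` ((1.22) at zero couplings); (asym1, OPEN) `RealStepRate P μ ν c θ` (`0 < c`,
`0 < θ < 1`); the uniform strip bound `M` of radius `R` with `c ≤ 2M` and the exponential moments of radius `R` (both from
the printed decay (5.10): `_decay` form below); radii `0 < ρ < R`; (cap) the one-sided list `m ≤ β⁰_{k+1}`, `k ≤ k₁`;
(asym2/an4) `RemainderConst S γ₀ r`; the ONE condition `r < m − c₀θ₁^{k₁}(1 + θ₁)`, `θ₁ = θ^{1−ρ/R}`,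
`c₀ = 3c^{1−ρ/R}(2M)^{ρ/R}/(ρ²(1 − θ₁))`; (C); (U).  Box `]0,γ₀]` NOT shrunk.
[cite: Balaban1987RG1, (1.22) p.264 and (5.10) p.293 and Thm 2 p.259 with (0.31)] -/
theorem thm2Printed_of_realMarginConst {C : B12.Construction} (hgen : ForwardGenerated C β) {L : ℝ} (hL : 1 < L)
    (S : B12Beta.OneLoopSplit β) {P : ℕ → B12Beta.Kernel d} {μ ν : Fin d}
    (hP : ∀ k, PolarizationSign.MomentSummable (P k) 2) (hβ0 : ∀ k, S.β0 k = B12Beta.secondMoment (P k) μ ν)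
    {γ₀ R ρ c θ M r β' m : ℝ} {k₁ : ℕ} (hγ₀ : 0 < γ₀) (hR : 0 < R) (hρ : 0 < ρ) (hρR : ρ < R) (hc : 0 < c)
    (hθ0 : 0 < θ) (hθ1 : θ < 1) (hrate : RealStepRate P μ ν c θ) (hB : StripBound P μ ν R M) (hcM : c ≤ 2 * M)
    (hE : ∀ k, ∀ v ∈ ({Pi.single μ 1, Pi.single ν 1, Pi.single μ 1 + Pi.single ν 1} : Set (Fin d → ℤ)),
      MomentSymbol.ExpMoment (P k μ ν) v R)
    (hlist : ∀ k, k ≤ k₁ → m ≤ S.β0 k) (hrem : RemainderConst S γ₀ r)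
    (hr : r < m - 3 * (c ^ (1 - ρ / R) * (2 * M) ^ (ρ / R)) / ρ ^ 2 / (1 - θ ^ (1 - ρ / R))
      * (θ ^ (1 - ρ / R)) ^ k₁ * (1 + θ ^ (1 - ρ / R)))
    (hcont : BetaContH γ₀ β) (hup : BetaUpperH β' γ₀ β) : B12.Thm2Printed C L :=
  have hθ' := ratio_lt_one hθ0.le hθ1 hR hρR
  thm2Printed_of_stripMarginConst hgen hL S hP hβ0 hγ₀ hρ hθ'.1 hθ'.2
    (hrate.stripStepRate hB hE hR hρR.le hc hθ0 hθ1.le hcM) (fun k v hv => (hE k v hv).mono hρR.le) hlist hrem hr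
    hcont hup

/-- **(AF-0) on ALL boxes from a REAL step rate, CONSTANT remainder**: `β_{k+1} ≥ m − c₀θ₁^{k₁}(1 + θ₁) − r` on
`]0,γ₀]^{k+1}` for every k (`θ₁`, `c₀` as above; `RealStepRate.stripStepRate` ∘ `StripStepRate.cauchyRate` ∘
`CauchyRate.geomRate` ∘ `betaLowerH_of_marginConst`). [cite: Balaban1987RG1, (1.22) p.264 and (2.12)–(2.14) p.268] -/
theorem betaLowerH_of_realMarginConst (S : B12Beta.OneLoopSplit β) {P : ℕ → B12Beta.Kernel d} {μ ν : Fin d}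
    (hP : ∀ k, PolarizationSign.MomentSummable (P k) 2) (hβ0 : ∀ k, S.β0 k = B12Beta.secondMoment (P k) μ ν)
    {γ₀ R ρ c θ M r m : ℝ} {k₁ : ℕ} (hR : 0 < R) (hρ : 0 < ρ) (hρR : ρ < R) (hc : 0 < c) (hθ0 : 0 < θ)
    (hθ1 : θ < 1) (hrate : RealStepRate P μ ν c θ) (hB : StripBound P μ ν R M) (hcM : c ≤ 2 * M)
    (hE : ∀ k, ∀ v ∈ ({Pi.single μ 1, Pi.single ν 1, Pi.single μ 1 + Pi.single ν 1} : Set (Fin d → ℤ)),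
      MomentSymbol.ExpMoment (P k μ ν) v R)
    (hlist : ∀ k, k ≤ k₁ → m ≤ S.β0 k) (hrem : RemainderConst S γ₀ r) :
    BetaLowerH (m - 3 * (c ^ (1 - ρ / R) * (2 * M) ^ (ρ / R)) / ρ ^ 2 / (1 - θ ^ (1 - ρ / R))
      * (θ ^ (1 - ρ / R)) ^ k₁ * (1 + θ ^ (1 - ρ / R)) - r) γ₀ β :=
  have hθ' := ratio_lt_one hθ0.le hθ1 hR hρR
  betaLowerH_of_marginConst S hθ'.1 hθ'.2.le
    (((hrate.stripStepRate hB hE hR hρR.le hc hθ0 hθ1.le hcM).cauchyRate hρ hP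
      (fun k v hv => (hE k v hv).mono hρR.le) hβ0).geomRate hθ'.2) hlist hrem

/-- **… ALL-IN-ONE FROM THE PRINTED DECAY (5.10)**: with (5.10) constants `(A, δ₁)` uniform in k for the one-loop kernels,
`μ ≠ ν` and `R < δ₁`, the strip bound (`M = A·Σ_x e^{−(δ₁−R)|x|₁}`, `stripBound_of_decay510`) and the exponential
moments (`expMoments_of_decay510`) are discharged.  What remains OPEN, precisely: the real step rate (asym1, O-asym1-1),
the certified list (cap), the constant remainder (the chain leaves, (D4)) and (C) ((D5)); printed-SHAPE binders: (5.10)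
for the one-loop kernels, (U); modelling: the DAG.  NOT Theorem 2 unconditionally.
[cite: Balaban1987RG1, (5.10) p.293 and Thm 2 p.259 with (0.31)] -/
theorem thm2Printed_of_realMarginConst_decay {C : B12.Construction} (hgen : ForwardGenerated C β) {L : ℝ}
    (hL : 1 < L) (S : B12Beta.OneLoopSplit β) {P : ℕ → B12Beta.Kernel d} {μ ν : Fin d} (hne : μ ≠ ν)
    (hP : ∀ k, PolarizationSign.MomentSummable (P k) 2) (hβ0 : ∀ k, S.β0 k = B12Beta.secondMoment (P k) μ ν)
    {γ₀ A δ₁ R ρ c θ r β' m : ℝ} {k₁ : ℕ} (hγ₀ : 0 < γ₀) (hdec : ∀ k, B12Sec2to5.Decay510 (P k μ ν) A δ₁)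
    (hR : 0 < R) (hRδ : R < δ₁) (hρ : 0 < ρ) (hρR : ρ < R) (hc : 0 < c) (hθ0 : 0 < θ) (hθ1 : θ < 1)
    (hrate : RealStepRate P μ ν c θ)
    (hcM : c ≤ 2 * (A * ∑' x : Fin d → ℤ, Real.exp (-(δ₁ - R) * B12Sec2to5.l1 x)))
    (hlist : ∀ k, k ≤ k₁ → m ≤ S.β0 k) (hrem : RemainderConst S γ₀ r)
    (hr : r < m - 3 * (c ^ (1 - ρ / R) * (2 * (A * ∑' x : Fin d → ℤ, Real.exp (-(δ₁ - R) * B12Sec2to5.l1 x)))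
      ^ (ρ / R)) / ρ ^ 2 / (1 - θ ^ (1 - ρ / R)) * (θ ^ (1 - ρ / R)) ^ k₁ * (1 + θ ^ (1 - ρ / R)))
    (hcont : BetaContH γ₀ β) (hup : BetaUpperH β' γ₀ β) : B12.Thm2Printed C L :=
  thm2Printed_of_realMarginConst hgen hL S hP hβ0 hγ₀ hR hρ hρR hc hθ0 hθ1 hrate
    (stripBound_of_decay510 hne hdec hR.le hRδ) hcM (expMoments_of_decay510 hne hdec hR.le hRδ) hlist hrem hr hcont
    hup

/-- Block transfer, bookkeeping: the COMPOSITION HYPOTHESIS `S.β0 k = blockSum n b k` (Q-asym1-5; a binder) and a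
small-block `CauchyRate b a θ` give `CauchyRate S.β0 (a(Σ_{i<n}θ^i)²) (θⁿ)` (`RateCertificate.cauchyRate_blockSum`).
[folklore] -/
theorem cauchyRate_of_block (S : B12Beta.OneLoopSplit β) {b : ℕ → ℝ} {n : ℕ} (hblock : ∀ k, S.β0 k = blockSum n b k)
    {a θ : ℝ} (hrate : CauchyRate b a θ) : CauchyRate S.β0 (a * (∑ i ∈ Finset.range n, θ ^ i) ^ 2) (θ ^ n) := by
  intro k
  rw [hblock, hblock]
  exact cauchyRate_blockSum hrate n k

/-- … and small-block block-sum certificates `m ≤ Σ_{i<n} b (n k + i)` (`k ≤ k₁`) are the one-sided list for `S.β0`.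
[folklore] -/
theorem list_of_block (S : B12Beta.OneLoopSplit β) {b : ℕ → ℝ} {n : ℕ} (hblock : ∀ k, S.β0 k = blockSum n b k)
    {m : ℝ} {k₁ : ℕ} (hlist : ∀ k, k ≤ k₁ → m ≤ blockSum n b k) : ∀ k, k ≤ k₁ → m ≤ S.β0 k :=
  fun k hk => (hblock k).symm ▸ hlist k hk

/-- **(AF-0) on ALL boxes at the LARGE block size, CONSTANT remainder**: the small-block rate `CauchyRate b a θ`
(`0 ≤ θ < 1`, `0 < n`), the composition hypothesis, the small-block certificates and `RemainderConst S γ₀ r` give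
`β_{k+1} ≥ m − a(Σ_{i<n}θ^i)²/(1 − θⁿ)·(θⁿ)^{k₁}(1 + θⁿ) − r` on `]0,γ₀]^{k+1}` for every k.
[cite: Balaban1987RG1, (1.22) p.264 and (2.12)–(2.14) p.268] -/
theorem betaLowerH_of_blockMarginConst (S : B12Beta.OneLoopSplit β) {b : ℕ → ℝ} {n : ℕ} (hn : 0 < n)
    (hblock : ∀ k, S.β0 k = blockSum n b k) {γ₀ a θ r m : ℝ} {k₁ : ℕ} (hθ0 : 0 ≤ θ) (hθ1 : θ < 1)
    (hrate : CauchyRate b a θ) (hlist : ∀ k, k ≤ k₁ → m ≤ blockSum n b k) (hrem : RemainderConst S γ₀ r) :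
    BetaLowerH (m - a * (∑ i ∈ Finset.range n, θ ^ i) ^ 2 / (1 - θ ^ n) * (θ ^ n) ^ k₁ * (1 + θ ^ n) - r) γ₀ β :=
  have hθ1' : θ ^ n < 1 := pow_lt_one₀ hθ0 hθ1 hn.ne'
  betaLowerH_of_marginConst S (pow_nonneg hθ0 n) hθ1'.le ((cauchyRate_of_block S hblock hrate).geomRate hθ1')
    (list_of_block S hblock hlist) hrem

/-- **THEOREM 2 AS PRINTED AT THE LARGE BLOCK SIZE `L'`, CONSTANT remainder — twin of
`RateCertificate.thm2Printed_of_blockMargin`** with `(hgap, hCr, haf1)` ↦ `(hrem, hr)`: the DAG at block size `L'`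
(`1 < L'`), its split `S`; (asym1 at the SMALL block size) `CauchyRate b a θ`, `0 ≤ θ < 1`, `0 < n`; the composition
hypothesis `hblock` (Q-asym1-5, a binder); (cap at the small block size) `m ≤ Σ_{i<n} b (n k + i)` for `k ≤ k₁`;
(asym2/an4, chain at `L'`) `RemainderConst S γ₀ r`; the ONE condition `r < m − a(Σ_{i<n}θ^i)²/(1 − θⁿ)·(θⁿ)^{k₁}(1 + θⁿ)`;
(C); (U).  [cite: Balaban1987RG1, Thm 2 p.259 with (0.31) and (1.22) p.264] -/
theorem thm2Printed_of_blockMarginConst {C : B12.Construction} (hgen : ForwardGenerated C β) {L' : ℝ} (hL : 1 < L')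
    (S : B12Beta.OneLoopSplit β) {b : ℕ → ℝ} {n : ℕ} (hn : 0 < n) (hblock : ∀ k, S.β0 k = blockSum n b k)
    {γ₀ a θ r β' m : ℝ} {k₁ : ℕ} (hγ₀ : 0 < γ₀) (hθ0 : 0 ≤ θ) (hθ1 : θ < 1) (hrate : CauchyRate b a θ)
    (hlist : ∀ k, k ≤ k₁ → m ≤ blockSum n b k) (hrem : RemainderConst S γ₀ r)
    (hr : r < m - a * (∑ i ∈ Finset.range n, θ ^ i) ^ 2 / (1 - θ ^ n) * (θ ^ n) ^ k₁ * (1 + θ ^ n))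
    (hcont : BetaContH γ₀ β) (hup : BetaUpperH β' γ₀ β) : B12.Thm2Printed C L' :=
  thm2Printed_of_cauchyMarginConst hgen hL S hγ₀ (pow_nonneg hθ0 n) (pow_lt_one₀ hθ0 hθ1 hn.ne')
    (cauchyRate_of_block S hblock hrate) (list_of_block S hblock hlist) hrem hr hcont hup

/-- **THE END STATEMENT `EndpointExistence C` AT THE LARGE BLOCK SIZE, CONSTANT remainder** (same inputs minus `L'`).
[cite: Balaban1987RG1, Thm 2 p.259 (first sentence)] -/
theorem endpointExistence_of_blockMarginConst {C : B12.Construction} (hgen : ForwardGenerated C β)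
    (S : B12Beta.OneLoopSplit β) {b : ℕ → ℝ} {n : ℕ} (hn : 0 < n) (hblock : ∀ k, S.β0 k = blockSum n b k)
    {γ₀ a θ r β' m : ℝ} {k₁ : ℕ} (hγ₀ : 0 < γ₀) (hθ0 : 0 ≤ θ) (hθ1 : θ < 1) (hrate : CauchyRate b a θ)
    (hlist : ∀ k, k ≤ k₁ → m ≤ blockSum n b k) (hrem : RemainderConst S γ₀ r)
    (hr : r < m - a * (∑ i ∈ Finset.range n, θ ^ i) ^ 2 / (1 - θ ^ n) * (θ ^ n) ^ k₁ * (1 + θ ^ n))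
    (hup : BetaUpperH β' γ₀ β) (hcont : BetaContH γ₀ β) : EndpointExistence C :=
  have hθ1' : θ ^ n < 1 := pow_lt_one₀ hθ0 hθ1 hn.ne'
  endpointExistence_of_marginConst hgen S hγ₀ (pow_nonneg hθ0 n) hθ1'.le
    ((cauchyRate_of_block S hblock hrate).geomRate hθ1') (list_of_block S hblock hlist) hrem hr hup hcont

/-- **THEOREM 2 AS PRINTED AT THE LARGE BLOCK SIZE, THE REMAINDER SLOT FILLED BY A WINDOW CHAIN AT `L'`**
`R : ChainL d M μ ν S γ₀ c ℓ α₂ B₃` (printed leaves BY NAME as fields, (D4)) under `CondsL`, `R22gen ℓ` (the closing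
relation at the large block size), the printed signs and the ONE condition
`ε₁·K_rem,L' < m − a(Σ_{i<n}θ^i)²/(1 − θⁿ)·(θⁿ)^{k₁}(1 + θⁿ)` (the small-block Cauchy constant is written `a`; `c` is the
record of printed constants).  Binders and status: `hgen` MODELLING; `hL` printed regime at `L'`; `hn, hrate, hθ0, hθ1`
asym1 at the small block size (LOCATED-UNPRINTED, O-asym1-1); `hblock` COMPOSITION HYPOTHESIS (Q-asym1-5, located, not
printed); `hlist` cap (small-block COMPUTATIONAL LEAVES, lower values only); `R, hC, h22, hs, hd, hM` an4/asym2 (printed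
leaves as fields); `hε₁` printed-TYPE restriction, k-free; `hcont` (C) (D5); `hup` (U).  NOT Theorem 2 unconditionally.
[cite: Balaban1987RG1, Thm 2 p.259 with (0.31); Balaban1988RG2Cluster, (2.38) p.20 and p.21] -/
theorem thm2Printed_of_blockMarginChainL {C : B12.Construction} (hgen : ForwardGenerated C β) {L' : ℝ} (hL : 1 < L')
    (S : B12Beta.OneLoopSplit β) {M : ℕ} {μ ν : Fin d} {γ₀ : ℝ} {c : B13.Consts} {ℓ α₂ B₃ : ℝ}
    (R : ChainL d M μ ν S γ₀ c ℓ α₂ B₃) (hC : CondsL d c ℓ) (h22 : c.R22gen ℓ) (hs : SignsL c α₂ B₃) (hd : 0 < d)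
    (hM : 0 < M) {b : ℕ → ℝ} {n : ℕ} (hn : 0 < n) (hblock : ∀ k, S.β0 k = blockSum n b k) {a θ β' m : ℝ}
    {k₁ : ℕ} (hγ₀ : 0 < γ₀) (hθ0 : 0 ≤ θ) (hθ1 : θ < 1) (hrate : CauchyRate b a θ)
    (hlist : ∀ k, k ≤ k₁ → m ≤ blockSum n b k)
    (hε₁ : c.ε₁ * remCoeffL d M c α₂ B₃ <
      m - a * (∑ i ∈ Finset.range n, θ ^ i) ^ 2 / (1 - θ ^ n) * (θ ^ n) ^ k₁ * (1 + θ ^ n))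
    (hcont : BetaContH γ₀ β) (hup : BetaUpperH β' γ₀ β) : B12.Thm2Printed C L' :=
  thm2Printed_of_blockMarginConst hgen hL S hn hblock hγ₀ hθ0 hθ1 hrate hlist (R.abs_beta1_le hC h22 hs hd hM) hε₁
    hcont hup

/-- **The lower half of (0.31) on FINE lattices, margin × constant — WITH NO THRESHOLD**: on this road the minimal
carrier has `k₀ = 0` (`eventualFormOfMarginConst_consts`), so `Assembly.EventualForm.thm2_fineLattices` holds for EVERY
number of steps `K` and every `0 < g ≤ γ ≤ γ₀` (the provisos `1/γ² + β′k₀ ≤ 1/g²` and `(3b + 2β′)k₀ ≤ bK` of the general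
form are empty), with the (0.31)-constant `b/2`, `b = m − c₀θ^{k₁}(1 + θ) − r`. [cite: Balaban1987RG1, Thm 2 (0.31) p.259] -/
theorem thm2_fineLattices_of_marginConst {C : B12.Construction} (hgen : ForwardGenerated C β)
    (S : B12Beta.OneLoopSplit β) {γ₀ binf c₀ θ r β' m : ℝ} {k₁ : ℕ} (hγ₀ : 0 < γ₀) (hθ0 : 0 ≤ θ) (hθ1 : θ ≤ 1)
    (hconv : GeomRate S.β0 binf c₀ θ) (hlist : ∀ k, k ≤ k₁ → m ≤ S.β0 k) (hrem : RemainderConst S γ₀ r)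
    (hr : r < m - c₀ * θ ^ k₁ * (1 + θ)) (hup : BetaUpperH β' γ₀ β) (hcont : BetaContH γ₀ β) :
    ∀ (n : ℕ) (γ : ℝ), 0 < γ → γ ≤ γ₀ → ∀ g : ℝ, 0 < g → g ≤ γ → ∀ K : ℕ,
      ∃ g0 : ℝ, (C ⟨K, n, g0⟩).flow.InInterval γ K ∧ (C ⟨K, n, g0⟩).flow.g K = g ∧
        Step.Discrete031 ((m - c₀ * θ ^ k₁ * (1 + θ) - r) / 2) β' K g (C ⟨K, n, g0⟩).flow.g := by
  intro n γ hγ hγle g hg hgγ K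
  refine (eventualFormOfMarginConst S hγ₀ hθ0 hθ1 hconv hlist hrem hr hup hcont).thm2_fineLattices hgen n γ hγ
    hγle g hg ?_ K ?_
  · show 1 / γ ^ 2 + β' * ((0 : ℕ) : ℝ) ≤ 1 / g ^ 2
    rw [Nat.cast_zero, mul_zero, add_zero]
    exact one_div_le_one_div_of_le (pow_pos hg 2) (pow_le_pow_left₀ hg.le hgγ 2)
  · show (3 * (m - c₀ * θ ^ k₁ * (1 + θ) - r) + 2 * β') * ((0 : ℕ) : ℝ) ≤ (m - c₀ * θ ^ k₁ * (1 + θ) - r) * K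
    rw [Nat.cast_zero, mul_zero]
    exact mul_nonneg (by linarith) (Nat.cast_nonneg K)

/-! ### Non-vacuity of the block-transfer × constant hypotheses (§8) with a genuine scale-dependent split -/

namespace Witness

/-- The hypotheses of `thm2Printed_of_blockMarginConst` other than the DAG, (C), (U) are jointly satisfiable by a
scale-DEPENDENT one-loop coefficient: small-block sequence `b j = 1 + (1/2)^j`, `n = 3`, `β_{k+1} ≡ β⁰_{k+1} = blockSum 3 b k
= 3 + (7/4)(1/8)^k`, `β¹ ≡ 0` (`r = 0`), `CauchyRate b (1/2) (1/2)`, small-block certificate `3 ≤ b₀ + b₁ + b₂` (`k₁ = 0`),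
and the one condition `0 < 3 − (1/2)(7/4)²/(7/8)·1·(9/8) = 33/32`. [folklore] -/
theorem blockMarginConst_nonvacuous :
    ∃ (β : HBeta) (S : B12Beta.OneLoopSplit β) (b : ℕ → ℝ) (n k₁ : ℕ) (γ₀ a θ m r : ℝ),
      0 < n ∧ (∀ k, S.β0 k = blockSum n b k) ∧ 0 < γ₀ ∧ 0 ≤ θ ∧ θ < 1 ∧ CauchyRate b a θ ∧
      (∀ k, k ≤ k₁ → m ≤ blockSum n b k) ∧ RemainderConst S γ₀ r ∧
      r < m - a * (∑ i ∈ Finset.range n, θ ^ i) ^ 2 / (1 - θ ^ n) * (θ ^ n) ^ k₁ * (1 + θ ^ n) ∧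
      S.β0 1 < S.β0 0 := by
  refine ⟨fun k _ => blockSum 3 (fun j => 1 + (1 / 2 : ℝ) ^ j) k,
    ⟨fun k => blockSum 3 (fun j => 1 + (1 / 2 : ℝ) ^ j) k, fun _ _ => 0, fun _ _ => (add_zero _).symm,
      fun _ _ _ => rfl⟩,
    fun j => 1 + (1 / 2 : ℝ) ^ j, 3, 0, 1, 1 / 2, 1 / 2, 3, 0, by norm_num, fun _ => rfl, one_pos, by norm_num,
    by norm_num, ?_, ?_, ?_, ?_, ?_⟩
  · intro k
    show |1 + (1 / 2 : ℝ) ^ (k + 1) - (1 + (1 / 2 : ℝ) ^ k)| ≤ 1 / 2 * (1 / 2) ^ k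
    rw [show (1 : ℝ) + (1 / 2) ^ (k + 1) - (1 + (1 / 2) ^ k) = -(1 / 2 * (1 / 2) ^ k) by ring, abs_neg,
      abs_of_nonneg (by positivity)]
  · intro k hk
    obtain rfl := Nat.le_zero.mp hk
    simp only [blockSum, Finset.sum_range_succ, Finset.sum_range_zero]
    norm_num
  · intro k p _
    show |(0 : ℝ)| ≤ 0
    simp
  · simp only [Finset.sum_range_succ, Finset.sum_range_zero]
    norm_num
  · show blockSum 3 (fun j => 1 + (1 / 2 : ℝ) ^ j) 1 < blockSum 3 (fun j => 1 + (1 / 2 : ℝ) ^ j) 0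
    simp only [blockSum, Finset.sum_range_succ, Finset.sum_range_zero]
    norm_num

end Witness

/-! ## 9. (v1.3) NEAR-SEQUENCE TRANSFER × CONSTANT REMAINDER — the constant-form twins of `RateCertificate` §11

`RateCertificate` v1.7 §11 (`NearRate a b e ϑ := ∀ k, |b k − a k| ≤ e·ϑ^k`; `NearRate.geomRate` (`c₀ ↦ c₀ + e`),
`NearRate.cauchyRate`, `NearRate.list` (`m ↦ m − e`), `NearRate.of_eq`; `thm2Printed_of_nearMargin` /
`_of_blockNearMargin`, `beta0_pos_all_of_nearMargin` / `_of_blockNearMargin` / `_of_blockMargin'`) types the INEQUALITY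
form of §10's composition hypothesis `hblock`: a rate and a one-sided certified list for a COMPARISON sequence `a` (any
road; for the genuine single B12 step of block size `Lⁿ` — scheme (S3) of asym1's §10 caveat — `a` = the block sums of the
small-block one-loop coefficients) TRANSFER to `S.β0` along the located nearness `NearRate a S.β0 e θ` (a one-loop
SCHEME-TRANSFER rate, asym1's Q-asym1-5 in inequality form: LOCATED, NOT printed, NEVER asserted — a binder; `e = 0` is
§8's `hblock`).  asym1's END theorems there end in the LINEAR remainder slot (AF-1) `(hgap, hCr, haf1)` on the shrunk box.
The twins below put the CONSTANT form `RemainderConst S γ₀ r` in that slot, binder lists otherwise VERBATIM with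
`(hgap, hCr, haf1)` ↦ `(hrem, hr)`; the ONE numeric condition is `r < (m − e) − (c₀ + e)θ^{k₁}(1 + θ)`, i.e.

    (c₀ + e)·θ^{k₁}·(1 + θ) + e + r < m ,      r = ε₁·K_rem,L' (k-free; the chain AT the construction's block size),

— the nearness constant `e` is paid TWICE, once in the transported rate constant and once in the transported certified
value; on the block road `θ₁ = θⁿ`, `c₀ = a(Σ_{i<n}θ^i)²/(1 − θⁿ)` from a small-block `CauchyRate b a θ`.  Box `]0,γ₀]`
NOT shrunk, threshold scale `k₀ = 0` (so the fine-lattice half of (0.31) again holds for every `K`), no sign or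
identification of any limit, no (AF-1); asym1's near gap `(c₀ + e)θ^{k₁}(1 + θ) < m − e` is IMPLIED
(`nearMarginGap_of_nearMarginConst`).  §8's equality road is re-derived as the case `e = 0`
(`thm2Printed_of_blockMarginConst'`).  HONEST NOTE (cell cross-read of asym1's §11, record C-an4-32 O2): for `θ < 1` the
pair (`GeomRate a binf c₀ θ`, `NearRate a S.β0 e θ`) already CONTAINS the geometric rate `GeomRate S.β0 binf (c₀ + e) θ` of
the one-loop coefficients themselves (`NearRate.geomRate`) — the near road RELOCATES asym1's rate question (O-asym1-1) to
the comparison sequence plus a scheme-transfer estimate, it does not remove it; what the transfer of the certified LIST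
uses is only the discrepancy `a k − e ≤ S.β0 k` AT THE CERTIFIED DEPTHS `k ≤ k₁` (`NearRate.sub_le`).  The DECOUPLED form
`thm2Printed_of_depthMarginConst` says exactly that: asym1's rate for `S.β0` itself (any road of §3–§10 there, §4/§7/§8
here) + a one-sided finite-depth discrepancy + certificates for `a`, the discrepancy then paid ONCE
(`c₀θ^{k₁}(1 + θ) + e + r < m`).  [folklore] algebra joining landed theorems by name; nothing of the series is discharged;
NOT Theorem 2 unconditionally. -/

/-- asym1's near gap is implied on the constant road: `RemainderConst S γ₀ r` on non-empty boxes forces `0 ≤ r`, so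
`r < m − e − (c₀ + e)θ^{k₁}(1 + θ)` gives `(c₀ + e)θ^{k₁}(1 + θ) < m − e` (hence
`RateCertificate.beta0_pos_all_of_nearMargin` applies). [folklore] -/
theorem nearMarginGap_of_nearMarginConst (S : B12Beta.OneLoopSplit β) {γ₀ c₀ θ e r m : ℝ} {k₁ : ℕ} (hγ₀ : 0 < γ₀)
    (hrem : RemainderConst S γ₀ r) (hr : r < m - e - (c₀ + e) * θ ^ k₁ * (1 + θ)) :
    (c₀ + e) * θ ^ k₁ * (1 + θ) < m - e :=
  marginGap_of_marginConst S hγ₀ hrem hr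

/-- **(AF-0) on ALL boxes, near × constant**: a `GeomRate a binf c₀ θ` of a COMPARISON sequence `a` (`0 ≤ θ ≤ 1`, `binf`
ANY real), the located nearness `NearRate a S.β0 e θ`, the one-sided certified list `m ≤ a k` (`k ≤ k₁`) and
`RemainderConst S γ₀ r` give `β_{k+1} ≥ m − e − (c₀ + e)θ^{k₁}(1 + θ) − r` on `]0,γ₀]^{k+1}` for EVERY k
(`NearRate.geomRate`, `NearRate.list` ∘ `betaLowerH_of_marginConst`). [cite: Balaban1987RG1, (2.12)–(2.14) p.268] -/
theorem betaLowerH_of_nearMarginConst (S : B12Beta.OneLoopSplit β) {a : ℕ → ℝ} {γ₀ binf c₀ θ e r m : ℝ} {k₁ : ℕ}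
    (hθ0 : 0 ≤ θ) (hθ1 : θ ≤ 1) (hconv : GeomRate a binf c₀ θ) (hnear : NearRate a S.β0 e θ)
    (hlist : ∀ k, k ≤ k₁ → m ≤ a k) (hrem : RemainderConst S γ₀ r) :
    BetaLowerH (m - e - (c₀ + e) * θ ^ k₁ * (1 + θ) - r) γ₀ β :=
  betaLowerH_of_marginConst S hθ0 hθ1 (hnear.geomRate hconv) (hnear.list hθ0 hθ1 hlist) hrem

/-- … hence `β_{k+1} > 0` on every `]0,γ₀]`-box under the single condition `r < m − e − (c₀ + e)θ^{k₁}(1 + θ)`.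
[folklore] -/
theorem beta_pos_all_of_nearMarginConst (S : B12Beta.OneLoopSplit β) {a : ℕ → ℝ} {γ₀ binf c₀ θ e r m : ℝ} {k₁ : ℕ}
    (hθ0 : 0 ≤ θ) (hθ1 : θ ≤ 1) (hconv : GeomRate a binf c₀ θ) (hnear : NearRate a S.β0 e θ)
    (hlist : ∀ k, k ≤ k₁ → m ≤ a k) (hrem : RemainderConst S γ₀ r)
    (hr : r < m - e - (c₀ + e) * θ ^ k₁ * (1 + θ)) : ∀ k, ∀ v ∈ Box γ₀ k, 0 < β k v :=
  beta_pos_all_of_marginConst S hθ0 hθ1 (hnear.geomRate hconv) (hnear.list hθ0 hθ1 hlist) hrem hr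

/-- … and every one-loop coefficient is positive, `β⁰_{k+1} > 0` (`RateCertificate.beta0_pos_all_of_nearMargin` at the
implied gap; needs `0 < γ₀` for `0 ≤ r`). [folklore] -/
theorem beta0_pos_all_of_nearMarginConst (S : B12Beta.OneLoopSplit β) {a : ℕ → ℝ} {γ₀ binf c₀ θ e r m : ℝ} {k₁ : ℕ}
    (hγ₀ : 0 < γ₀) (hθ0 : 0 ≤ θ) (hθ1 : θ ≤ 1) (hconv : GeomRate a binf c₀ θ) (hnear : NearRate a S.β0 e θ)
    (hlist : ∀ k, k ≤ k₁ → m ≤ a k) (hrem : RemainderConst S γ₀ r)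
    (hr : r < m - e - (c₀ + e) * θ ^ k₁ * (1 + θ)) : ∀ k, 0 < S.β0 k :=
  beta0_pos_all_of_nearMargin S hθ0 hθ1 hconv hnear hlist (nearMarginGap_of_nearMarginConst S hγ₀ hrem hr)

/-- **THE END STATEMENT `DagBinding.EndpointExistence C`, near × constant** (forward-generated constructions): comparison
rate + nearness + one-sided list + constant remainder + the one condition + (U) + (C) (`eventualFormOfMarginConst` at the
transported constants, `k₀ = 0`, box `γ₀` not shrunk). [cite: Balaban1987RG1, Thm 2 p.259 (first sentence)] -/
theorem endpointExistence_of_nearMarginConst {C : B12.Construction} (hgen : ForwardGenerated C β)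
    (S : B12Beta.OneLoopSplit β) {a : ℕ → ℝ} {γ₀ binf c₀ θ e r β' m : ℝ} {k₁ : ℕ} (hγ₀ : 0 < γ₀) (hθ0 : 0 ≤ θ)
    (hθ1 : θ ≤ 1) (hconv : GeomRate a binf c₀ θ) (hnear : NearRate a S.β0 e θ) (hlist : ∀ k, k ≤ k₁ → m ≤ a k)
    (hrem : RemainderConst S γ₀ r) (hr : r < m - e - (c₀ + e) * θ ^ k₁ * (1 + θ)) (hup : BetaUpperH β' γ₀ β)
    (hcont : BetaContH γ₀ β) : EndpointExistence C :=
  endpointExistence_of_marginConst hgen S hγ₀ hθ0 hθ1 (hnear.geomRate hconv) (hnear.list hθ0 hθ1 hlist) hrem hr hup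
    hcont

/-- **THEOREM 2 AS PRINTED, NEAR × CONSTANT — the constant-form twin of `RateCertificate.thm2Printed_of_nearMargin`.**
Inputs: the DAG (`ForwardGenerated`), `1 < L`; the printed split `S`; (asym) `GeomRate a binf c₀ θ` for a COMPARISON
sequence `a` (any road of `RateCertificate` §3–§10; `0 ≤ θ ≤ 1`, `binf` ANY real) and the located nearness
`NearRate a S.β0 e θ` (one-loop scheme transfer; OPEN, never asserted); (cap) ONE-SIDED certified lower values `m ≤ a k`
for `k ≤ k₁` — certificates for the COMPARISON sequence; (asym2/an4) `RemainderConst S γ₀ r`; the ONE numeric condition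
`r < m − e − (c₀ + e)θ^{k₁}(1 + θ)`; (C); (U).  Binder list = asym1's with `(hgap, hCr, haf1)` ↦ `(hrem, hr)`.  Lower
constant of (0.31): `(m − e − (c₀ + e)θ^{k₁}(1 + θ) − r)/log L`, on the FULL box `]0,γ₀]`.
[cite: Balaban1987RG1, Thm 2 p.259 with (0.31)] -/
theorem thm2Printed_of_nearMarginConst {C : B12.Construction} (hgen : ForwardGenerated C β) {L : ℝ} (hL : 1 < L)
    (S : B12Beta.OneLoopSplit β) {a : ℕ → ℝ} {γ₀ binf c₀ θ e r β' m : ℝ} {k₁ : ℕ} (hγ₀ : 0 < γ₀) (hθ0 : 0 ≤ θ)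
    (hθ1 : θ ≤ 1) (hconv : GeomRate a binf c₀ θ) (hnear : NearRate a S.β0 e θ) (hlist : ∀ k, k ≤ k₁ → m ≤ a k)
    (hrem : RemainderConst S γ₀ r) (hr : r < m - e - (c₀ + e) * θ ^ k₁ * (1 + θ)) (hcont : BetaContH γ₀ β)
    (hup : BetaUpperH β' γ₀ β) : B12.Thm2Printed C L :=
  thm2Printed_of_marginConst hgen hL S hγ₀ hθ0 hθ1 (hnear.geomRate hconv) (hnear.list hθ0 hθ1 hlist) hrem hr hcont
    hup

/-- **Discrete asymptotic freedom `BetaAFH β`, near × constant** (witness box `γ₀` itself, constant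
`m − e − (c₀ + e)θ^{k₁}(1 + θ) − r`). [folklore] -/
theorem betaAFH_of_nearMarginConst (S : B12Beta.OneLoopSplit β) {a : ℕ → ℝ} {γ₀ binf c₀ θ e r m : ℝ} {k₁ : ℕ}
    (hγ₀ : 0 < γ₀) (hθ0 : 0 ≤ θ) (hθ1 : θ ≤ 1) (hconv : GeomRate a binf c₀ θ) (hnear : NearRate a S.β0 e θ)
    (hlist : ∀ k, k ≤ k₁ → m ≤ a k) (hrem : RemainderConst S γ₀ r)
    (hr : r < m - e - (c₀ + e) * θ ^ k₁ * (1 + θ)) : BetaAFH β :=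
  betaAFH_of_marginConst S hγ₀ hθ0 hθ1 (hnear.geomRate hconv) (hnear.list hθ0 hθ1 hlist) hrem hr

/-- **The lower half of (0.31) on FINE lattices, near × constant — WITH NO THRESHOLD** (`k₀ = 0`: every number of steps
`K`, every `0 < g ≤ γ ≤ γ₀`; (0.31)-constant `b/2`, `b = m − e − (c₀ + e)θ^{k₁}(1 + θ) − r`;
`thm2_fineLattices_of_marginConst` at the transported constants). [cite: Balaban1987RG1, Thm 2 (0.31) p.259] -/
theorem thm2_fineLattices_of_nearMarginConst {C : B12.Construction} (hgen : ForwardGenerated C β)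
    (S : B12Beta.OneLoopSplit β) {a : ℕ → ℝ} {γ₀ binf c₀ θ e r β' m : ℝ} {k₁ : ℕ} (hγ₀ : 0 < γ₀) (hθ0 : 0 ≤ θ)
    (hθ1 : θ ≤ 1) (hconv : GeomRate a binf c₀ θ) (hnear : NearRate a S.β0 e θ) (hlist : ∀ k, k ≤ k₁ → m ≤ a k)
    (hrem : RemainderConst S γ₀ r) (hr : r < m - e - (c₀ + e) * θ ^ k₁ * (1 + θ)) (hup : BetaUpperH β' γ₀ β)
    (hcont : BetaContH γ₀ β) :
    ∀ (n : ℕ) (γ : ℝ), 0 < γ → γ ≤ γ₀ → ∀ g : ℝ, 0 < g → g ≤ γ → ∀ K : ℕ,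
      ∃ g0 : ℝ, (C ⟨K, n, g0⟩).flow.InInterval γ K ∧ (C ⟨K, n, g0⟩).flow.g K = g ∧
        Step.Discrete031 ((m - e - (c₀ + e) * θ ^ k₁ * (1 + θ) - r) / 2) β' K g (C ⟨K, n, g0⟩).flow.g :=
  thm2_fineLattices_of_marginConst hgen S hγ₀ hθ0 hθ1 (hnear.geomRate hconv) (hnear.list hθ0 hθ1 hlist) hrem hr hup
    hcont

/-- The certified list transfers under a ONE-SIDED discrepancy bound AT THE CERTIFIED DEPTHS ONLY: `a k − e ≤ S.β0 k`
and `m ≤ a k` for `k ≤ k₁` give `m − e ≤ S.β0 k` for `k ≤ k₁` (all that `NearRate.list` uses of a `NearRate`; no rate, no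
limit, nothing beyond depth `k₁`). [folklore] -/
theorem list_of_depthDiscrepancy (S : B12Beta.OneLoopSplit β) {a : ℕ → ℝ} {e m : ℝ} {k₁ : ℕ}
    (hdisc : ∀ k, k ≤ k₁ → a k - e ≤ S.β0 k) (hlist : ∀ k, k ≤ k₁ → m ≤ a k) : ∀ k, k ≤ k₁ → m - e ≤ S.β0 k :=
  fun k hk => by linarith [hdisc k hk, hlist k hk]

/-- A located nearness `NearRate a S.β0 e θ` (`0 ≤ θ ≤ 1`) gives the finite-depth discrepancy bound at every depth
(`NearRate.sub_le`). [folklore] -/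
theorem depthDiscrepancy_of_nearRate (S : B12Beta.OneLoopSplit β) {a : ℕ → ℝ} {e θ : ℝ} (hnear : NearRate a S.β0 e θ)
    (hθ0 : 0 ≤ θ) (hθ1 : θ ≤ 1) (k₁ : ℕ) : ∀ k, k ≤ k₁ → a k - e ≤ S.β0 k :=
  fun k _ => hnear.sub_le hθ0 hθ1 k

/-- **THEOREM 2 AS PRINTED with asym1's rate for `S.β0` ITSELF and the certificates for a COMPARISON sequence — the
DECOUPLED form of the near road** (HONEST NOTE of this section): (asym) `GeomRate S.β0 binf c₀ θ` by any road
(`0 ≤ θ ≤ 1`, `binf` ANY real); (one-loop scheme transfer, FINITE depth, one-sided; LOCATED, NOT printed, a binder)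
`a k − e ≤ S.β0 k` for `k ≤ k₁`; (cap) `m ≤ a k` for `k ≤ k₁`; (asym2/an4) `RemainderConst S γ₀ r`; the ONE condition
`r < m − e − c₀θ^{k₁}(1 + θ)` — the discrepancy is paid ONCE; (C); (U).  `list_of_depthDiscrepancy` ∘
`thm2Printed_of_marginConst`. [cite: Balaban1987RG1, Thm 2 p.259 with (0.31)] -/
theorem thm2Printed_of_depthMarginConst {C : B12.Construction} (hgen : ForwardGenerated C β) {L : ℝ} (hL : 1 < L)
    (S : B12Beta.OneLoopSplit β) {a : ℕ → ℝ} {γ₀ binf c₀ θ e r β' m : ℝ} {k₁ : ℕ} (hγ₀ : 0 < γ₀) (hθ0 : 0 ≤ θ)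
    (hθ1 : θ ≤ 1) (hconv : GeomRate S.β0 binf c₀ θ) (hdisc : ∀ k, k ≤ k₁ → a k - e ≤ S.β0 k)
    (hlist : ∀ k, k ≤ k₁ → m ≤ a k) (hrem : RemainderConst S γ₀ r) (hr : r < m - e - c₀ * θ ^ k₁ * (1 + θ))
    (hcont : BetaContH γ₀ β) (hup : BetaUpperH β' γ₀ β) : B12.Thm2Printed C L :=
  thm2Printed_of_marginConst hgen hL S hγ₀ hθ0 hθ1 hconv (list_of_depthDiscrepancy S hdisc hlist) hrem hr hcont hup

/-- **(AF-0) on ALL boxes for the GENUINE block-size-`Lⁿ` step, CONSTANT remainder**: a small-block `CauchyRate b a θ`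
(`0 ≤ θ < 1`, `0 < n`), the located nearness `NearRate (blockSum n b) S.β0 e (θⁿ)` of the one-loop coefficients to the
block sums (Q-asym1-5, inequality form; a binder), small-block block-sum certificates `m ≤ Σ_{i<n} b (n k + i)` (`k ≤ k₁`)
and `RemainderConst S γ₀ r` give `β_{k+1} ≥ m − e − (a(Σ_{i<n}θ^i)²/(1 − θⁿ) + e)(θⁿ)^{k₁}(1 + θⁿ) − r` on `]0,γ₀]^{k+1}`
for every k (`RateCertificate.cauchyRate_blockSum` ∘ `CauchyRate.geomRate` ∘ `betaLowerH_of_nearMarginConst`).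
[cite: Balaban1987RG1, (1.22) p.264 and (2.12)–(2.14) p.268] -/
theorem betaLowerH_of_blockNearMarginConst (S : B12Beta.OneLoopSplit β) {b : ℕ → ℝ} {n : ℕ} (hn : 0 < n)
    {γ₀ a θ e r m : ℝ} {k₁ : ℕ} (hθ0 : 0 ≤ θ) (hθ1 : θ < 1) (hrate : CauchyRate b a θ)
    (hnear : NearRate (blockSum n b) S.β0 e (θ ^ n)) (hlist : ∀ k, k ≤ k₁ → m ≤ blockSum n b k)
    (hrem : RemainderConst S γ₀ r) :
    BetaLowerH (m - e - (a * (∑ i ∈ Finset.range n, θ ^ i) ^ 2 / (1 - θ ^ n) + e) * (θ ^ n) ^ k₁ * (1 + θ ^ n) - r)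
      γ₀ β :=
  have hθn1 : θ ^ n < 1 := pow_lt_one₀ hθ0 hθ1 hn.ne'
  betaLowerH_of_nearMarginConst S (pow_nonneg hθ0 n) hθn1.le ((cauchyRate_blockSum hrate n).geomRate hθn1) hnear
    hlist hrem

/-- **THEOREM 2 AS PRINTED FOR THE GENUINE BLOCK-SIZE-`Lⁿ` STEP FROM SMALL-BLOCK DATA, CONSTANT remainder — twin of
`RateCertificate.thm2Printed_of_blockNearMargin`** with `(hgap, hCr, haf1)` ↦ `(hrem, hr)`: the DAG at block size `L'`
(`1 < L'`), its split `S`; (asym1 at the SMALL block size) `CauchyRate b a θ`, `0 ≤ θ < 1`, `0 < n`; the located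
nearness `NearRate (blockSum n b) S.β0 e (θⁿ)` (one-loop scheme transfer (S3) ↔ (S1); OPEN, never asserted; `e = 0` is
§8's `hblock`); (cap at the small block size) `m ≤ Σ_{i<n} b (n k + i)` for `k ≤ k₁`; (asym2/an4, chain at `L'`)
`RemainderConst S γ₀ r`; the ONE condition `r < m − e − (a(Σ_{i<n}θ^i)²/(1 − θⁿ) + e)(θⁿ)^{k₁}(1 + θⁿ)`; (C); (U).
[cite: Balaban1987RG1, Thm 2 p.259 with (0.31) and (1.22) p.264] -/
theorem thm2Printed_of_blockNearMarginConst {C : B12.Construction} (hgen : ForwardGenerated C β) {L' : ℝ}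
    (hL : 1 < L') (S : B12Beta.OneLoopSplit β) {b : ℕ → ℝ} {n : ℕ} (hn : 0 < n) {γ₀ a θ e r β' m : ℝ} {k₁ : ℕ}
    (hγ₀ : 0 < γ₀) (hθ0 : 0 ≤ θ) (hθ1 : θ < 1) (hrate : CauchyRate b a θ)
    (hnear : NearRate (blockSum n b) S.β0 e (θ ^ n)) (hlist : ∀ k, k ≤ k₁ → m ≤ blockSum n b k)
    (hrem : RemainderConst S γ₀ r)
    (hr : r < m - e - (a * (∑ i ∈ Finset.range n, θ ^ i) ^ 2 / (1 - θ ^ n) + e) * (θ ^ n) ^ k₁ * (1 + θ ^ n))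
    (hcont : BetaContH γ₀ β) (hup : BetaUpperH β' γ₀ β) : B12.Thm2Printed C L' :=
  have hθn1 : θ ^ n < 1 := pow_lt_one₀ hθ0 hθ1 hn.ne'
  thm2Printed_of_nearMarginConst hgen hL S hγ₀ (pow_nonneg hθ0 n) hθn1.le ((cauchyRate_blockSum hrate n).geomRate hθn1)
    hnear hlist hrem hr hcont hup

/-- **THE END STATEMENT `EndpointExistence C` FOR THE GENUINE BLOCK-SIZE-`Lⁿ` STEP, CONSTANT remainder** (same inputs
minus `L'`). [cite: Balaban1987RG1, Thm 2 p.259 (first sentence)] -/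
theorem endpointExistence_of_blockNearMarginConst {C : B12.Construction} (hgen : ForwardGenerated C β)
    (S : B12Beta.OneLoopSplit β) {b : ℕ → ℝ} {n : ℕ} (hn : 0 < n) {γ₀ a θ e r β' m : ℝ} {k₁ : ℕ} (hγ₀ : 0 < γ₀)
    (hθ0 : 0 ≤ θ) (hθ1 : θ < 1) (hrate : CauchyRate b a θ) (hnear : NearRate (blockSum n b) S.β0 e (θ ^ n))
    (hlist : ∀ k, k ≤ k₁ → m ≤ blockSum n b k) (hrem : RemainderConst S γ₀ r)
    (hr : r < m - e - (a * (∑ i ∈ Finset.range n, θ ^ i) ^ 2 / (1 - θ ^ n) + e) * (θ ^ n) ^ k₁ * (1 + θ ^ n))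
    (hup : BetaUpperH β' γ₀ β) (hcont : BetaContH γ₀ β) : EndpointExistence C :=
  have hθn1 : θ ^ n < 1 := pow_lt_one₀ hθ0 hθ1 hn.ne'
  endpointExistence_of_nearMarginConst hgen S hγ₀ (pow_nonneg hθ0 n) hθn1.le
    ((cauchyRate_blockSum hrate n).geomRate hθn1) hnear hlist hrem hr hup hcont

/-- §8's equality road is the case `e = 0` of the near road (consistency, `NearRate.of_eq`): Theorem 2 at the large block
size from the composition hypothesis `hblock`, re-derived through `thm2Printed_of_blockNearMarginConst`. [folklore] -/
theorem thm2Printed_of_blockMarginConst' {C : B12.Construction} (hgen : ForwardGenerated C β) {L' : ℝ} (hL : 1 < L')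
    (S : B12Beta.OneLoopSplit β) {b : ℕ → ℝ} {n : ℕ} (hn : 0 < n) (hblock : ∀ k, S.β0 k = blockSum n b k)
    {γ₀ a θ r β' m : ℝ} {k₁ : ℕ} (hγ₀ : 0 < γ₀) (hθ0 : 0 ≤ θ) (hθ1 : θ < 1) (hrate : CauchyRate b a θ)
    (hlist : ∀ k, k ≤ k₁ → m ≤ blockSum n b k) (hrem : RemainderConst S γ₀ r)
    (hr : r < m - a * (∑ i ∈ Finset.range n, θ ^ i) ^ 2 / (1 - θ ^ n) * (θ ^ n) ^ k₁ * (1 + θ ^ n))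
    (hcont : BetaContH γ₀ β) (hup : BetaUpperH β' γ₀ β) : B12.Thm2Printed C L' :=
  thm2Printed_of_blockNearMarginConst hgen hL S hn hγ₀ hθ0 hθ1 hrate (NearRate.of_eq hblock _) hlist hrem
    (by simpa using hr) hcont hup

/-- **THEOREM 2 AS PRINTED, NEAR × CONSTANT, THE REMAINDER SLOT FILLED BY A WINDOW CHAIN** `R : ChainL d M μ ν S γ₀ c ℓ
α₂ B₃` (printed leaves BY NAME as fields, (D4)) under `CondsL`, the closing relation `R22gen ℓ`, the printed signs and the
ONE condition `ε₁·K_rem,L < m − e − (c₀ + e)θ^{k₁}(1 + θ)`.  Binders and status: `hgen` MODELLING; `hL` printed;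
`hconv/hθ0/hθ1` asym1 for the COMPARISON sequence `a` (LOCATED-UNPRINTED, O-asym1-1); `hnear` the one-loop scheme-transfer
nearness (LOCATED, NOT printed, Q-asym1-5 — one more open input on this road); `hlist` cap (COMPUTATIONAL LEAVES for `a`,
lower values only); `R, hC, h22, hs, hd, hM` an4/asym2 (printed leaves as fields, k-free closed-form thresholds); `hε₁`
printed-TYPE restriction, k-free; `hcont` (C) (D5); `hup` (U).  NOT Theorem 2 unconditionally.
[cite: Balaban1987RG1, Thm 2 p.259 with (0.31); Balaban1988RG2Cluster, (2.38) p.20 and p.21] -/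
theorem thm2Printed_of_nearMarginChainL {C : B12.Construction} (hgen : ForwardGenerated C β) {L : ℝ} (hL : 1 < L)
    (S : B12Beta.OneLoopSplit β) {M : ℕ} {μ ν : Fin d} {γ₀ : ℝ} {c : B13.Consts} {ℓ α₂ B₃ : ℝ}
    (R : ChainL d M μ ν S γ₀ c ℓ α₂ B₃) (hC : CondsL d c ℓ) (h22 : c.R22gen ℓ) (hs : SignsL c α₂ B₃) (hd : 0 < d)
    (hM : 0 < M) {a : ℕ → ℝ} {binf c₀ θ e β' m : ℝ} {k₁ : ℕ} (hγ₀ : 0 < γ₀) (hθ0 : 0 ≤ θ) (hθ1 : θ ≤ 1)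
    (hconv : GeomRate a binf c₀ θ) (hnear : NearRate a S.β0 e θ) (hlist : ∀ k, k ≤ k₁ → m ≤ a k)
    (hε₁ : c.ε₁ * remCoeffL d M c α₂ B₃ < m - e - (c₀ + e) * θ ^ k₁ * (1 + θ)) (hcont : BetaContH γ₀ β)
    (hup : BetaUpperH β' γ₀ β) : B12.Thm2Printed C L :=
  thm2Printed_of_nearMarginConst hgen hL S hγ₀ hθ0 hθ1 hconv hnear hlist (R.abs_beta1_le hC h22 hs hd hM) hε₁ hcont
    hup

/-- **THEOREM 2 AS PRINTED FOR THE GENUINE BLOCK-SIZE-`Lⁿ` STEP, THE REMAINDER SLOT FILLED BY A WINDOW CHAIN AT `L'`**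
(small-block Cauchy constant written `a`; `c` is the record of printed constants): `hblock` of
`thm2Printed_of_blockMarginChainL` replaced by the located nearness `hnear : NearRate (blockSum n b) S.β0 e (θⁿ)`, the ONE
condition `ε₁·K_rem,L' < m − e − (a(Σ_{i<n}θ^i)²/(1 − θⁿ) + e)(θⁿ)^{k₁}(1 + θⁿ)`.  NOT Theorem 2 unconditionally.
[cite: Balaban1987RG1, Thm 2 p.259 with (0.31); Balaban1988RG2Cluster, (2.38) p.20 and p.21] -/
theorem thm2Printed_of_blockNearMarginChainL {C : B12.Construction} (hgen : ForwardGenerated C β) {L' : ℝ}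
    (hL : 1 < L') (S : B12Beta.OneLoopSplit β) {M : ℕ} {μ ν : Fin d} {γ₀ : ℝ} {c : B13.Consts} {ℓ α₂ B₃ : ℝ}
    (R : ChainL d M μ ν S γ₀ c ℓ α₂ B₃) (hC : CondsL d c ℓ) (h22 : c.R22gen ℓ) (hs : SignsL c α₂ B₃) (hd : 0 < d)
    (hM : 0 < M) {b : ℕ → ℝ} {n : ℕ} (hn : 0 < n) {a θ e β' m : ℝ} {k₁ : ℕ} (hγ₀ : 0 < γ₀) (hθ0 : 0 ≤ θ)
    (hθ1 : θ < 1) (hrate : CauchyRate b a θ) (hnear : NearRate (blockSum n b) S.β0 e (θ ^ n))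
    (hlist : ∀ k, k ≤ k₁ → m ≤ blockSum n b k)
    (hε₁ : c.ε₁ * remCoeffL d M c α₂ B₃ <
      m - e - (a * (∑ i ∈ Finset.range n, θ ^ i) ^ 2 / (1 - θ ^ n) + e) * (θ ^ n) ^ k₁ * (1 + θ ^ n))
    (hcont : BetaContH γ₀ β) (hup : BetaUpperH β' γ₀ β) : B12.Thm2Printed C L' :=
  thm2Printed_of_blockNearMarginConst hgen hL S hn hγ₀ hθ0 hθ1 hrate hnear hlist (R.abs_beta1_le hC h22 hs hd hM) hε₁
    hcont hup

/-! ### Non-vacuity of the near × constant hypotheses (§9) with a GENUINE nearness (`e ≠ 0`, `S.β0 ≠ a`) -/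

namespace Witness

/-- The hypotheses of `thm2Printed_of_nearMarginConst` other than the DAG, (C), (U) are jointly satisfiable with a
comparison sequence DIFFERENT from the one-loop coefficients: `β_{k+1} ≡ β⁰_{k+1} = 1 + (1/4)(1/2)^k`, `β¹ ≡ 0` (`r = 0`),
comparison `a ≡ 1` (`GeomRate a 1 0 (1/2)`), nearness `NearRate a β⁰ (1/4) (1/2)`, list `m = 1` (`k₁ = 0`), `γ₀ = 1`,
and the one condition `0 < 1 − 1/4 − (0 + 1/4)·1·(3/2) = 3/8` (the sequences of
`RateCertificate.Witness.nearMargin_nonvacuous`). [folklore] -/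
theorem nearMarginConst_nonvacuous :
    ∃ (β : HBeta) (S : B12Beta.OneLoopSplit β) (a : ℕ → ℝ) (k₁ : ℕ) (γ₀ binf c₀ θ e m r : ℝ),
      0 < γ₀ ∧ 0 ≤ θ ∧ θ ≤ 1 ∧ GeomRate a binf c₀ θ ∧ NearRate a S.β0 e θ ∧ (∀ k, k ≤ k₁ → m ≤ a k) ∧
      RemainderConst S γ₀ r ∧ r < m - e - (c₀ + e) * θ ^ k₁ * (1 + θ) ∧ S.β0 0 ≠ a 0 := by
  refine ⟨fun k _ => 1 + 1 / 4 * (1 / 2 : ℝ) ^ k,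
    ⟨fun k => 1 + 1 / 4 * (1 / 2 : ℝ) ^ k, fun _ _ => 0, fun _ _ => (add_zero _).symm, fun _ _ _ => rfl⟩,
    fun _ => 1, 0, 1, 1, 0, 1 / 2, 1 / 4, 1, 0, one_pos, by norm_num, by norm_num, ?_, ?_, fun _ _ => le_rfl, ?_,
    by norm_num, ?_⟩
  · intro k
    simp
  · intro k
    show |1 + 1 / 4 * (1 / 2 : ℝ) ^ k - 1| ≤ 1 / 4 * (1 / 2) ^ k
    rw [add_sub_cancel_left, abs_of_nonneg (by positivity)]
  · intro k p _
    show |(0 : ℝ)| ≤ 0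
    simp
  · show (1 : ℝ) + 1 / 4 * (1 / 2) ^ 0 ≠ 1
    norm_num

end Witness

/-! ## 10. (v1.4) CUMULATIVE (PARTIAL-SUM) SCHEME / L-TRANSFER DEFECT × CONSTANT REMAINDER — asym2's β-level side of
the cell lead's RULING (R19) («L-transfer ⊂ (D1)»)

§8 transports small-block data to the split at block size `L' = Lⁿ` along the EQUALITY `S.β0 k = blockSum n b k`
(`hblock`), §9 along a geometrically DECAYING nearness `NearRate a S.β0 e θ`.  For the genuine single step of block size
`Lⁿ` (scheme (S3) of asym1's §10 caveat) neither is the expected shape: the cell's analytic row an2 records (cell record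
GAPS C-an2-52 (3) — a LOCATED READING, not print, not a theorem of the tree) that the one-shot and the composed one-loop
coefficients differ by a TELESCOPED scheme term, `β⁰_{k+1}(Lⁿ) − Σ_{i<n} β⁰_{nk+i+1}(L) = γ_{k+1} − γ_k`, `γ_0 = 0`,
whose partial sums are the single numbers `γ_k` (in an2's words: «if `γ_k` converges (expected from locality, NOT proved
here) the per-step defect → 0 and the cumulative defect stays bounded (= a finite scheme renormalisation)») — the
pointwise differences need neither decay nor vanish (cell EVIDENCE, float grade, never used below: the numerics row
reports a discrepancy already at `k = 0` for `(L, n) = (2, 2)`) —, and the lead's kernel lemma `ScalewiseVectorSeam.lTransfer_flowSum_le_of_hU` (RULING (R19-1):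
«(D1) twice») bounds exactly the PARTIAL-SUM discrepancy `|Σ_{j<n·m} β₁⁰ j − Σ_{j<m} β₂⁰ j| ≤ U₁ + U₂` from two
instances of the wall's (D1) full-sum binder.  This section types that shape over plain real sequences,

    CumNear a b Γ  :=  ∀ k, |Σ_{j<k} b j − Σ_{j<k} a j| ≤ Γ        (cumulative nearness),

— `Γ = 0` on §8's equality road (`CumNear.of_eq`), `Γ = e/(1 − ϑ)` on §9's near road (`cumNear_of_nearRate`), an2's
telescoped form (`CumNear.telescoped` / `of_telescoped`), the (R19) conclusion shape by pure re-indexing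
(`cumNear_blockSum_of_flowSums`; the seam module is NOT imported — any supplier of that shape plugs in) — and puts the
CONSTANT remainder behind it at the two grades the cell distinguishes:

* END grade (`BetaPartialSumsLowerH`, `EndpointExistence`, the p. 355 reading): a `GeomRate` of the COMPARISON sequence
  `a` gives its drift (`GeomRate.drift`), `CumNear a S.β0 Γ` transports the drift to `S.β0` with defect `+ Γ`
  (`CumNear.drift`), and row an4's drift × constant-remainder sockets (`Beta.DriftRemainder`, imported BY NAME,
  unmodified) conclude.  NO CONDITION RELATES `Γ` TO THE MARGIN: the one numeric condition is `r ≤ m − c₀θ^{k₁}` (ONE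
  certified value `m ≤ a k₁` locating the drift slope, `a_∞ ≥ m − c₀θ^{k₁} ≥ r`, `GeomRate.binf_ge`), and `Γ < ∞` enters
  only the partial-sums constant `2(c₀/(1 − θ) + Γ)` (the B16-side smallness `2(c₀/(1 − θ) + Γ)·γ² ≤ β₀(2 + β₀)` of the
  p. 355 reading) — the kernel form, on the certified road, of (R19-1) «at EXISTENCE grade the L-transfer is not a new
  item»: `oneLoopDrift_of_cumNear`, `betaPartialSumsLowerH_of_cumNearConst`, `endpointExistence_of_cumNearConst`,
  `p355Unconditional_of_cumNearConst`; the block road from small-block data `endpointExistence_of_blockCumNearConst`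
  and, with the (R19) conclusion shape itself as the binder, `endpointExistence_of_lTransferConst`; chain level
  `endpointExistence_of_cumNearChainL`.
* Theorem-2-printed grade (`B12.Thm2Printed C L`: a POSITIVE floor on every box): `CumNear` gives the pointwise
  one-sided discrepancy `a k − 2Γ ≤ S.β0 k` (`CumNear.lower`; no decay, none needed), so §7's floor road applies with the
  ONE condition `c₀θ^{k₁}(1 + θ) + 2Γ + r < m` — here the NUMBER `Γ` IS measured against the certified margin, which is
  (R19-3)'s certificate question for asym1's finite-`k₁` plan (owners: the cap / num engines; evidence grade (R15));
  nothing of it is supplied here: `betaLowerH_of_cumNearMarginConst`, `thm2Printed_of_cumNearMarginConst`,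
  `betaAFH_of_cumNearMarginConst`.

Binders and status as in §§7–9: `hconv` / `hrate` asym1 for the COMPARISON sequence (LOCATED-UNPRINTED, O-asym1-1);
`hcum` / `hLT` the cumulative scheme / L-transfer defect (LOCATED, NOT printed, NEVER asserted — per (R19-1) two
instances of the wall's (D1) binder; at Theorem-2 grade its size against the margin is a certificate question); `hcert` /
`hlist` cap (COMPUTATIONAL LEAVES for `a`, lower values only); `hrem` / the chain an4/asym2 ((D4) inside); `hcont` (C)
(D5); `hup`, `hβ'` (U); `hgen` MODELLING.  No wall binder is instantiated and no wall row is implied (R18-3, R19-1);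
[folklore] algebra joining landed theorems by name; nothing of the series is discharged; NOT Theorem 2 / endpoint
existence unconditionally.  Non-vacuity with an OSCILLATING defect (`Witness.cumNearConst_nonvacuous`: `|S.β0 k − a k| =
1/4` for every k — neither §8's equality nor §9's decay — while `CumNear a S.β0 (1/4)`). -/

section CumulativeConst

/-- HYPOTHESIS SHAPE (cumulative nearness of two real sequences): the PARTIAL SUMS of `b` stay within `Γ` of those of
`a`, `|Σ_{j<k} b j − Σ_{j<k} a j| ≤ Γ` for every `k` — the grade of the wall's (D1) full-sum binder and of the (R19)
L-transfer bound; for `a` = the block sums of the base-`L` one-loop coefficients and `b` = the base-`Lⁿ` ones it is the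
located cumulative scheme defect (an2's `γ_k`, `CumNear.telescoped`).  A binder below, located, NOT printed, never
asserted. [folklore] -/
def CumNear (a b : ℕ → ℝ) (Γ : ℝ) : Prop :=
  ∀ k, |∑ j ∈ Finset.range k, b j - ∑ j ∈ Finset.range k, a j| ≤ Γ

namespace CumNear

variable {a b : ℕ → ℝ} {Γ : ℝ}

/-- The constant of a `CumNear` is `≥ 0` (take `k = 0`). [folklore] -/
theorem const_nonneg (h : CumNear a b Γ) : 0 ≤ Γ := by
  simpa using h 0

/-- Symmetry. [folklore] -/
theorem symm (h : CumNear a b Γ) : CumNear b a Γ := fun k => by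
  rw [abs_sub_comm]; exact h k

/-- Weakening the constant. [folklore] -/
theorem mono (h : CumNear a b Γ) {Γ' : ℝ} (hΓ : Γ ≤ Γ') : CumNear a b Γ' := fun k => (h k).trans hΓ

/-- §8's EQUALITY road (`hblock`) is the case `Γ = 0`. [folklore] -/
theorem of_eq (hab : ∀ k, b k = a k) : CumNear a b 0 := fun k => by
  simp [hab]

/-- **The TELESCOPED form** (row an2's reading of the scheme defect): `CumNear a b Γ` gives `b k = a k + (γ (k+1) − γ k)`
with `γ 0 = 0` and `|γ k| ≤ Γ` — `γ k` the k-th partial-sum discrepancy. [folklore] -/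
theorem telescoped (h : CumNear a b Γ) :
    ∃ γ : ℕ → ℝ, γ 0 = 0 ∧ (∀ k, b k = a k + (γ (k + 1) - γ k)) ∧ ∀ k, |γ k| ≤ Γ :=
  ⟨fun k => ∑ j ∈ Finset.range k, b j - ∑ j ∈ Finset.range k, a j, by simp, fun k => by
    show b k = a k + ((∑ j ∈ Finset.range (k + 1), b j - ∑ j ∈ Finset.range (k + 1), a j) -
      (∑ j ∈ Finset.range k, b j - ∑ j ∈ Finset.range k, a j))
    rw [Finset.sum_range_succ, Finset.sum_range_succ]; ring, h⟩

/-- … and conversely: a telescoped defect with `γ 0 = 0`, `|γ k| ≤ Γ` is a `CumNear`. [folklore] -/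
theorem of_telescoped {γ : ℕ → ℝ} (hγ0 : γ 0 = 0) (hb : ∀ k, b k = a k + (γ (k + 1) - γ k))
    (hΓ : ∀ k, |γ k| ≤ Γ) : CumNear a b Γ := by
  have hsum : ∀ k, ∑ j ∈ Finset.range k, b j - ∑ j ∈ Finset.range k, a j = γ k := by
    intro k
    induction k with
    | zero => simp [hγ0]
    | succ k ih =>
      rw [Finset.sum_range_succ, Finset.sum_range_succ, hb k]
      linear_combination ih
  intro k
  rw [hsum k]
  exact hΓ k

/-- Pointwise consequence: consecutive partial-sum discrepancies differ by `b k − a k`, so `|b k − a k| ≤ 2Γ` for every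
`k` — NO decay in `k` (contrast `NearRate`), none is needed below. [folklore] -/
theorem abs_sub_le (h : CumNear a b Γ) (k : ℕ) : |b k - a k| ≤ 2 * Γ := by
  have e : b k - a k = (∑ j ∈ Finset.range (k + 1), b j - ∑ j ∈ Finset.range (k + 1), a j) -
      (∑ j ∈ Finset.range k, b j - ∑ j ∈ Finset.range k, a j) := by
    rw [Finset.sum_range_succ, Finset.sum_range_succ]; ring
  have h1 := abs_le.mp (h (k + 1))
  have h2 := abs_le.mp (h k)
  rw [e, abs_le]
  constructor <;> linarith [h1.1, h1.2, h2.1, h2.2]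

/-- … in the one-sided form the floor road uses: `a k − 2Γ ≤ b k`. [folklore] -/
theorem lower (h : CumNear a b Γ) (k : ℕ) : a k - 2 * Γ ≤ b k := by
  have := (abs_le.mp (h.abs_sub_le k)).1
  linarith

/-- **Drift transport**: a drift `|Σ_{j<k} a j − s·k| ≤ A` of the comparison sequence and `CumNear a b Γ` give the
drift `|Σ_{j<k} b j − s·k| ≤ A + Γ` of `b` — same slope, defect `+ Γ`. [folklore] -/
theorem drift (h : CumNear a b Γ) {s A : ℝ} (hd : Drift.OneLoopDrift s A a) : Drift.OneLoopDrift s (A + Γ) b :=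
  fun k => by
  have e : ∑ j ∈ Finset.range k, b j - s * k =
      (∑ j ∈ Finset.range k, a j - s * k) + (∑ j ∈ Finset.range k, b j - ∑ j ∈ Finset.range k, a j) := by ring
  have h1 := abs_le.mp (hd k)
  have h2 := abs_le.mp (h k)
  rw [e, abs_le]
  constructor <;> linarith [h1.1, h1.2, h2.1, h2.2]

end CumNear

/-- §9's near road is the case `Γ = e/(1 − ϑ)`: a geometrically decaying nearness `NearRate a b e ϑ` (`0 ≤ ϑ < 1`) is
cumulatively near (`GeomRate.drift` on the difference sequence). [folklore] -/
theorem cumNear_of_nearRate {a b : ℕ → ℝ} {e ϑ : ℝ} (h : NearRate a b e ϑ) (hϑ0 : 0 ≤ ϑ) (hϑ1 : ϑ < 1) :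
    CumNear a b (e / (1 - ϑ)) := by
  have hg : GeomRate (fun k => b k - a k) 0 e ϑ := fun k => by simpa using h k
  intro k
  have hk := hg.drift hϑ0 hϑ1 k
  simpa [Finset.sum_sub_distrib] using hk

/-- Block sums re-index an initial segment: `Σ_{j<n·m} b j = Σ_{k<m} blockSum n b k`. [folklore] -/
theorem sum_range_mul_eq_sum_blockSum (n : ℕ) (b : ℕ → ℝ) (m : ℕ) :
    ∑ j ∈ Finset.range (n * m), b j = ∑ k ∈ Finset.range m, blockSum n b k := by
  induction m with
  | zero => simp
  | succ m ih => rw [Nat.mul_succ, Finset.sum_range_add, ih, Finset.sum_range_succ, blockSum]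

/-- **The (R19) conclusion shape is a `CumNear` for the block sums**: a bound `|Σ_{j<n·m} β₁ j − Σ_{j<m} β₂ j| ≤ Γ` for
every `m ≥ 1` (the shape concluded by the lead's `ScalewiseVectorSeam.lTransfer_flowSum_le_of_hU`, there with
`Γ = U₁ + U₂` from two (D1) full-sum binders; NOT imported here) gives `CumNear (blockSum n β₁) β₂ Γ` (at `m = 0` both
sums vanish and `0 ≤ Γ` is read off `m = 1`). [folklore] -/
theorem cumNear_blockSum_of_flowSums {β₁ β₂ : ℕ → ℝ} {n : ℕ} {Γ : ℝ}
    (h : ∀ m : ℕ, 1 ≤ m → |∑ j ∈ Finset.range (n * m), β₁ j - ∑ j ∈ Finset.range m, β₂ j| ≤ Γ) :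
    CumNear (blockSum n β₁) β₂ Γ := by
  intro m
  rcases Nat.eq_zero_or_pos m with rfl | hm
  · simpa using (abs_nonneg _).trans (h 1 le_rfl)
  · rw [abs_sub_comm, ← sum_range_mul_eq_sum_blockSum]
    exact h m hm

/-- **Drift of the one-loop coefficients from the comparison rate and the cumulative defect**: `GeomRate a binf c₀ θ`
(`0 ≤ θ < 1`) and `CumNear a S.β0 Γ` give `OneLoopDrift binf (c₀/(1 − θ) + Γ) S.β0` — the drift road's hypothesis,
slope = the comparison limit (never identified, never signed). [folklore] -/
theorem oneLoopDrift_of_cumNear (S : B12Beta.OneLoopSplit β) {a : ℕ → ℝ} {binf c₀ θ Γ : ℝ} (hθ0 : 0 ≤ θ)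
    (hθ1 : θ < 1) (hconv : GeomRate a binf c₀ θ) (hcum : CumNear a S.β0 Γ) :
    Drift.OneLoopDrift binf (c₀ / (1 - θ) + Γ) S.β0 :=
  hcum.drift (hconv.drift hθ0 hθ1)

/-- **(A-ps) `BetaPartialSumsLowerH`, cumulative defect × constant remainder** — END grade, NO condition on `Γ`: the
comparison rate, ONE certified value `m ≤ a k₁`, `CumNear a S.β0 Γ`, `RemainderConst S γ₀ r` and `r ≤ m − c₀θ^{k₁}`
(so `r ≤ a_∞`, `GeomRate.binf_ge`) give `BetaPartialSumsLowerH (2(c₀/(1 − θ) + Γ)) γ₀ β`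
(`DriftRemainder.betaPartialSumsLowerH_of_drift_remainderConst`).
[cite: Balaban1987RG1, Thm 2 p.259 (first sentence) and (2.12)–(2.14) p.268] -/
theorem betaPartialSumsLowerH_of_cumNearConst (S : B12Beta.OneLoopSplit β) {a : ℕ → ℝ}
    {γ₀ binf c₀ θ Γ r m : ℝ} {k₁ : ℕ} (hθ0 : 0 ≤ θ) (hθ1 : θ < 1) (hconv : GeomRate a binf c₀ θ)
    (hcert : m ≤ a k₁) (hcum : CumNear a S.β0 Γ) (hrem : RemainderConst S γ₀ r) (hr : r ≤ m - c₀ * θ ^ k₁) :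
    BetaPartialSumsLowerH (2 * (c₀ / (1 - θ) + Γ)) γ₀ β :=
  DriftRemainder.betaPartialSumsLowerH_of_drift_remainderConst S (oneLoopDrift_of_cumNear S hθ0 hθ1 hconv hcum) hrem
    (hr.trans (hconv.binf_ge hcert))

/-- **ENDPOINT EXISTENCE, cumulative defect × constant remainder** (forward-generated constructions) — END grade, NO
condition on `Γ`.  Inputs: the comparison rate (asym1), ONE certified value (cap), the cumulative defect (LOCATED;
(D1) twice per (R19-1)), the constant remainder (an4/asym2), `r ≤ m − c₀θ^{k₁}`, (U) with `0 ≤ β′`, (C)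
(`DriftRemainder.endpointExistence_of_drift_remainderConst`). [cite: Balaban1987RG1, Thm 2 p.259 (first sentence)] -/
theorem endpointExistence_of_cumNearConst {C : B12.Construction} (hgen : ForwardGenerated C β)
    (S : B12Beta.OneLoopSplit β) {a : ℕ → ℝ} {γ₀ binf c₀ θ Γ r β' m : ℝ} {k₁ : ℕ} (hγ₀ : 0 < γ₀) (hθ0 : 0 ≤ θ)
    (hθ1 : θ < 1) (hconv : GeomRate a binf c₀ θ) (hcert : m ≤ a k₁) (hcum : CumNear a S.β0 Γ)
    (hrem : RemainderConst S γ₀ r) (hr : r ≤ m - c₀ * θ ^ k₁) (hβ' : 0 ≤ β') (hcont : BetaContH γ₀ β)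
    (hup : BetaUpperH β' γ₀ β) : EndpointExistence C :=
  DriftRemainder.endpointExistence_of_drift_remainderConst hgen S hγ₀ (oneLoopDrift_of_cumNear S hθ0 hθ1 hconv hcum)
    hrem (hr.trans (hconv.binf_ge hcert)) hβ' hcont hup

/-- **THE p. 355 UNCONDITIONAL READING, cumulative defect × constant remainder** (Gloss 1 of `Beta.DriftRemainder`:
`hnodes` kept) — the only place `Γ` enters a numeric condition at END grade: the partial-sums constant
`2(c₀/(1 − θ) + Γ)` in the B16-side smallness `2(c₀/(1 − θ) + Γ)·γ² ≤ β₀(2 + β₀)`; the certified value is written `mc`.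
Via `DriftRemainder.p355Unconditional_of_drift_remainderConst`; bookkeeping only.
[cite: Balaban1989LargeFieldII, p.355; Balaban1987RG1, (2.12)–(2.14) p.268] -/
theorem p355Unconditional_of_cumNearConst (w : World) (hγw : 0 < w.γ) {γ₀ : ℝ} (hγ₀ : w.γ ≤ γ₀)
    (hβup : 0 ≤ w.βup) (hnodes : ∀ P, Nodes (leaves w P)) {βw : HBeta}
    (hgen : ForwardGenerated w.C.toB12 βw) (hhalt : HaltsOutside w.C.toB12 βw)
    (hcur : CurriesHBeta w.C.toB12 βw) (hcont : BetaContH γ₀ βw) (hup : BetaUpperH w.βup γ₀ βw)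
    (S : B12Beta.OneLoopSplit βw) {a : ℕ → ℝ} {binf c₀ θ Γ r mc : ℝ} {k₁ : ℕ} (hθ0 : 0 ≤ θ) (hθ1 : θ < 1)
    (hconv : GeomRate a binf c₀ θ) (hcert : mc ≤ a k₁) (hcum : CumNear a S.β0 Γ) (hrem : RemainderConst S γ₀ r)
    (hr : r ≤ mc - c₀ * θ ^ k₁) (hMγ : 2 * (c₀ / (1 - θ) + Γ) * w.γ ^ 2 ≤ w.β₀ * (2 + w.β₀)) :
    B16.Sect2Unconditional w.C ∧
      ∃ Em Ep : ℝ, ∀ m : ℕ, ∃ gstar : ℝ, 0 < gstar ∧ ∀ g : ℝ, 0 < g → g ≤ gstar →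
        ∀ K : ℕ, ∃ g0 : ℝ, (w.C ⟨K, m, g0⟩).flow.g K = g ∧
          ∀ k, k ≤ K → ∀ V : (w.C ⟨K, m, g0⟩).Cfg k, B16.UVIneq (w.C ⟨K, m, g0⟩) k V Em Ep :=
  DriftRemainder.p355Unconditional_of_drift_remainderConst w hγw hγ₀ hβup hnodes hgen hhalt hcur hcont hup S
    (oneLoopDrift_of_cumNear S hθ0 hθ1 hconv hcum) hrem (hr.trans (hconv.binf_ge hcert)) hMγ

/-- **ENDPOINT EXISTENCE AT THE LARGE BLOCK SIZE from small-block data and the cumulative defect** — END grade, NO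
condition on `Γ`: the small-block `CauchyRate b c θ` (`0 ≤ θ < 1`, `0 < n`; asym1 at the SMALL block size), ONE
block-sum certificate `m ≤ Σ_{i<n} b (n k₁ + i)` (cap at the small block size), `CumNear (blockSum n b) S.β0 Γ` (the
cumulative scheme / L-transfer defect, LOCATED), `RemainderConst S γ₀ r` (the chain AT the construction's block size),
`r ≤ m − c(Σ_{i<n}θ^i)²/(1 − θⁿ)·(θⁿ)^{k₁}`, (U) with `0 ≤ β′`, (C).
[cite: Balaban1987RG1, Thm 2 p.259 (first sentence) and (1.22) p.264] -/
theorem endpointExistence_of_blockCumNearConst {C : B12.Construction} (hgen : ForwardGenerated C β)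
    (S : B12Beta.OneLoopSplit β) {b : ℕ → ℝ} {n : ℕ} (hn : 0 < n) {γ₀ c θ Γ r β' m : ℝ} {k₁ : ℕ} (hγ₀ : 0 < γ₀)
    (hθ0 : 0 ≤ θ) (hθ1 : θ < 1) (hrate : CauchyRate b c θ) (hcert : m ≤ blockSum n b k₁)
    (hcum : CumNear (blockSum n b) S.β0 Γ) (hrem : RemainderConst S γ₀ r)
    (hr : r ≤ m - c * (∑ i ∈ Finset.range n, θ ^ i) ^ 2 / (1 - θ ^ n) * (θ ^ n) ^ k₁) (hβ' : 0 ≤ β')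
    (hcont : BetaContH γ₀ β) (hup : BetaUpperH β' γ₀ β) : EndpointExistence C :=
  have hθ1' : θ ^ n < 1 := pow_lt_one₀ hθ0 hθ1 hn.ne'
  endpointExistence_of_cumNearConst hgen S hγ₀ (pow_nonneg hθ0 n) hθ1' ((cauchyRate_blockSum hrate n).geomRate hθ1')
    hcert hcum hrem hr hβ' hcont hup

/-- **… with the (R19) CONCLUSION SHAPE ITSELF as the transfer binder** (`β₁⁰ = b` at the small block size, `β₂⁰ = S.β0`
at block size `Lⁿ`; `U = U₁ + U₂` when supplied by `ScalewiseVectorSeam.lTransfer_flowSum_le_of_hU` from two (D1)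
full-sum binders — RULING (R19-1) «the L-transfer at EXISTENCE grade is (D1) twice», composed here to the END statement
with NO further numeric condition on `U`). [cite: Balaban1987RG1, Thm 2 p.259 (first sentence) and (1.22) p.264] -/
theorem endpointExistence_of_lTransferConst {C : B12.Construction} (hgen : ForwardGenerated C β)
    (S : B12Beta.OneLoopSplit β) {b : ℕ → ℝ} {n : ℕ} (hn : 0 < n) {γ₀ c θ U r β' m : ℝ} {k₁ : ℕ} (hγ₀ : 0 < γ₀)
    (hθ0 : 0 ≤ θ) (hθ1 : θ < 1) (hrate : CauchyRate b c θ) (hcert : m ≤ blockSum n b k₁)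
    (hLT : ∀ m' : ℕ, 1 ≤ m' → |∑ j ∈ Finset.range (n * m'), b j - ∑ j ∈ Finset.range m', S.β0 j| ≤ U)
    (hrem : RemainderConst S γ₀ r) (hr : r ≤ m - c * (∑ i ∈ Finset.range n, θ ^ i) ^ 2 / (1 - θ ^ n) * (θ ^ n) ^ k₁)
    (hβ' : 0 ≤ β') (hcont : BetaContH γ₀ β) (hup : BetaUpperH β' γ₀ β) : EndpointExistence C :=
  endpointExistence_of_blockCumNearConst hgen S hn hγ₀ hθ0 hθ1 hrate hcert (cumNear_blockSum_of_flowSums hLT) hrem hr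
    hβ' hcont hup

/-- **ENDPOINT EXISTENCE, cumulative defect × THE REMAINDER SLOT FILLED BY A WINDOW CHAIN** `R : ChainL d M μ ν S γ₀ c ℓ
α₂ B₃` (printed leaves BY NAME as fields, (D4)) under `CondsL`, the closing relation `R22gen ℓ`, the printed signs and
the printed-TYPE restriction `ε₁·K_rem,L ≤ m − c₀θ^{k₁}` (k-free; NO `Γ` in it).  Binders and status: `hgen` MODELLING;
`hconv/hθ0/hθ1` asym1 for the COMPARISON sequence (LOCATED-UNPRINTED, O-asym1-1); `hcum` the cumulative scheme /
L-transfer defect (LOCATED, NOT printed; (D1) twice per (R19-1)); `hcert` cap (ONE computational leaf for `a`);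
`R, hC, h22, hs, hd, hM` an4/asym2 (printed leaves as fields, k-free closed-form thresholds); `hcont` (C) (D5); `hup`,
`hβ'` (U).  NOT endpoint existence unconditionally.
[cite: Balaban1987RG1, Thm 2 p.259 (first sentence); Balaban1988RG2Cluster, (2.38) p.20 and p.21] -/
theorem endpointExistence_of_cumNearChainL {C : B12.Construction} (hgen : ForwardGenerated C β)
    (S : B12Beta.OneLoopSplit β) {M : ℕ} {μ ν : Fin d} {γ₀ : ℝ} {c : B13.Consts} {ℓ α₂ B₃ : ℝ}
    (R : ChainL d M μ ν S γ₀ c ℓ α₂ B₃) (hC : CondsL d c ℓ) (h22 : c.R22gen ℓ) (hs : SignsL c α₂ B₃) (hd : 0 < d)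
    (hM : 0 < M) {a : ℕ → ℝ} {binf c₀ θ Γ β' m : ℝ} {k₁ : ℕ} (hγ₀ : 0 < γ₀) (hθ0 : 0 ≤ θ) (hθ1 : θ < 1)
    (hconv : GeomRate a binf c₀ θ) (hcert : m ≤ a k₁) (hcum : CumNear a S.β0 Γ)
    (hε₁ : c.ε₁ * remCoeffL d M c α₂ B₃ ≤ m - c₀ * θ ^ k₁) (hβ' : 0 ≤ β') (hcont : BetaContH γ₀ β)
    (hup : BetaUpperH β' γ₀ β) : EndpointExistence C :=
  endpointExistence_of_cumNearConst hgen S hγ₀ hθ0 hθ1 hconv hcert hcum (R.abs_beta1_le hC h22 hs hd hM) hε₁ hβ'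
    hcont hup

/-- **(AF-0) on ALL boxes, cumulative defect × constant** (Theorem-2 grade): the comparison rate (`0 ≤ θ ≤ 1`), the
one-sided certified list `m ≤ a k` (`k ≤ k₁`), `CumNear a S.β0 Γ` (pointwise `a k − 2Γ ≤ S.β0 k`, `CumNear.lower`) and
`RemainderConst S γ₀ r` give `β_{k+1} ≥ m − c₀θ^{k₁}(1 + θ) − 2Γ − r` on `]0,γ₀]^{k+1}` for every k
(`GeomRate.lower_of_list` ∘ `betaLowerH_of_floor_const`). [cite: Balaban1987RG1, (2.12)–(2.14) p.268] -/
theorem betaLowerH_of_cumNearMarginConst (S : B12Beta.OneLoopSplit β) {a : ℕ → ℝ} {γ₀ binf c₀ θ Γ r m : ℝ}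
    {k₁ : ℕ} (hθ0 : 0 ≤ θ) (hθ1 : θ ≤ 1) (hconv : GeomRate a binf c₀ θ) (hlist : ∀ k, k ≤ k₁ → m ≤ a k)
    (hcum : CumNear a S.β0 Γ) (hrem : RemainderConst S γ₀ r) :
    BetaLowerH (m - c₀ * θ ^ k₁ * (1 + θ) - 2 * Γ - r) γ₀ β :=
  betaLowerH_of_floor_const S (fun k => by linarith [hconv.lower_of_list hθ0 hθ1 hlist k, hcum.lower k]) hrem

/-- **THEOREM 2 AS PRINTED, cumulative defect × constant** — the Theorem-2 grade, where the size of the cumulative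
defect IS measured against the certified margin: the ONE condition `r < m − c₀θ^{k₁}(1 + θ) − 2Γ`, i.e.
`c₀θ^{k₁}(1 + θ) + 2Γ + ε₁·K_rem,L < m` ((R19-3): the NUMBER `Γ` with a certified margin is a certificate of the
acceleration lanes — not supplied here).  Lower constant of (0.31): `(m − c₀θ^{k₁}(1 + θ) − 2Γ − r)/log L`, FULL box.
[cite: Balaban1987RG1, Thm 2 p.259 with (0.31)] -/
theorem thm2Printed_of_cumNearMarginConst {C : B12.Construction} (hgen : ForwardGenerated C β) {L : ℝ} (hL : 1 < L)
    (S : B12Beta.OneLoopSplit β) {a : ℕ → ℝ} {γ₀ binf c₀ θ Γ r β' m : ℝ} {k₁ : ℕ} (hγ₀ : 0 < γ₀) (hθ0 : 0 ≤ θ)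
    (hθ1 : θ ≤ 1) (hconv : GeomRate a binf c₀ θ) (hlist : ∀ k, k ≤ k₁ → m ≤ a k) (hcum : CumNear a S.β0 Γ)
    (hrem : RemainderConst S γ₀ r) (hr : r < m - c₀ * θ ^ k₁ * (1 + θ) - 2 * Γ) (hcont : BetaContH γ₀ β)
    (hup : BetaUpperH β' γ₀ β) : B12.Thm2Printed C L :=
  thm2Printed_of_floor_const hgen hL S hγ₀
    (fun k => by linarith [hconv.lower_of_list hθ0 hθ1 hlist k, hcum.lower k]) hrem hr hcont hup

/-- **Discrete asymptotic freedom `BetaAFH β`, cumulative defect × constant** (witness box `γ₀`, constant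
`m − c₀θ^{k₁}(1 + θ) − 2Γ − r`). [folklore] -/
theorem betaAFH_of_cumNearMarginConst (S : B12Beta.OneLoopSplit β) {a : ℕ → ℝ} {γ₀ binf c₀ θ Γ r m : ℝ} {k₁ : ℕ}
    (hγ₀ : 0 < γ₀) (hθ0 : 0 ≤ θ) (hθ1 : θ ≤ 1) (hconv : GeomRate a binf c₀ θ) (hlist : ∀ k, k ≤ k₁ → m ≤ a k)
    (hcum : CumNear a S.β0 Γ) (hrem : RemainderConst S γ₀ r) (hr : r < m - c₀ * θ ^ k₁ * (1 + θ) - 2 * Γ) :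
    BetaAFH β :=
  betaAFH_of_floor_const S hγ₀ (fun k => by linarith [hconv.lower_of_list hθ0 hθ1 hlist k, hcum.lower k]) hrem hr

/-! ### Non-vacuity of the cumulative-defect × constant hypotheses (§10) with an OSCILLATING defect -/

namespace Witness

/-- The hypotheses of §10 other than the DAG, (C), (U) are jointly satisfiable by a defect that is NEITHER §8's equality
NOR §9's geometric decay: comparison `a ≡ 1` (`GeomRate a 1 0 0`), one-loop coefficients
`β_{k+1} ≡ β⁰_{k+1} = 1 + (−1)^k/4` (an oscillating scheme term, `|β⁰_{k+1} − a k| = 1/4` for EVERY k), `β¹ ≡ 0`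
(`r = 0`), `CumNear a β⁰ (1/4)` (partial-sum discrepancies `0, 1/4, 0, 1/4, …`), certificate `m = 1 ≤ a 0` (`k₁ = 0`),
the END condition `0 ≤ 1 − 0` and the Theorem-2 condition `0 < 1 − 0·1·(1 + 0) − 2·(1/4) = 1/2`. [folklore] -/
theorem cumNearConst_nonvacuous :
    ∃ (β : HBeta) (S : B12Beta.OneLoopSplit β) (a : ℕ → ℝ) (k₁ : ℕ) (γ₀ binf c₀ θ Γ m r : ℝ),
      0 < γ₀ ∧ 0 ≤ θ ∧ θ < 1 ∧ GeomRate a binf c₀ θ ∧ CumNear a S.β0 Γ ∧ (∀ k, k ≤ k₁ → m ≤ a k) ∧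
      RemainderConst S γ₀ r ∧ r ≤ m - c₀ * θ ^ k₁ ∧ r < m - c₀ * θ ^ k₁ * (1 + θ) - 2 * Γ ∧
      (∀ k, |S.β0 k - a k| = 1 / 4) := by
  refine ⟨fun k _ => 1 + (-1 : ℝ) ^ k / 4,
    ⟨fun k => 1 + (-1 : ℝ) ^ k / 4, fun _ _ => 0, fun _ _ => (add_zero _).symm, fun _ _ _ => rfl⟩,
    fun _ => 1, 0, 1, 1, 0, 0, 1 / 4, 1, 0, one_pos, le_rfl, one_pos, ?_, ?_, fun _ _ => le_rfl, ?_,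
    by norm_num, by norm_num, ?_⟩
  · intro k
    simp
  · intro k
    show |∑ j ∈ Finset.range k, (1 + (-1 : ℝ) ^ j / 4) - ∑ j ∈ Finset.range k, (1 : ℝ)| ≤ 1 / 4
    have hs : ∀ k : ℕ, ∑ j ∈ Finset.range k, (1 + (-1 : ℝ) ^ j / 4) - ∑ j ∈ Finset.range k, (1 : ℝ) =
        (1 - (-1 : ℝ) ^ k) / 8 := by
      intro k
      induction k with
      | zero => simp
      | succ k ih =>
        rw [Finset.sum_range_succ, Finset.sum_range_succ, pow_succ]
        linear_combination ih
    rw [hs k, abs_le]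
    rcases neg_one_pow_eq_or ℝ k with h | h <;> rw [h] <;> constructor <;> norm_num
  · intro k p _
    show |(0 : ℝ)| ≤ 0
    simp
  · intro k
    show |1 + (-1 : ℝ) ^ k / 4 - 1| = 1 / 4
    rw [add_sub_cancel_left, abs_div, abs_pow, abs_neg, abs_one, one_pow, abs_of_pos (by norm_num : (0 : ℝ) < 4)]

end Witness

end CumulativeConst

/-! ## 11. (v1.4) EVENTUAL RATE × CONSTANT REMAINDER — the constant-form twins of `RateCertificate` v1.8 §12

asym1's §12 weakens the rate binder to an EVENTUAL one, `EvGeomRate b binf c₀ θ k₁ := ∀ k ≥ k₁, |b k − b_∞| ≤ c₀θ^k`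
(the located contraction is owed only from the threshold scale on; below it the finitely many certified values are the
only input — the «first-step exemption» of the numerics rows, there with float EVIDENCE only), and proves that the
one-sided certified list up to the threshold yields the SAME uniform floor `m − c₀θ^{k₁}(1 + θ)`
(`EvGeomRate.lower_of_list`).  Its Theorem-2 forms carry (AF-1).  Here the remainder slot is the CONSTANT form / the
window chain, through §3's floor road — statements identical to §7's with `GeomRate S.β0 …` replaced by
`EvGeomRate S.β0 … k₁` (§7 is the special case `k₁ = 0` up to `GeomRate.evGeomRate`, kernel-checked below as an
`example`): `betaLowerH_of_evMarginConst`, `beta_pos_all_of_evMarginConst`, `endpointExistence_of_evMarginConst`,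
`thm2Printed_of_evMarginConst`, the Cauchy form `thm2Printed_of_evCauchyMarginConst` (`c₀ = c/(1 − θ)`, the limit
never named), `betaAFH_of_evMarginConst`, chain level `thm2Printed_of_evMarginChainL` /
`endpointExistence_of_evMarginChainL`; the generic END socket of the floor road `endpointExistence_of_floor_const`
(§3 had the Theorem-2 and `BetaAFH` sockets only).  Binders and status as in §7 with `hconv` now the EVENTUAL rate
(asym1, LOCATED-UNPRINTED from the threshold, O-asym1-1) and `hlist` the certified list for EVERY `k ≤ k₁` (cap,
COMPUTATIONAL LEAVES); nothing of the series is discharged; NOT Theorem 2 unconditionally. -/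

section EventualConst

/-- **The END socket of the floor road**: a UNIFORM floor `f ≤ β⁰_{k+1}` (all k), `RemainderConst S γ₀ r` with `r < f`,
(U) and (C) give `EndpointExistence C` for a forward-generated construction (`eventualFormOfFloorConst` at `k₀ = 0`;
the lower companion `−β′ ≤ β` read off `0 < f − r ≤ β ≤ β′`). [cite: Balaban1987RG1, Thm 2 p.259 (first sentence)] -/
theorem endpointExistence_of_floor_const {C : B12.Construction} (hgen : ForwardGenerated C β)
    (S : B12Beta.OneLoopSplit β) {γ₀ f r β' : ℝ} (hγ₀ : 0 < γ₀) (hF : ∀ k, f ≤ S.β0 k) (hrem : RemainderConst S γ₀ r)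
    (hr : r < f) (hup : BetaUpperH β' γ₀ β) (hcont : BetaContH γ₀ β) : EndpointExistence C :=
  (eventualFormOfFloorConst S (k₀ := 0) hγ₀ (fun k _ => hF k) hrem hr hup
    (fun k v hv => by
      have h1 := betaLowerH_of_floor_const S hF hrem k v hv
      have h2 := hup k v hv
      linarith) hcont).endpointExistence hgen

/-- **(AF-0) on ALL boxes, EVENTUAL rate × constant**: `EvGeomRate S.β0 binf c₀ θ k₁` (`0 ≤ θ ≤ 1`), the one-sided
certified list `m ≤ β⁰_{k+1}` for every `k ≤ k₁` and `RemainderConst S γ₀ r` give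
`β_{k+1} ≥ m − c₀θ^{k₁}(1 + θ) − r` on `]0,γ₀]^{k+1}` for every k (`EvGeomRate.lower_of_list` ∘
`betaLowerH_of_floor_const`). [cite: Balaban1987RG1, (2.12)–(2.14) p.268] -/
theorem betaLowerH_of_evMarginConst (S : B12Beta.OneLoopSplit β) {γ₀ binf c₀ θ r m : ℝ} {k₁ : ℕ} (hθ0 : 0 ≤ θ)
    (hθ1 : θ ≤ 1) (hconv : EvGeomRate S.β0 binf c₀ θ k₁) (hlist : ∀ k, k ≤ k₁ → m ≤ S.β0 k)
    (hrem : RemainderConst S γ₀ r) : BetaLowerH (m - c₀ * θ ^ k₁ * (1 + θ) - r) γ₀ β :=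
  betaLowerH_of_floor_const S (hconv.lower_of_list hθ0 hθ1 hlist) hrem

/-- **Positivity of EVERY `β_{k+1}` on its box** from the eventual rate, the certified list, the constant remainder and
the ONE condition `r < m − c₀θ^{k₁}(1 + θ)` (no (C)/(U), no DAG). [cite: Balaban1987RG1, (2.12)–(2.14) p.268] -/
theorem beta_pos_all_of_evMarginConst (S : B12Beta.OneLoopSplit β) {γ₀ binf c₀ θ r m : ℝ} {k₁ : ℕ} (hθ0 : 0 ≤ θ)
    (hθ1 : θ ≤ 1) (hconv : EvGeomRate S.β0 binf c₀ θ k₁) (hlist : ∀ k, k ≤ k₁ → m ≤ S.β0 k)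
    (hrem : RemainderConst S γ₀ r) (hr : r < m - c₀ * θ ^ k₁ * (1 + θ)) : ∀ k, ∀ v ∈ Box γ₀ k, 0 < β k v :=
  fun k v hv => by
  have := betaLowerH_of_evMarginConst S hθ0 hθ1 hconv hlist hrem k v hv
  linarith

/-- **ENDPOINT EXISTENCE, EVENTUAL rate × constant remainder** (forward-generated constructions): the eventual rate
(asym1, from the threshold), the certified list up to the threshold (cap), the constant remainder (an4/asym2), the ONE
condition `r < m − c₀θ^{k₁}(1 + θ)`, (U), (C). [cite: Balaban1987RG1, Thm 2 p.259 (first sentence)] -/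
theorem endpointExistence_of_evMarginConst {C : B12.Construction} (hgen : ForwardGenerated C β)
    (S : B12Beta.OneLoopSplit β) {γ₀ binf c₀ θ r β' m : ℝ} {k₁ : ℕ} (hγ₀ : 0 < γ₀) (hθ0 : 0 ≤ θ) (hθ1 : θ ≤ 1)
    (hconv : EvGeomRate S.β0 binf c₀ θ k₁) (hlist : ∀ k, k ≤ k₁ → m ≤ S.β0 k) (hrem : RemainderConst S γ₀ r)
    (hr : r < m - c₀ * θ ^ k₁ * (1 + θ)) (hup : BetaUpperH β' γ₀ β) (hcont : BetaContH γ₀ β) :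
    EndpointExistence C :=
  endpointExistence_of_floor_const hgen S hγ₀ (hconv.lower_of_list hθ0 hθ1 hlist) hrem hr hup hcont

/-- **THEOREM 2 AS PRINTED, EVENTUAL rate × constant** — §7's `thm2Printed_of_marginConst` with the rate owed from the
threshold `k₁` only: `EvGeomRate S.β0 binf c₀ θ k₁` (`0 ≤ θ ≤ 1`, `binf` any real), the one-sided certified list
`m ≤ β⁰_{k+1}` for EVERY `k ≤ k₁`, `RemainderConst S γ₀ r`, the ONE condition `r < m − c₀θ^{k₁}(1 + θ)`, (C), (U).
Lower constant of (0.31): `(m − c₀θ^{k₁}(1 + θ) − r)/log L` on the FULL box.  Inputs BY NAME that no printed source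
supplies: the eventual rate (asym1), the list (cap), the remainder bound's leaves, (C).
[cite: Balaban1987RG1, Thm 2 p.259 with (0.31)] -/
theorem thm2Printed_of_evMarginConst {C : B12.Construction} (hgen : ForwardGenerated C β) {L : ℝ} (hL : 1 < L)
    (S : B12Beta.OneLoopSplit β) {γ₀ binf c₀ θ r β' m : ℝ} {k₁ : ℕ} (hγ₀ : 0 < γ₀) (hθ0 : 0 ≤ θ) (hθ1 : θ ≤ 1)
    (hconv : EvGeomRate S.β0 binf c₀ θ k₁) (hlist : ∀ k, k ≤ k₁ → m ≤ S.β0 k) (hrem : RemainderConst S γ₀ r)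
    (hr : r < m - c₀ * θ ^ k₁ * (1 + θ)) (hcont : BetaContH γ₀ β) (hup : BetaUpperH β' γ₀ β) :
    B12.Thm2Printed C L :=
  thm2Printed_of_floor_const hgen hL S hγ₀ (hconv.lower_of_list hθ0 hθ1 hlist) hrem hr hcont hup

/-- **… from the EVENTUAL CAUCHY shape** (`c₀ = c/(1 − θ)`, `θ < 1`; the constructed limit never appears; the rate is
owed for `k ≥ k₁` only; `EvCauchyRate.evGeomRate`). [cite: Balaban1987RG1, Thm 2 p.259 with (0.31)] -/
theorem thm2Printed_of_evCauchyMarginConst {C : B12.Construction} (hgen : ForwardGenerated C β) {L : ℝ} (hL : 1 < L)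
    (S : B12Beta.OneLoopSplit β) {γ₀ c θ r β' m : ℝ} {k₁ : ℕ} (hγ₀ : 0 < γ₀) (hθ0 : 0 ≤ θ) (hθ1 : θ < 1)
    (hrate : EvCauchyRate S.β0 c θ k₁) (hlist : ∀ k, k ≤ k₁ → m ≤ S.β0 k) (hrem : RemainderConst S γ₀ r)
    (hr : r < m - c / (1 - θ) * θ ^ k₁ * (1 + θ)) (hcont : BetaContH γ₀ β) (hup : BetaUpperH β' γ₀ β) :
    B12.Thm2Printed C L :=
  thm2Printed_of_evMarginConst hgen hL S hγ₀ hθ0 hθ1.le (hrate.evGeomRate hθ1) hlist hrem hr hcont hup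

/-- **Discrete asymptotic freedom `BetaAFH β`, EVENTUAL rate × constant** (witness box `γ₀`, constant
`m − c₀θ^{k₁}(1 + θ) − r`). [folklore] -/
theorem betaAFH_of_evMarginConst (S : B12Beta.OneLoopSplit β) {γ₀ binf c₀ θ r m : ℝ} {k₁ : ℕ} (hγ₀ : 0 < γ₀)
    (hθ0 : 0 ≤ θ) (hθ1 : θ ≤ 1) (hconv : EvGeomRate S.β0 binf c₀ θ k₁) (hlist : ∀ k, k ≤ k₁ → m ≤ S.β0 k)
    (hrem : RemainderConst S γ₀ r) (hr : r < m - c₀ * θ ^ k₁ * (1 + θ)) : BetaAFH β :=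
  betaAFH_of_floor_const S hγ₀ (hconv.lower_of_list hθ0 hθ1 hlist) hrem hr

/-- **THEOREM 2 AS PRINTED, EVENTUAL rate × THE REMAINDER SLOT FILLED BY A WINDOW CHAIN** `R : ChainL d M μ ν S γ₀ c ℓ
α₂ B₃` under `CondsL`, `R22gen ℓ`, the printed signs and the printed-TYPE restriction
`ε₁·K_rem,L < m − c₀θ^{k₁}(1 + θ)` (k-free).  Binders and status: `hgen` MODELLING; `hconv/hθ0/hθ1` asym1 — the
EVENTUAL rate from the threshold `k₁` (LOCATED-UNPRINTED, O-asym1-1); `hlist` cap (COMPUTATIONAL LEAVES, every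
`k ≤ k₁`); `R, hC, h22, hs, hd, hM` an4/asym2 (printed leaves as fields); `hcont` (C) (D5); `hup` (U).  NOT Theorem 2
unconditionally. [cite: Balaban1987RG1, Thm 2 p.259 with (0.31); Balaban1988RG2Cluster, (2.38) p.20 and p.21] -/
theorem thm2Printed_of_evMarginChainL {C : B12.Construction} (hgen : ForwardGenerated C β) {L : ℝ} (hL : 1 < L)
    (S : B12Beta.OneLoopSplit β) {M : ℕ} {μ ν : Fin d} {γ₀ : ℝ} {c : B13.Consts} {ℓ α₂ B₃ : ℝ}
    (R : ChainL d M μ ν S γ₀ c ℓ α₂ B₃) (hC : CondsL d c ℓ) (h22 : c.R22gen ℓ) (hs : SignsL c α₂ B₃) (hd : 0 < d)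
    (hM : 0 < M) {binf c₀ θ β' m : ℝ} {k₁ : ℕ} (hγ₀ : 0 < γ₀) (hθ0 : 0 ≤ θ) (hθ1 : θ ≤ 1)
    (hconv : EvGeomRate S.β0 binf c₀ θ k₁) (hlist : ∀ k, k ≤ k₁ → m ≤ S.β0 k)
    (hε₁ : c.ε₁ * remCoeffL d M c α₂ B₃ < m - c₀ * θ ^ k₁ * (1 + θ)) (hcont : BetaContH γ₀ β)
    (hup : BetaUpperH β' γ₀ β) : B12.Thm2Printed C L :=
  thm2Printed_of_evMarginConst hgen hL S hγ₀ hθ0 hθ1 hconv hlist (R.abs_beta1_le hC h22 hs hd hM) hε₁ hcont hup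

/-- **ENDPOINT EXISTENCE, EVENTUAL rate × window chain** (same binders, (U) with `BetaUpperH β′ γ₀ β`).
[cite: Balaban1987RG1, Thm 2 p.259 (first sentence); Balaban1988RG2Cluster, (2.38) p.20 and p.21] -/
theorem endpointExistence_of_evMarginChainL {C : B12.Construction} (hgen : ForwardGenerated C β)
    (S : B12Beta.OneLoopSplit β) {M : ℕ} {μ ν : Fin d} {γ₀ : ℝ} {c : B13.Consts} {ℓ α₂ B₃ : ℝ}
    (R : ChainL d M μ ν S γ₀ c ℓ α₂ B₃) (hC : CondsL d c ℓ) (h22 : c.R22gen ℓ) (hs : SignsL c α₂ B₃) (hd : 0 < d)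
    (hM : 0 < M) {binf c₀ θ β' m : ℝ} {k₁ : ℕ} (hγ₀ : 0 < γ₀) (hθ0 : 0 ≤ θ) (hθ1 : θ ≤ 1)
    (hconv : EvGeomRate S.β0 binf c₀ θ k₁) (hlist : ∀ k, k ≤ k₁ → m ≤ S.β0 k)
    (hε₁ : c.ε₁ * remCoeffL d M c α₂ B₃ < m - c₀ * θ ^ k₁ * (1 + θ)) (hup : BetaUpperH β' γ₀ β)
    (hcont : BetaContH γ₀ β) : EndpointExistence C :=
  endpointExistence_of_evMarginConst hgen S hγ₀ hθ0 hθ1 hconv hlist (R.abs_beta1_le hC h22 hs hd hM) hε₁ hup hcont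

/- NOTHING IS LOST (kernel check, not a new declaration): §7's `thm2Printed_of_marginConst` is the case of a rate from
`k₁ := k₁` of the full `GeomRate` (`GeomRate.evGeomRate`). -/
example {C : B12.Construction} (hgen : ForwardGenerated C β) {L : ℝ} (hL : 1 < L) (S : B12Beta.OneLoopSplit β)
    {γ₀ binf c₀ θ r β' m : ℝ} {k₁ : ℕ} (hγ₀ : 0 < γ₀) (hθ0 : 0 ≤ θ) (hθ1 : θ ≤ 1) (hconv : GeomRate S.β0 binf c₀ θ)
    (hlist : ∀ k, k ≤ k₁ → m ≤ S.β0 k) (hrem : RemainderConst S γ₀ r) (hr : r < m - c₀ * θ ^ k₁ * (1 + θ))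
    (hcont : BetaContH γ₀ β) (hup : BetaUpperH β' γ₀ β) : B12.Thm2Printed C L :=
  thm2Printed_of_evMarginConst hgen hL S hγ₀ hθ0 hθ1 (hconv.evGeomRate k₁) hlist hrem hr hcont hup

/-! ### Non-vacuity of the eventual × constant hypotheses (§11) with a rate that FAILS below the threshold -/

namespace Witness

/-- The hypotheses of `thm2Printed_of_evMarginConst` other than the DAG, (C), (U) are jointly satisfiable by one-loop
coefficients with NO useful rate at `k = 0`: `β_{k+1} ≡ β⁰_{k+1}` = `2` at `k = 0` and `1` for `k ≥ 1`, `β¹ ≡ 0`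
(`r = 0`), `EvGeomRate β⁰ 1 0 0 1` (exact from the threshold `k₁ = 1`, while `|β⁰_1 − 1| = 1` — no `GeomRate β⁰ 1 0 θ`),
list `m = 1 ≤ β⁰_{k+1}` for `k ≤ 1`, `γ₀ = 1`, the one condition `0 < 1 − 0`. [folklore] -/
theorem evMarginConst_nonvacuous :
    ∃ (β : HBeta) (S : B12Beta.OneLoopSplit β) (k₁ : ℕ) (γ₀ binf c₀ θ m r : ℝ),
      0 < γ₀ ∧ 0 ≤ θ ∧ θ ≤ 1 ∧ EvGeomRate S.β0 binf c₀ θ k₁ ∧ (∀ k, k ≤ k₁ → m ≤ S.β0 k) ∧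
      RemainderConst S γ₀ r ∧ r < m - c₀ * θ ^ k₁ * (1 + θ) ∧ ¬ GeomRate S.β0 binf c₀ θ := by
  refine ⟨fun k _ => if k = 0 then 2 else 1,
    ⟨fun k => if k = 0 then 2 else 1, fun _ _ => 0, fun _ _ => (add_zero _).symm, fun _ _ _ => rfl⟩,
    1, 1, 1, 0, 0, 1, 0, one_pos, le_rfl, zero_le_one, ?_, ?_, ?_, by norm_num, ?_⟩
  · intro k hk
    have hk0 : k ≠ 0 := by omega
    show |(if k = 0 then (2 : ℝ) else 1) - 1| ≤ 0 * 0 ^ k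
    simp [hk0]
  · intro k _
    show (1 : ℝ) ≤ if k = 0 then 2 else 1
    split_ifs <;> norm_num
  · intro k p _
    show |(0 : ℝ)| ≤ 0
    simp
  · intro h
    have h0 := h 0
    change |(if (0 : ℕ) = 0 then (2 : ℝ) else 1) - 1| ≤ 0 * 0 ^ 0 at h0
    norm_num at h0

end Witness

end EventualConst

end

end Literature.MathematicalPhysics.QuantumFieldTheory.Balaban1983to89.Beta.RemainderConstCertified
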